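import Literature.Computability.QuantumComplexity.PauliRotationPropagation
import Mathlib.Analysis.Normed.Algebra.MatrixExponential
import Mathlib.Analysis.SpecialFunctions.Trigonometric.Arctan
import Mathlib.Analysis.MeanInequalities
import Mathlib.Combinatorics.SimpleGraph.Finite
import Mathlib.Combinatorics.SimpleGraph.Clique
import Mathlib.Algebra.BigOperators.Ring.Finset
import HarnessLib

/-!
# QAOA for MaxCut: the level-1 closed form of `⟨C_{uv}⟩` (Wang–Hadfield–Jiang–Rieffel 2018, Theorem 1); the levels `M_p`, the light cone and the concentration bound (Farhi–Goldstone–Gutmann 2014, §§1–3)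

Topic `Literature/Computability/QuantumComplexity` (pub-qadeq lane). The Quantum Approximate
Optimization Algorithm (QAOA, Farhi–Goldstone–Gutmann 2014) is the ansatz behind a large share of the
'quantum advantage in optimisation' claims typed in the cell's register (QAOA Max-Cut / Max-k-Cut
approximation-ratio rows, fixed-point-QAOA factoring, pilot-wave/classical samplers of shallow QAOA
circuits); before this file the tree had NO declaration about QAOA (`lean search` for
'QAOA / Hadfield / Gutmann / alternating operator / variational quantum': 0 hits, 2026-08-24). This
file fixes FGG's definitions of the level-`p` objects at `p = 1` for MaxCut on an arbitrary finite
simple graph and PROVES the closed form of the level-1 expectation value of every edge term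
(Wang–Hadfield–Jiang–Rieffel, Theorem 1) together with its corollaries for triangle-free regular
graphs (Corollary 1: the value, its maximum over the angles via AM–GM, the optimal angles
`(arctan(1/√d), π/8)`, the ring-of-disagrees value `3/4` of FGG, the `0.692` of triangle-free
3-regular graphs, and the `1/√e` lower bound).

HONEST FRAMING: instance-level adjudication of specific advantage claims; no claim about BQP vs
BPP or the summit. These are exact finite identities about the level-1 ansatz; nothing here says how
well QAOA at higher depth performs, how hard its output distribution is to sample, or how any
classical or quantum device performs on any instance. The closed form is itself a (trivial)
classical algorithm for `F₁(γ, β)` — the paper's remark “for an arbitrary graph the expectation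
value `F(γ, β)` may be efficiently computed classically, while to find an actual bit string realizing
an approximate solution, quantum computation … is required”.

## Sources (held texts, read at the cited places)

* [FarhiGoldstoneGutmann2014] E. Farhi, J. Goldstone, S. Gutmann, *A Quantum Approximate
  Optimization Algorithm*, arXiv:1411.4028 (2014) (`lit read arxiv:1411.4028`, tex chunks p0003–p0004,
  p0007–p0008). §1, eqs. (1)–(8) (equation numbers counted in the arXiv source, whose displays are
  single numbered equations): “`C(z) = Σ_α C_α(z)`” (1); “`U(C, γ) = e^{−iγC} = ∏_α e^{−iγC_α}` … All
  of the terms in this product commute because they are diagonal in the computational basis” (2);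
  “`B = Σ_j σ^x_j`” (3); “`U(B, β) = e^{−iβB} = ∏_j e^{−iβσ^x_j}`” (4); “`|s⟩ = 2^{−n/2} Σ_z |z⟩`” (5);
  “`|γ, β⟩ = U(B, β_p) U(C, γ_p) ⋯ U(B, β₁) U(C, γ₁) |s⟩`” (6); “`F_p(γ, β) = ⟨γ, β| C |γ, β⟩`” (7);
  “`M_p = max_{γ,β} F_p(γ, β)`” (8); “Note that the maximization at `p − 1` can be viewed as a
  constrained maximization at `p` so `M_p ≥ M_{p−1}`” (9); “`lim_{p→∞} M_p = max_z C(z)`” (10);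
  “Because `C` has integer eigenvalues we can restrict `γ` to lie between `0` and `2π`”; “Measure in
  the computational basis to get a string `z` and evaluate `C(z)` … The mean of `C(z)` for strings
  obtained in this way is `M_p`”; §2: “Repeating gives a sample of values of `C(z)` between `0` and
  `+m` whose mean is `F_p(γ, β)`. An outcome of at least `F_p(γ, β) − 1` will be obtained with
  probability `1 − 1/m` with order `m log m` repetitions.” §2 (Fixed `p` algorithm, MaxCut): “`C = Σ_{⟨jk⟩} C_{⟨jk⟩}`,
  `C_{⟨jk⟩} = ½(−σ^z_j σ^z_k + 1)`”, “`F_p(γ,β) = Σ_{⟨jk⟩} ⟨s| U†(C,γ₁) ⋯ U†(B,β_p) C_{⟨jk⟩} U(B,β_p) ⋯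
  U(C,γ₁) |s⟩`” (display (13)), the operator `U†(C,γ₁)⋯U†(B,β_p) C_{⟨jk⟩} U(B,β_p)⋯U(C,γ₁)` (display
  (14)): “This operator only involves qubits `j` and `k` and those qubits whose distance on the graph
  from `j` or `k` is less than or equal to `p`. To see this consider `p = 1` where the previous
  expression is `U†(C,γ₁) U†(B,β₁) C_{⟨jk⟩} U(B,β₁) U(C,γ₁)` (15). The factors in the operator
  `U(B, β₁)` which do not involve qubits `j` or `k` commute through `C_{⟨jk⟩}` and we get
  `U†(C,γ₁) e^{iβ₁(σ^x_j+σ^x_k)} C_{⟨jk⟩} e^{−iβ₁(σ^x_j+σ^x_k)} U(C,γ₁)` (16). Any factors in the operator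
  `U(C, γ₁)` which do not involve qubits `j` or `k` will commute through and cancel out. So the
  operator in equation (16) only involves the edge `⟨jk⟩` and edges adjacent to `⟨jk⟩`, and qubits on
  those edges. For any `p` we see that the operator in (14) only involves edges at most `p` steps away
  from `⟨jk⟩` and qubits on those edges”, “`|s⟩ = |+⟩₁|+⟩₂…|+⟩_n` so each term in equation (13)
  depends only on the subgraph involving qubits `j` and `k` and those at a distance no more than `p`
  away” (display numbers (13)–(16) as labelled in the tex source); “For a graph with maximum degree
  `v`, the numbers of qubits in this tree is `q_tree = 2[((v−1)^{p+1} − 1)/((v−1) − 1)]` (26) (or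
  `2p + 2` if `v = 2`)”. §3 (Concentration, tex chunk p0006): “`⟨γ,β|C²|γ,β⟩ − ⟨γ,β|C|γ,β⟩² =
  Σ_{⟨jk⟩,⟨j′k′⟩} [⟨s|U†⋯C_{⟨jk⟩}C_{⟨j′k′⟩}⋯U|s⟩ − ⟨s|U†⋯C_{⟨jk⟩}⋯U|s⟩·⟨s|U†⋯C_{⟨j′k′⟩}⋯U|s⟩]`” (29);
  “If the subgraphs `g(j,k)` and `g(j′,k′)` do not involve any common qubits, the summand in (29)
  will be 0. The subgraphs `g(j,k)` and `g(j′,k′)` will have no common qubits as long as there is no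
  path in the instance graph from `⟨jk⟩` to `⟨j′k′⟩` of length `2p + 1` or shorter. From (26) with `p`
  replaced by `2p + 1` we see that for each `⟨jk⟩` there are at most `2[((v−1)^{2p+2} − 1)/((v−1) −
  1)]` edges `⟨j′k′⟩` which could contribute to the sum in (29) (or `4p + 4` if `v = 2`) and
  therefore `⟨γ,β|C²|γ,β⟩ − ⟨γ,β|C|γ,β⟩² ≤ 2[((v−1)^{2p+2} − 1)/((v−1) − 1)] · m` (27) since each
  summand is at most `1` in norm. For `v` and `p` fixed we see that the standard deviation of `C(z)`
  is at most of order `√m`.” §4 (The ring of disagrees):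
  “we find that for `p = 1, 2, 3, 4, 5` and `6` the maxima are `3/4, 5/6, …`”. Abstract/§5: “For
  `p = 1`, on 3-regular graphs the quantum algorithm always finds a cut that is at least 0.6924 times
  the size of the optimal cut.”
* [WangHadfieldJiangRieffel2018] Z. Wang, S. Hadfield, Z. Jiang, E. G. Rieffel, *Quantum approximate
  optimization algorithm for MaxCut: A fermionic view*, Phys. Rev. A 97, 022304 (2018) =
  arXiv:1706.02998 (`lit read arxiv:1706.02998`, tex chunks p0004–p0006, p0013; displays cited by
  section and position — the held text is the tex source without visible equation numbers). §2
  (Recap): “`U_C(γ) ≡ exp[−iγ H_C]`, `U_B(β) ≡ exp[−iβ H_B]`”, “`ρ₀ = |ψ₀⟩⟨ψ₀| = ∏_j ½(1 + σ^x_j)`”,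
  “`U = U_B(β_p)U_C(γ_p) ⋯ U_B(β₁)U_C(γ₁)`”, “`F(γ, β) = tr[H_C U ρ₀ U†]`”. §3 (QAOA₁ for MaxCut):
  “`C = ½ Σ_{(i,j)∈E} (1 − z_i z_j)` where `z_i`, `z_j` … assume value `+1` or `−1`”, “`H_C = Σ_{⟨uv⟩∈E}
  C_{uv}`, `C_{uv} = ½(I − σ^z_u σ^z_v)`”, “`F(γ,β) ≡ Σ_{⟨uv⟩∈E} ⟨C_{uv}⟩` where `⟨C_{uv}⟩ := tr[C_{uv} U
  ρ₀ U†]`”; **Theorem 1.** “For QAOA with `p = 1`, for each edge `⟨uv⟩`,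
  `⟨C_{uv}⟩ = ½ + ¼ (sin 4β sin γ)(cos^{d_u} γ + cos^{d_v} γ) − ¼ (sin² 2β cos^{d_u+d_v−2λ_{uv}} γ)(1 −
  cos^{λ_{uv}} 2γ)`, where `d_u + 1` and `d_v + 1` are the degrees of vertices `u` and `v`,
  respectively, and `λ_{uv}` is the number of triangles in the graph containing edge `⟨uv⟩`”; “the
  overall expectation value is `F(γ,β) = Σ_{(d₁,d₂,λ)} ⟨C_{uv}⟩ χ(d₁,d₂,λ)` … Thus, for an arbitrary
  graph the expectation value `F(γ, β)` may be efficiently computed classically”; **Corollary 1.**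
  “For a triangle-free `(d+1)`-regular graph, … `F(γ,β) = |E|/2 (1 + sin 4β sin γ cos^d γ)` with
  maximum `F* = |E|/2 (1 + (1/√(d+1)) (d/(d+1))^{d/2}) =: C^reg_max(d)`. For any such graph, one
  optimal pair of angles is `(γ, β) = (arctan(1/√d), π/8)`.” “Notice that `(d/(d+1))^d > 1/e`, the
  optimal approximation ratio is lower-bounded as `r > ½(1 + (1/√e)(1/√(d+1)))`”; “[the ring] yields
  the approximation ratio 0.75 at `(β,γ) = (π/8, π/4)`, reproducing the results in [Farhi2014]. For
  triangle-free 3-regular graph (`d = 2`), the ratio is 0.692”. **Appendix A (Proof of Theorem 1)**: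
  “Let `c = cos 2β` and `s = sin 2β`. We have `e^{iβB} σ^z_uσ^z_v e^{−iβB} = c² σ^z_uσ^z_v + sc(σ^z_uσ^y_v
  + σ^y_uσ^z_v) + s² σ^y_uσ^y_v`. The first term `σ^z_uσ^z_v` commutes with `C` and does not contribute
  … Let `c' = cos γ` and `s' = sin γ`. … `tr[ρ₀ e^{iγC} σ^y_uσ^z_v e^{−iγC}] = −s' c'^d`. By symmetry,
  `tr[ρ₀ e^{iγC} σ^z_uσ^y_v e^{−iγC}] = −s' c'^e` … `tr[ρ₀ e^{iγC} σ^y_uσ^y_v e^{−iγC}] = ½ c'^{d+e−2f}(1 −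
  cos^f 2γ)` … Putting this all together, `⟨C_{uv}⟩ = ½ + ½ s c s'(c'^d + c'^e) − ¼ s² c'^{d+e−2f}(1 −
  cos^f 2γ)`.”

## What is formalised, and how the printed proof is followed

Register = `V → Bool` for the finite vertex type `V` of `G : SimpleGraph V` (the tree's qubit
convention, `PauliExpansion.lean`: `Pauli`, `pauliString`, `tensorAll`; `PauliRotationPropagation.lean`:
`pauliRot`, `exp_eq_pauliRot`). All operators are `Matrix (V → Bool) (V → Bool) ℂ`:

* `cutValue G x` = `C(x)`, the number of cut edges (FGG (1) for MaxCut); `sitePauli Q w` = `σ^Q_w`;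
  `edgeTerm ⟨ab⟩ = ½(1 − σ^z_a σ^z_b)`; `costOp G = Σ_{e∈E} edgeTerm e` (`= diagonal C`,
  `costOp_eq_diagonal`); `mixOp = Σ_w σ^x_w`; `costUnitary G γ` = `U(C,γ)` written as the diagonal
  matrix `diag(e^{−iγC(x)})` and PROVED equal to the matrix exponential `exp(−iγ C)`
  (`costUnitary_eq_exp`); `mixUnitary β = ⊗_w (cos β·1 − i sin β·σ^x)` PROVED equal to `exp(−iβB)`
  (`mixUnitary_eq_exp`, via the tree's `exp_eq_pauliRot` and `Matrix.exp_add_of_commute`);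
  `initialState = ⊗_w ½(1 + σ^x_w)` (WHJR's `ρ₀`), PROVED to be `|s⟩⟨s|` for FGG's uniform superposition
  (`initialState_eq_vecMulVec`); `qaoaUnitary = U(B,β)U(C,γ)`; `edgeExpect = tr[C_{uv} Uρ₀U†]`;
  `levelOne = tr[C Uρ₀U†] = F₁(γ,β)`, PROVED equal to `⟨γ,β|C|γ,β⟩` (`levelOne_eq_expectation`).
* The printed proof of Theorem 1 is mirrored: `mixUnitary_conj_ZZ` is the display
  `e^{iβB}σ^z_uσ^z_v e^{−iβB} = c²ZZ + sc(ZY + YZ) + s²YY`; `trace_ZZ_phaseState`, `trace_YZ_phaseState`,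
  `trace_ZY_phaseState`, `trace_YY_phaseState` are the three traces `0`, `−s'c'^{d}`, `−s'c'^{e}`,
  `½c'^{d+e−2f}(1 − cos^f 2γ)` against `W(γ) = e^{−iγC}ρ₀e^{iγC}` (`phaseState`). Where the paper expands
  the operator products and keeps “the only term that can contribute” (the one proportional to
  `∏σ^x`), we evaluate the same trace in the computational basis: a Pauli word has one nonzero entry
  per row (`pauliString_apply_flipPattern`), the diagonal phases of the flipped configuration differ
  from the unflipped ones exactly by the constraints touching the flipped vertex
  (`cutValue_flipAt`, `cutValue_flipAt_flipAt` — the paper's “only the `d` constraints `C_u` … and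
  the `e` constraints `C_v` contribute”), and after the change of variables `ζ_w ↦ ζ_uζ_w`
  (`shearEquiv`) the register average factorises site by site (`avg_prod_eq`); the surviving factors
  are the paper's `−s'c'^d` and, for `σ^yσ^y`, the odd binomial sum over the `f = λ_{uv}` common
  neighbours, which we obtain directly in the closed form `½((c'²+s'²)^f − (c'²−s'²)^f)`.
* `edgeExpect_eq` is **Theorem 1** (with `levelOneEdge d_u d_v λ γ β` the printed right-hand side,
  `d_u = deg u − 1`, `λ_{uv} = edgeTriangles G u v = |N(u) ∩ N(v)|`); `levelOne_eq_sum_edgeFormula`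
  is `F = Σ_{⟨uv⟩} ⟨C_{uv}⟩` in closed form. **Corollary 1**: `edgeExpect_eq_of_regular_cliqueFree`,
  `levelOne_eq_of_regular_cliqueFree` (`F = |E|/2 (1 + sin 4β sin γ cos^d γ)`), `regularEdge_le`
  (every angle pair gives at most `½(1 + regularMax d)`, `regularMax d = (1/√(d+1))(√(d/(d+1)))^d =
  (1/√(d+1))(d/(d+1))^{d/2}`; the maximisation is the AM–GM inequality `x(1−x)^d ≤ d^d/(d+1)^{d+1}`,
  `mul_pow_le_max`), `regularEdge_optimal` (attained at `(arctan(1/√d), π/8)`, `d ≥ 1`),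
  `regularMax_one` / `regularEdge_one_le` / `regularEdge_one_optimal` (ring of disagrees: `3/4` at
  `(β,γ) = (π/8,π/4)`), `regularMax_two` / `regularMax_two_bounds` (`½(1 + 2/(3√3)) ∈ (0.6924, 0.6925)`),
  `regularMax_ge` (`regularMax d ≥ 1/(√e √(d+1))`, from `1 + 1/d ≤ e^{1/d}`; the paper states the
  strict form).
* **The light cone (FGG §2, general level `p`)**, section `LightCone`: `qaoaUnitaryP G p γ β` is the
  level-`p` circuit `U(B,β_p)U(C,γ_p)⋯U(B,β₁)U(C,γ₁)` (FGG (6)), `levelP` / `edgeExpectP` are `F_p` and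
  its edge terms (FGG (7), (13)); `ActsWithin S M` says that `M` involves only the qubits in `S`
  (commutes with every single-site Pauli elsewhere) and `touching G T` is `G` restricted to the edges
  meeting `T`. The two cancellations of FGG's §2 are `mixUnitary_conj_eq` (“the factors in `U(B, β₁)`
  which do not involve qubits `j` or `k` commute through”) and `costUnitary_conj_eq` (“any factors in
  `U(C, γ₁)` which do not involve qubits `j` or `k` will commute through and cancel out”), proved via
  `Commute.exp_right` on the exponential forms; `lightCone` is the induction over the levels: `U† O U`
  involves only the qubits within distance `p` of the support of `O` (`ball G p S`) and is unchanged
  when `G` is replaced by `touching G T` for any `T ⊇ ball G (p−1) S`; `edgeExpectP_eq_touching` is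
  the consequence for the terms of `F_p` (“each term … depends only on the subgraph involving qubits
  `j` and `k` and those at a distance no more than `p` away”).
* **Concentration (FGG §3)**, section `Concentration`: the graph-ball combinatorics behind (26)
  (`ball` symmetry and concatenation; the shell counts `card_sdiff_le`; **`card_ball_le`** is the tree
  count (26), `|B_p(⟨jk⟩)| ≤ 2 Σ_{i≤p} (v−1)^i`, for maximum degree `v`; `card_filter_meets_ball_le` /
  **`card_filter_not_disjoint_le`** the edge count “(26) with `p` replaced by `2p + 1`”); the Pauli
  side of “no common qubits ⇒ the summand is 0”: an operator involving only `S` has Pauli coefficients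
  supported in `S` (`ActsWithin.pauliCoeff_eq_zero`, `ActsWithin.eq_sum`, from the tree's Pauli
  expansion `PauliPath.eq_inv_smul_sum_pauliCoeff_smul` and `pauliCoeff_single_conj`) and
  `ρ₀ = ⊗½(1+σ^x)` is a product, so **`trace_mul_mul_initialState`**: `tr[ABρ₀] = tr[Aρ₀]tr[Bρ₀]` for
  disjoint supports; with the light cone this gives **`trace_edgeTerm_mul_edgeTerm_mul_finalStateP`**
  (the summand of (29) vanishes for edges with disjoint `p`-balls); `levelPSq_sub_sq` is display (29);
  `norm_cov_le_one` is “each summand is at most 1 in norm” (via `finalStateP_eq_vecMulVec`,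
  `star_qaoaStateP_dotProduct` — the circuit is unitary, `qaoaUnitaryP_conjTranspose_mul_self` — and
  `0 ≤ C_e, C_eC_{e′} ≤ 1` diagonal); **`levelPSq_sub_sq_le` is eq. (27)**:
  `‖⟨C²⟩ − ⟨C⟩²‖ ≤ 2 (Σ_{i=0}^{2p+1} (v−1)^i) · |E|`, the geometric sum being the printed bracket for
  `v ≥ 3` and the printed `4p + 4` for `v = 2`. Also `levelP_eq_expectation` (`F_p = ⟨γ,β|C|γ,β⟩`).
* **The levels and the measurement statistics (FGG §1)**, section `Levels`: `outcomeProb` is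
  `P(z) = |⟨z|γ,β⟩|²` (`sum_outcomeProb`), `meanCut = Σ_z C(z)P(z)` with **`levelP_eq_meanCut`**
  (`F_p` is the mean of the measured cut) and `levelPSq_eq_sum`; `0 ≤ F_p ≤ m` and `F_p ≤ max_z C(z)`
  (`meanCut_nonneg`, `meanCut_le_card`, `meanCut_le_maxCut`); `qaoaUnitaryP_snoc_zero` /
  `levelP_snoc_zero` (level `p` is level `p + 1` at `γ_{p+1} = β_{p+1} = 0`), `maxLevel` = `M_p` (8) as
  the supremum over all real angles, **`maxLevel_mono` is (9) `M_{p+1} ≥ M_p`**, `maxLevel_le_maxCut`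
  (the trivial half of (10)); `costUnitary_add_two_pi` (`γ`-periodicity); `varCut` with
  `levelPSq_sub_sq_eq_varCut` (the left side of (27) is the variance of the measured cut),
  **`varCut_le`** ((27) for the measured cut), `sum_outcomeProb_filter_le` (Chebyshev) and
  **`sum_outcomeProb_filter_le_of_degree`** (`P(|C(z) − F_p| ≥ t) ≤ 2(Σ_{i≤2p+1}(v−1)^i) m / t²`), and
  the single-shot Markov step `inv_le_sum_outcomeProb_filter` (`P(C(z) ≥ F_p − 1) ≥ 1/(m+1)`) behind
  the “order `m log m` repetitions” sentence.
* NOT formalised: closed forms at levels `p ≥ 2`, the existence of maximising angles in (8) and the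
  limit (10), the `β`-periodicity, the repetition counts (statements about independent runs), the fermionic representation (§§4–8 of WHJR), the
  subgraph-type bookkeeping `F_p = Σ_g w_g f_g` (FGG (24)–(25)), the probabilistic reading of (27)
  (“the sample mean of order `m²` values of `C(z)` will be within 1 of `F_p` with probability
  `1 − 1/m`”, a Chebyshev step over repeated measurements, not modelled here), FGG's `0.6924` for
  3-regular graphs WITH triangles (§5, which needs the isolated-triangle / crossed-square case
  analysis), `lim_p M_p = max C`, and any statement about sampling hardness.

0 named facts, 0 sorry.
-/

noncomputable section

open Matrix Finset

namespace Literature.Computability.QuantumComplexity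

namespace QAOA

variable {V : Type*} [Fintype V] [DecidableEq V]

/-! ### Spins, cuts and the cutValue function -/

/-- The `σ^z`-eigenvalue `ζ_w(x) = (−1)^{x_w} ∈ {+1, −1}` of the basis state `|x⟩` at vertex `w`
(the paper's binary variables `z_i ∈ {+1, −1}`). [cite: WangHadfieldJiangRieffel2018, §3 (C = ½Σ(1 −
z_i z_j), z_i = ±1)] -/
def zspin (x : V → Bool) (w : V) : ℂ := if x w then -1 else 1

omit [Fintype V] [DecidableEq V] in
/-- Plumbing: `ζ_w(x) = −1` when `x_w = 1`. [folklore] -/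
@[simp] private theorem zspin_true {x : V → Bool} {w : V} (h : x w = true) : zspin x w = -1 := by
  simp [zspin, h]

omit [Fintype V] [DecidableEq V] in
/-- Plumbing: `ζ_w(x) = 1` when `x_w = 0`. [folklore] -/
@[simp] private theorem zspin_false {x : V → Bool} {w : V} (h : x w = false) : zspin x w = 1 := by
  simp [zspin, h]

omit [Fintype V] [DecidableEq V] in
/-- Plumbing: `ζ² = 1`. [folklore] -/
private theorem zspin_mul_self (x : V → Bool) (w : V) : zspin x w * zspin x w = 1 := by
  unfold zspin; split_ifs <;> norm_num

omit [Fintype V] [DecidableEq V] in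
/-- Plumbing: `ζ² = 1`. [folklore] -/
private theorem zspin_sq (x : V → Bool) (w : V) : zspin x w ^ 2 = 1 := by
  rw [sq, zspin_mul_self]

omit [Fintype V] [DecidableEq V] in
/-- Plumbing: `ζ` is real. [folklore] -/
private theorem star_zspin (x : V → Bool) (w : V) : star (zspin x w) = zspin x w := by
  unfold zspin; split_ifs <;> simp

/-- The cut indicator of an unordered pair `{a, b}` under the two-colouring `x`: `1` if `x_a ≠ x_b`,
else `0` (the MaxCut clause `C_α(z)` of the edge). [cite: FarhiGoldstoneGutmann2014, eq. (1) and §2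
(MaxCut clauses C_⟨jk⟩)] [cite: WangHadfieldJiangRieffel2018, §3 (C = ½ Σ_{(i,j)∈E} (1 − z_i z_j))]
-/
def cutInd (x : V → Bool) : Sym2 V → ℕ :=
  Sym2.lift ⟨fun a b => if x a = x b then 0 else 1, fun a b => by
    simp only [eq_comm]⟩

omit [Fintype V] [DecidableEq V] in
/-- Unfolding of the cut indicator on `s(a, b)`. [cite: WangHadfieldJiangRieffel2018, §3 (C = ½
Σ_{(i,j)∈E} (1 − z_i z_j))] -/
@[simp] theorem cutInd_mk (x : V → Bool) (a b : V) :
    cutInd x s(a, b) = if x a = x b then 0 else 1 := rfl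

omit [Fintype V] [DecidableEq V] in
/-- In spin variables the cut indicator is `(1 − ζ_a ζ_b)/2`. [cite: WangHadfieldJiangRieffel2018,
§3 (C = ½ Σ_{(i,j)∈E} (1 − z_i z_j))] -/
theorem cutInd_mk_eq_zspin (x : V → Bool) (a b : V) :
    (cutInd x s(a, b) : ℂ) = (1 - zspin x a * zspin x b) / 2 := by
  rw [cutInd_mk]
  unfold zspin
  cases x a <;> cases x b <;> norm_num

variable (G : SimpleGraph V) [DecidableRel G.Adj]

/-- **The MaxCut objective `C(x)`**: the number of edges of `G` cut by the two-colouring `x` (FGG's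
`C(z) = Σ_α C_α(z)` for the MaxCut clauses). [cite: FarhiGoldstoneGutmann2014, eq. (1) and §2 (C =
Σ_⟨jk⟩ C_⟨jk⟩)] [cite: WangHadfieldJiangRieffel2018, §3 (MaxCut: C = ½ Σ_{(i,j)∈E} (1 − z_i z_j))]
-/
def cutValue (x : V → Bool) : ℕ := ∑ e ∈ G.edgeFinset, cutInd x e

/-! ### Operators on the register `V → Bool` -/

/-- The Pauli word with the letter `Q` at vertex `w` and `I` elsewhere. [folklore] -/
def siteWord (Q : Pauli) (w : V) : V → Pauli := Function.update (fun _ => Pauli.I) w Q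

/-- The single-vertex Pauli operator `σ^Q_w` on the register `V → Bool` (`σ^x_j` of FGG eq. (3),
`σ^z_j` of the edge clauses). [cite: FarhiGoldstoneGutmann2014, eqs. (3)–(4) and §2 (σ^x_j, σ^z_j)]
-/
def sitePauli (Q : Pauli) (w : V) : Matrix (V → Bool) (V → Bool) ℂ := pauliString (siteWord Q w)

omit [Fintype V] in
/-- Letters of the single-site word. [folklore] -/
private theorem siteWord_apply (Q : Pauli) (w i : V) : siteWord Q w i = if i = w then Q else Pauli.I := by
  unfold siteWord; by_cases h : i = w
  · subst h; simp
  · simp [h]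

/-- `σ^z_w` is diagonal in the computational basis with entries `ζ_w(x)`. [cite:
FarhiGoldstoneGutmann2014, §1 (“we view (1) as an operator which is diagonal in the computational
basis”)] -/
theorem sitePauli_Z_eq_diagonal (w : V) : sitePauli Pauli.Z w = diagonal fun x => zspin x w := by
  ext x y
  rw [sitePauli, pauliString_eq, tensorAll_apply, diagonal_apply]
  by_cases hxy : x = y
  · subst hxy
    rw [if_pos rfl]
    rw [← Finset.prod_erase_mul _ _ (Finset.mem_univ w)]
    have h1 : ∏ i ∈ Finset.univ.erase w, (siteWord Pauli.Z w i).mat (x i) (x i) = 1 := by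
      refine Finset.prod_eq_one fun i hi => ?_
      rw [siteWord_apply, if_neg (Finset.ne_of_mem_erase hi)]
      simp
    rw [h1, one_mul, siteWord_apply, if_pos rfl]
    unfold zspin
    cases x w <;> simp
  · rw [if_neg hxy]
    obtain ⟨i, hi⟩ : ∃ i, x i ≠ y i := by
      by_contra hc
      push Not at hc
      exact hxy (funext hc)
    refine Finset.prod_eq_zero (Finset.mem_univ i) ?_
    rw [siteWord_apply]
    by_cases hiw : i = w
    · rw [if_pos hiw]; simp [hi]
    · rw [if_neg hiw]; simp [hi]

/-- `σ^z_a σ^z_b` is diagonal with entries `ζ_a(x) ζ_b(x)`. [cite: FarhiGoldstoneGutmann2014, §2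
(C_⟨jk⟩ = ½(−σ^z_j σ^z_k + 1) is diagonal)] -/
theorem sitePauli_Z_mul_sitePauli_Z (a b : V) :
    sitePauli Pauli.Z a * sitePauli Pauli.Z b = diagonal fun x => zspin x a * zspin x b := by
  rw [sitePauli_Z_eq_diagonal, sitePauli_Z_eq_diagonal, diagonal_mul_diagonal]

/-- Plumbing: `σ^z_a` and `σ^z_b` commute. [folklore] -/
private theorem sitePauli_Z_comm (a b : V) : sitePauli Pauli.Z a * sitePauli Pauli.Z b = sitePauli Pauli.Z b * sitePauli Pauli.Z a := by
  rw [sitePauli_Z_mul_sitePauli_Z, sitePauli_Z_mul_sitePauli_Z]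
  simp_rw [mul_comm]

/-- **The edge term `C_{⟨ab⟩} = ½(1 − σ^z_a σ^z_b)`** of the MaxCut cost Hamiltonian, as a function
of the unordered pair. [cite: FarhiGoldstoneGutmann2014, §2 (C_⟨jk⟩ = ½(−σ^z_j σ^z_k + 1))] [cite:
WangHadfieldJiangRieffel2018, §3 (C_uv = ½(I − σ^z_u σ^z_v))] -/
def edgeTerm : Sym2 V → Matrix (V → Bool) (V → Bool) ℂ :=
  Sym2.lift ⟨fun a b => (1 / 2 : ℂ) • (1 - sitePauli Pauli.Z a * sitePauli Pauli.Z b), fun a b => by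
    simp only [sitePauli_Z_comm a b]⟩

/-- Unfolding of the edge term on `s(a, b)`. [cite: WangHadfieldJiangRieffel2018, §3 (C_uv = ½(I −
σ^z_u σ^z_v))] -/
theorem edgeTerm_mk (a b : V) :
    edgeTerm s(a, b) = (1 / 2 : ℂ) • (1 - sitePauli Pauli.Z a * sitePauli Pauli.Z b) := rfl

/-- The edge term is diagonal with the cut indicator of the edge on the diagonal. [cite:
FarhiGoldstoneGutmann2014, §1–§2 (C is diagonal in the computational basis; C_⟨jk⟩ = ½(−σ^z_j σ^z_k
+ 1))] -/
theorem edgeTerm_eq_diagonal (e : Sym2 V) :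
    edgeTerm e = diagonal fun x => (cutInd x e : ℂ) := by
  induction e using Sym2.ind with
  | h a b =>
    rw [edgeTerm_mk, sitePauli_Z_mul_sitePauli_Z]
    ext x y
    rw [Matrix.smul_apply, Matrix.sub_apply, Matrix.one_apply, diagonal_apply, diagonal_apply,
      cutInd_mk_eq_zspin, smul_eq_mul]
    split_ifs <;> ring

/-- **The cost Hamiltonian `C = H_C = Σ_{⟨ab⟩ ∈ E} C_{⟨ab⟩}`.** [cite: FarhiGoldstoneGutmann2014, §2
(C = Σ_⟨jk⟩ C_⟨jk⟩)] [cite: WangHadfieldJiangRieffel2018, §3 (H_C = Σ_{⟨uv⟩∈E} C_uv)] -/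
def costOp : Matrix (V → Bool) (V → Bool) ℂ := ∑ e ∈ G.edgeFinset, edgeTerm e

/-- `C` is diagonal in the computational basis with entries `C(x)`. [cite:
FarhiGoldstoneGutmann2014, §1 (“we view (1) as an operator which is diagonal in the computational
basis”)] -/
theorem costOp_eq_diagonal : costOp G = diagonal fun x => (cutValue G x : ℂ) := by
  rw [costOp]
  simp_rw [edgeTerm_eq_diagonal]
  have h := map_sum (Matrix.diagonalAddMonoidHom (V → Bool) ℂ)
    (fun e => fun x : V → Bool => (cutInd x e : ℂ)) G.edgeFinset
  simp only [Matrix.diagonalAddMonoidHom_apply] at h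
  rw [← h]
  congr 1
  funext x
  rw [cutValue, Nat.cast_sum, Finset.sum_apply]

/-- **The mixing Hamiltonian `B = Σ_w σ^x_w`.** [cite: FarhiGoldstoneGutmann2014, eq. (3)] [cite:
WangHadfieldJiangRieffel2018, §2 (H_B = Σ_j σ^x_j)] -/
def mixOp : Matrix (V → Bool) (V → Bool) ℂ := ∑ w, sitePauli Pauli.X w

/-- **The phase separator `U(C, γ) = e^{−iγC}`**, written as the diagonal matrix `diag(e^{−iγ
C(x)})` that it is (`costUnitary_eq_exp` identifies it with the matrix exponential). [cite:
FarhiGoldstoneGutmann2014, eq. (2) (U(C, γ) = e^{−iγC}, diagonal in the computational basis)] [cite: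
WangHadfieldJiangRieffel2018, §2 (U_C(γ) ≡ exp[−iγ H_C])] -/
def costUnitary (γ : ℝ) : Matrix (V → Bool) (V → Bool) ℂ :=
  diagonal fun x => Complex.exp (-(Complex.I * γ * (cutValue G x : ℂ)))

/-- The one-qubit mixer factor `e^{−iβσ^x} = cos β · 1 − i sin β · σ^x`. [cite:
FarhiGoldstoneGutmann2014, eq. (4) (e^{−iβσ^x_j})] -/
def mixerGate (β : ℝ) : Matrix Bool Bool ℂ :=
  (Real.cos β : ℂ) • (1 : Matrix Bool Bool ℂ) - (Complex.I * (Real.sin β : ℂ)) • Pauli.X.mat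

/-- **The mixer `U(B, β) = e^{−iβB} = ∏_w e^{−iβσ^x_w}`**, written as the tensor product `⊗_w (cos β
· 1 − i sin β · σ^x)` (`mixUnitary_eq_exp` identifies it with the matrix exponential). [cite:
FarhiGoldstoneGutmann2014, eq. (4)] [cite: WangHadfieldJiangRieffel2018, §2 (U_B(β) ≡ exp[−iβ H_B])]
-/
def mixUnitary (β : ℝ) : Matrix (V → Bool) (V → Bool) ℂ := tensorAll fun _ : V => mixerGate β

/-- **The initial state `ρ₀ = |ψ₀⟩⟨ψ₀| = ∏_w ½(1 + σ^x_w)`** (the projector onto the uniform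
superposition `|s⟩`, `initialState_eq_vecMulVec`). [cite: WangHadfieldJiangRieffel2018, §2 (ρ₀ =
|ψ₀⟩⟨ψ₀| = ∏_j ½(1 + σ^x_j))] [cite: FarhiGoldstoneGutmann2014, eq. (5) and §2 (|s⟩ = |+⟩₁…|+⟩_n)]
-/
def initialState : Matrix (V → Bool) (V → Bool) ℂ :=
  tensorAll fun _ : V => (1 / 2 : ℂ) • ((1 : Matrix Bool Bool ℂ) + Pauli.X.mat)

/-- **The level-1 QAOA circuit `U = U(B, β) U(C, γ)`.** [cite: FarhiGoldstoneGutmann2014, eq. (6) (p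
= 1)] [cite: WangHadfieldJiangRieffel2018, §2 (U = U_B(β_p)U_C(γ_p)⋯U_B(β₁)U_C(γ₁), p = 1)] -/
def qaoaUnitary (γ β : ℝ) : Matrix (V → Bool) (V → Bool) ℂ := mixUnitary β * costUnitary G γ

/-- The final state `U ρ₀ U†`. [cite: WangHadfieldJiangRieffel2018, §2 (F(γ, β) = tr[H_C U ρ₀ U†])]
-/
def finalState (γ β : ℝ) : Matrix (V → Bool) (V → Bool) ℂ :=
  qaoaUnitary G γ β * initialState * (qaoaUnitary G γ β)ᴴ

/-- **`⟨C_{⟨uv⟩}⟩ := tr[C_{⟨uv⟩} U ρ₀ U†]`**, the level-1 expectation of one edge term. [cite: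
WangHadfieldJiangRieffel2018, §3 (⟨C_uv⟩ := tr[C_uv U ρ₀ U†])] -/
def edgeExpect (γ β : ℝ) (e : Sym2 V) : ℂ := (edgeTerm e * finalState G γ β).trace

/-- **`F(γ, β) = F₁(γ, β) = tr[H_C U ρ₀ U†]`**, the level-1 QAOA expectation of the cut (`= ⟨γ, β| C
|γ, β⟩`, `levelOne_eq_expectation`). [cite: FarhiGoldstoneGutmann2014, eq. (7) (F_p(γ, β) = ⟨γ,
β|C|γ, β⟩, p = 1)] [cite: WangHadfieldJiangRieffel2018, §2 (F(γ, β) = tr[H_C U ρ₀ U†])] -/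
def levelOne (γ β : ℝ) : ℂ := (costOp G * finalState G γ β).trace

/-- **`F(γ, β) = Σ_{⟨uv⟩ ∈ E} ⟨C_{uv}⟩`.** [cite: WangHadfieldJiangRieffel2018, §3 (F(γ,β) ≡
Σ_{⟨uv⟩∈E} ⟨C_uv⟩)] [cite: FarhiGoldstoneGutmann2014, §2 (F_p = Σ_⟨jk⟩ ⟨s|U†⋯C_⟨jk⟩⋯U|s⟩)] -/
theorem levelOne_eq_sum_edgeExpect (γ β : ℝ) :
    levelOne G γ β = ∑ e ∈ G.edgeFinset, edgeExpect G γ β e := by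
  rw [levelOne, costOp, Finset.sum_mul, trace_sum]
  rfl

/-! ### Entries -/

omit [DecidableEq V] in
/-- Entries of `ρ₀`: all equal to `2^{−|V|}` (the projector onto the uniform superposition). [cite:
WangHadfieldJiangRieffel2018, §2 (ρ₀ = ∏_j ½(1 + σ^x_j))] [cite: FarhiGoldstoneGutmann2014, eq. (5)]
-/
theorem initialState_apply (x y : V → Bool) : (initialState : Matrix (V → Bool) (V → Bool) ℂ) x y = ((2 : ℂ) ^ Fintype.card V)⁻¹ := by
  rw [initialState, tensorAll_apply]
  have : ∀ i : V, ((1 / 2 : ℂ) • ((1 : Matrix Bool Bool ℂ) + Pauli.X.mat)) (x i) (y i) = 1 / 2 := by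
    intro i
    rw [Matrix.smul_apply, Matrix.add_apply, Matrix.one_apply, Pauli.mat_X_apply]
    split_ifs <;> simp
  simp_rw [this]
  rw [Finset.prod_const, Finset.card_univ, one_div, inv_pow]

/-- `tr ρ₀ = 1`. [cite: WangHadfieldJiangRieffel2018, §2 (ρ₀ = |ψ₀⟩⟨ψ₀| a density matrix)] -/
theorem trace_initialState : (initialState : Matrix (V → Bool) (V → Bool) ℂ).trace = 1 := by
  simp only [Matrix.trace, diag_apply, initialState_apply, Finset.sum_const, Finset.card_univ,
    Fintype.card_fun, Fintype.card_bool, nsmul_eq_mul]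
  push_cast
  rw [mul_inv_cancel₀ (pow_ne_zero _ two_ne_zero)]


/-! ### Entries of Pauli strings: one nonzero entry per row -/

/-- The basis state reached from `x` by the bit flips of the Pauli word `S` (`σ^x`, `σ^y` flip; `I`,
`σ^z` do not). [folklore] -/
def flipPattern (S : V → Pauli) (x : V → Bool) : V → Bool := fun i => Bool.xor (x i) (S i).flipsBit

/-- The product of the row phases of the Pauli word `S` along the basis state `x` (`⟨x| P_S =
strPhase · ⟨flipPattern S x|`). [folklore] -/
def strPhase (S : V → Pauli) (x : V → Bool) : ℂ := ∏ i, (S i).rowPhase (x i)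

omit [DecidableEq V] in
/-- Entries of a Pauli word on its flip pattern: `⟨x| P_S |flipPattern_S x⟩ = strPhase_S(x)`.
[folklore] -/
private theorem pauliString_apply_flipPattern (S : V → Pauli) (x : V → Bool) :
    pauliString S x (flipPattern S x) = strPhase S x := by
  rw [pauliString_eq, tensorAll_apply]
  simp_rw [Pauli.mat_apply_eq_ite]
  simp only [flipPattern, if_true]
  rfl

omit [DecidableEq V] in
/-- Entries of a Pauli word off its flip pattern vanish. [folklore] -/
private theorem pauliString_apply_of_ne (S : V → Pauli) {x y : V → Bool} (h : y ≠ flipPattern S x) :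
    pauliString S x y = 0 := by
  rw [pauliString_eq, tensorAll_apply]
  simp_rw [Pauli.mat_apply_eq_ite]
  obtain ⟨i, hi⟩ : ∃ i, y i ≠ flipPattern S x i := by
    by_contra hc
    push Not at hc
    exact h (funext hc)
  exact Finset.prod_eq_zero (Finset.mem_univ i) (if_neg hi)

/-- Row sums against a Pauli word collapse to the flip pattern. [folklore] -/
private theorem sum_pauliString_apply_mul (S : V → Pauli) (x : V → Bool) (f : (V → Bool) → ℂ) :
    ∑ y, pauliString S x y * f y = strPhase S x * f (flipPattern S x) := by
  rw [Finset.sum_eq_single (flipPattern S x)]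
  · rw [pauliString_apply_flipPattern]
  · intro y _ hy
    rw [pauliString_apply_of_ne S hy, zero_mul]
  · intro h
    exact absurd (Finset.mem_univ _) h

/-! ### The state after the strPhase separator -/

/-- `W(γ) = U(C, γ) ρ₀ U(C, γ)†`, the state after the phase separator, against which the printed
proof takes its traces `tr[ρ₀ e^{iγC} (·) e^{−iγC}] = tr[(·) W(γ)]`. [cite:
WangHadfieldJiangRieffel2018, App. A (tr[ρ₀ e^{iγC} σ^y_u σ^z_v e^{−iγC}])] -/
def phaseState (γ : ℝ) : Matrix (V → Bool) (V → Bool) ℂ := costUnitary G γ * initialState * (costUnitary G γ)ᴴ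

/-- Entries of `W(γ)`: `2^{−|V|} e^{−iγ C(x)} e^{iγ C(y)}`. [cite: WangHadfieldJiangRieffel2018,
App. A (e^{−iγC} is diagonal)] [cite: FarhiGoldstoneGutmann2014, eq. (2)] -/
theorem phaseState_apply (γ : ℝ) (x y : V → Bool) :
    phaseState G γ x y = ((2 : ℂ) ^ Fintype.card V)⁻¹ *
      (Complex.exp (-(Complex.I * γ * (cutValue G x : ℂ))) * Complex.exp (Complex.I * γ * (cutValue G y : ℂ))) := by
  rw [phaseState, costUnitary, diagonal_conjTranspose, mul_diagonal, diagonal_mul, initialState_apply]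
  rw [Pi.star_apply, Complex.star_def, ← Complex.exp_conj]
  simp only [map_neg, map_mul, Complex.conj_I, Complex.conj_ofReal, Complex.conj_natCast, neg_mul,
    neg_neg]
  ring

/-- **The traces of the printed proof in the computational basis**: for any Pauli word `P`, `tr[P ·
W(γ)] = 2^{−|V|} Σ_x strPhase_P(x) e^{−iγ C(flipPattern_P x)} e^{iγ C(x)}`. [cite:
WangHadfieldJiangRieffel2018, App. A (tr[ρ₀ e^{iγC} σ^y_u σ^z_v e^{−iγC}], tr[ρ₀ e^{iγC} σ^y_u σ^y_v
e^{−iγC}])] -/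
theorem trace_pauliString_mul_phaseState (S : V → Pauli) (γ : ℝ) :
    (pauliString S * phaseState G γ).trace = ((2 : ℂ) ^ Fintype.card V)⁻¹ *
      ∑ x, strPhase S x * (Complex.exp (-(Complex.I * γ * (cutValue G (flipPattern S x) : ℂ))) *
        Complex.exp (Complex.I * γ * (cutValue G x : ℂ))) := by
  simp only [Matrix.trace, diag_apply, Matrix.mul_apply]
  simp_rw [phaseState_apply, sum_pauliString_apply_mul, Finset.mul_sum]
  refine Finset.sum_congr rfl fun x _ => ?_
  ring

/-! ### The Heisenberg-evolved edge term under the mixer -/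

/-- Plumbing: `(e^{−iβσ^x})† = cos β · 1 + i sin β · σ^x`. [folklore] -/
private theorem conjTranspose_mixerGate (β : ℝ) :
    (mixerGate β)ᴴ = (Real.cos β : ℂ) • (1 : Matrix Bool Bool ℂ) + (Complex.I * (Real.sin β : ℂ)) • Pauli.X.mat := by
  rw [mixerGate, conjTranspose_sub, conjTranspose_smul, conjTranspose_smul, conjTranspose_one,
    Pauli.conjTranspose_mat]
  simp only [Complex.star_def, Complex.conj_ofReal, map_mul, Complex.conj_I]
  rw [sub_eq_add_neg, ← neg_smul, neg_mul, neg_neg]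

/-- **`e^{iβσ^x} σ^z e^{−iβσ^x} = cos 2β · σ^z + sin 2β · σ^y`** (the one-qubit content of the first
display of the printed proof, `c = cos 2β`, `s = sin 2β`). [cite: WangHadfieldJiangRieffel2018, App.
A (e^{iβB} σ^z_u σ^z_v e^{−iβB} = c² σ^zσ^z + sc(σ^zσ^y + σ^yσ^z) + s² σ^yσ^y)] -/
theorem mixerGate_conj_Z (β : ℝ) :
    (mixerGate β)ᴴ * Pauli.Z.mat * mixerGate β =
      (Real.cos (2 * β) : ℂ) • Pauli.Z.mat + (Real.sin (2 * β) : ℂ) • Pauli.Y.mat := by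
  rw [conjTranspose_mixerGate, mixerGate]
  ext a b
  simp only [Matrix.add_apply, Matrix.smul_apply, Matrix.sub_apply, Matrix.one_apply, Pauli.mul_apply_bool,
    Pauli.mat_X_apply, Pauli.mat_Z_apply, Pauli.mat_Y_apply, smul_eq_mul, Real.cos_two_mul,
    Real.sin_two_mul]
  have hs : Complex.sin (β : ℂ) ^ 2 = 1 - Complex.cos (β : ℂ) ^ 2 := Complex.sin_sq _
  push_cast
  cases a <;> cases b <;> simp <;> ring_nf <;> simp only [Complex.I_sq, hs] <;> ring

/-- Plumbing: `(e^{−iβσ^x})† e^{−iβσ^x} = 1`. [folklore] -/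
private theorem mixerGate_conj_one (β : ℝ) : (mixerGate β)ᴴ * 1 * mixerGate β = 1 := by
  rw [conjTranspose_mixerGate, mixerGate, Matrix.mul_one]
  ext a b
  simp only [Matrix.add_apply, Matrix.smul_apply, Matrix.sub_apply, Matrix.one_apply, Pauli.mul_apply_bool,
    Pauli.mat_X_apply, smul_eq_mul]
  have hs : Complex.sin (β : ℂ) ^ 2 = 1 - Complex.cos (β : ℂ) ^ 2 := Complex.sin_sq _
  push_cast
  cases a <;> cases b <;> simp <;> ring_nf <;> simp only [Complex.I_sq, hs] <;> ring

omit [DecidableEq V] in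
/-- Plumbing: `U(B, β)† = ⊗_w (e^{−iβσ^x})†`. [folklore] -/
private theorem conjTranspose_mixUnitary (β : ℝ) : (mixUnitary β : Matrix (V → Bool) (V → Bool) ℂ)ᴴ = tensorAll fun _ : V => (mixerGate β)ᴴ := by
  rw [mixUnitary, conjTranspose_tensorAll]

/-- Conjugating a Pauli word by the mixer acts slot by slot (the factors of `U(B, β)` not on the
word's support commute through). [cite: FarhiGoldstoneGutmann2014, §2 (“The factors in the operator
U(B, β₁) which do not involve qubits j or k commute through C_⟨jk⟩”)] -/
theorem mixUnitary_conj_pauliString (β : ℝ) (S : V → Pauli) :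
    (mixUnitary β)ᴴ * pauliString S * mixUnitary β = tensorAll fun i => (mixerGate β)ᴴ * (S i).mat * mixerGate β := by
  rw [conjTranspose_mixUnitary, mixUnitary, pauliString_eq, tensorAll_mul, tensorAll_mul]


/-! ### Two-siteWord words and the expansion of `e^{iβB} σ^z_u σ^z_v e^{−iβB}` -/

/-- The Pauli word with the letter `Q` at `u`, `P` at `v` and `I` elsewhere (`σ^Q_u σ^P_v` for `u ≠
v`). [folklore] -/
def word₂ (u v : V) (Q P : Pauli) : V → Pauli := Function.update (siteWord Q u) v P

omit [Fintype V] in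
/-- Letters of a two-site word. [folklore] -/
private theorem word₂_apply {u v : V} (huv : u ≠ v) (Q P : Pauli) (i : V) :
    word₂ u v Q P i = if i = u then Q else if i = v then P else Pauli.I := by
  unfold word₂
  by_cases hiv : i = v
  · subst hiv
    rw [Function.update_self, if_neg (Ne.symm huv), if_pos rfl]
  · rw [Function.update_of_ne hiv, siteWord_apply, if_neg hiv]

/-- A two-site word as a tensor product with two non-trivial slots. [folklore] -/
private theorem pauliString_word₂ {u v : V} (huv : u ≠ v) (Q P : Pauli) :
    pauliString (word₂ u v Q P) =
      tensorAll (Function.update (Function.update (fun _ : V => (1 : Matrix Bool Bool ℂ)) u Q.mat) v P.mat) := by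
  rw [pauliString_eq]
  congr 1
  funext i
  rw [word₂_apply huv]
  by_cases hiv : i = v
  · subst hiv
    rw [Function.update_self, if_neg (Ne.symm huv), if_pos rfl]
  · rw [Function.update_of_ne hiv]
    by_cases hiu : i = u
    · subst hiu
      rw [Function.update_self, if_pos rfl]
    · rw [Function.update_of_ne hiu, if_neg hiu, if_neg hiv]
      rfl

/-- Plumbing: `σ^z_u σ^z_v` is the two-site word `Z_u Z_v`. [folklore] -/
private theorem sitePauli_Z_mul_sitePauli_Z_eq_word₂ {u v : V} (huv : u ≠ v) :
    sitePauli Pauli.Z u * sitePauli Pauli.Z v = pauliString (word₂ u v Pauli.Z Pauli.Z) := by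
  rw [sitePauli, sitePauli, pauliString_eq, pauliString_eq, tensorAll_mul, pauliString_eq]
  congr 1
  funext i
  rw [siteWord_apply, siteWord_apply, word₂_apply huv]
  by_cases hiu : i = u
  · subst hiu
    rw [if_pos rfl, if_neg huv, if_pos rfl]
    simp [Pauli.mat]
  · rw [if_neg hiu, if_neg hiu]
    by_cases hiv : i = v
    · rw [if_pos hiv]; simp [Pauli.mat]
    · rw [if_neg hiv]; simp [Pauli.mat]

/-- Conjugating a two-site word by the mixer: the two slots are conjugated, the rest is untouched.
[folklore] -/
private theorem mixUnitary_conj_word₂ (β : ℝ) {u v : V} (huv : u ≠ v) (Q P : Pauli) :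
    (mixUnitary β)ᴴ * pauliString (word₂ u v Q P) * mixUnitary β =
      tensorAll (Function.update (Function.update (fun _ : V => (1 : Matrix Bool Bool ℂ))
        u ((mixerGate β)ᴴ * Q.mat * mixerGate β)) v ((mixerGate β)ᴴ * P.mat * mixerGate β)) := by
  rw [mixUnitary_conj_pauliString]
  congr 1
  funext i
  rw [word₂_apply huv]
  by_cases hiv : i = v
  · subst hiv
    rw [Function.update_self, if_neg (Ne.symm huv), if_pos rfl]
  · rw [Function.update_of_ne hiv]
    by_cases hiu : i = u
    · subst hiu
      rw [Function.update_self, if_pos rfl]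
    · rw [Function.update_of_ne hiu, if_neg hiu, if_neg hiv]
      exact mixerGate_conj_one β

/-- **`e^{iβB} σ^z_u σ^z_v e^{−iβB} = c² σ^z_uσ^z_v + cs σ^z_uσ^y_v + sc σ^y_uσ^z_v + s²
σ^y_uσ^y_v`** with `c = cos 2β`, `s = sin 2β` — the first display of the printed proof. [cite:
WangHadfieldJiangRieffel2018, App. A (e^{iβB} σ^z_u σ^z_v e^{−iβB} = c² σ^z_uσ^z_v + sc(σ^z_uσ^y_v +
σ^y_uσ^z_v) + s² σ^y_uσ^y_v)] -/
theorem mixUnitary_conj_ZZ (β : ℝ) {u v : V} (huv : u ≠ v) :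
    (mixUnitary β)ᴴ * pauliString (word₂ u v Pauli.Z Pauli.Z) * mixUnitary β =
      ((Real.cos (2 * β) : ℂ) ^ 2) • pauliString (word₂ u v Pauli.Z Pauli.Z) +
      ((Real.cos (2 * β) : ℂ) * (Real.sin (2 * β) : ℂ)) • pauliString (word₂ u v Pauli.Z Pauli.Y) +
      ((Real.sin (2 * β) : ℂ) * (Real.cos (2 * β) : ℂ)) • pauliString (word₂ u v Pauli.Y Pauli.Z) +
      ((Real.sin (2 * β) : ℂ) ^ 2) • pauliString (word₂ u v Pauli.Y Pauli.Y) := by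
  rw [mixUnitary_conj_word₂ β huv, mixerGate_conj_Z]
  set c : ℂ := (Real.cos (2 * β) : ℂ) with hc
  set s : ℂ := (Real.sin (2 * β) : ℂ) with hs
  set A : V → Matrix Bool Bool ℂ :=
    Function.update (fun _ : V => (1 : Matrix Bool Bool ℂ)) u (c • Pauli.Z.mat + s • Pauli.Y.mat) with hA
  -- expand the slot `v`
  rw [tensorAll_update_add, tensorAll_update_smul, tensorAll_update_smul]
  -- move the slot `u` to the outside and expand it
  have hswap : ∀ M : Matrix Bool Bool ℂ, Function.update A v M =
      Function.update (Function.update (fun _ : V => (1 : Matrix Bool Bool ℂ)) v M) u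
        (c • Pauli.Z.mat + s • Pauli.Y.mat) := by
    intro M
    rw [hA, Function.update_comm huv]
  rw [hswap, hswap, tensorAll_update_add, tensorAll_update_smul, tensorAll_update_smul,
    tensorAll_update_add, tensorAll_update_smul, tensorAll_update_smul]
  simp only [← Function.update_comm huv, ← pauliString_word₂ huv, smul_add, smul_smul]
  rw [mul_comm s c, ← sq, ← sq]
  abel


/-! ### Signs, flips and phases of the four words -/

/-- The sign `(−1)^b` of a bit. [folklore] -/
def bsign (b : Bool) : ℂ := if b then -1 else 1

/-- Plumbing. [folklore] -/
@[simp] private theorem bsign_true : bsign true = -1 := rfl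
/-- Plumbing. [folklore] -/
@[simp] private theorem bsign_false : bsign false = 1 := rfl

omit [Fintype V] [DecidableEq V] in
/-- Plumbing: `ζ_w(x) = (−1)^{x_w}`. [folklore] -/
private theorem zspin_eq_bsign (x : V → Bool) (w : V) : zspin x w = bsign (x w) := rfl

/-- Plumbing: flipping a bit flips its sign. [folklore] -/
private theorem bsign_not (b : Bool) : bsign (!b) = -bsign b := by cases b <;> simp

/-- Plumbing: signs are multiplicative under xor. [folklore] -/
private theorem bsign_xor (a b : Bool) : bsign (Bool.xor a b) = bsign a * bsign b := by
  cases a <;> cases b <;> simp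

/-- Plumbing: `(−1)^{2b} = 1`. [folklore] -/
private theorem bsign_mul_self (b : Bool) : bsign b * bsign b = 1 := by cases b <;> simp

/-- Plumbing: the row phase of `σ^z` is the sign. [folklore] -/
private theorem rowPhase_Z (b : Bool) : Pauli.Z.rowPhase b = bsign b := by cases b <;> rfl

/-- Plumbing: the row phase of `σ^y` is `−i` times the sign. [folklore] -/
private theorem rowPhase_Y (b : Bool) : Pauli.Y.rowPhase b = -Complex.I * bsign b := by
  cases b <;> simp [Pauli.rowPhase]

/-- Plumbing: the row phase of `I` is `1`. [folklore] -/
private theorem rowPhase_I (b : Bool) : Pauli.I.rowPhase b = 1 := by cases b <;> rfl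

/-- The phase of a two-site word is the product of its two row phases. [folklore] -/
private theorem strPhase_word₂ {u v : V} (huv : u ≠ v) (Q P : Pauli) (x : V → Bool) :
    strPhase (word₂ u v Q P) x = Q.rowPhase (x u) * P.rowPhase (x v) := by
  rw [strPhase, ← Finset.prod_erase_mul _ _ (Finset.mem_univ u),
    ← Finset.prod_erase_mul _ _ (Finset.mem_erase.2 ⟨Ne.symm huv, Finset.mem_univ v⟩)]
  rw [word₂_apply huv, word₂_apply huv, if_pos rfl, if_neg (Ne.symm huv), if_pos rfl]
  have h1 : ∏ i ∈ (Finset.univ.erase u).erase v, (word₂ u v Q P i).rowPhase (x i) = 1 := by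
    refine Finset.prod_eq_one fun i hi => ?_
    have hiv : i ≠ v := Finset.ne_of_mem_erase hi
    have hiu : i ≠ u := Finset.ne_of_mem_erase (Finset.mem_of_mem_erase hi)
    rw [word₂_apply huv, if_neg hiu, if_neg hiv, rowPhase_I]
  rw [h1, one_mul, mul_comm]

/-- Flipping the bit of `x` at `u` (`x ⊕ e_u`). [folklore] -/
def flipAt (x : V → Bool) (u : V) : V → Bool := Function.update x u (!x u)

omit [Fintype V] in
/-- Entries of a flipped configuration. [folklore] -/
private theorem flipAt_apply (x : V → Bool) (u i : V) : flipAt x u i = if i = u then !x u else x i := by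
  unfold flipAt
  by_cases h : i = u
  · subst h; simp
  · simp [h]

omit [Fintype V] in
/-- Spins of a flipped configuration: `ζ_u ↦ −ζ_u`, the others unchanged. [folklore] -/
private theorem zspin_flipAt (x : V → Bool) (u i : V) :
    zspin (flipAt x u) i = if i = u then -zspin x u else zspin x i := by
  rw [zspin_eq_bsign, flipAt_apply]
  split_ifs with h
  · rw [bsign_not, zspin_eq_bsign]
  · rfl

omit [Fintype V] in
/-- The flip pattern of a two-site word. [folklore] -/
private theorem flipPattern_word₂ {u v : V} (huv : u ≠ v) (Q P : Pauli) (x : V → Bool) :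
    flipPattern (word₂ u v Q P) x =
      fun i => if i = u then Bool.xor (x u) Q.flipsBit else if i = v then Bool.xor (x v) P.flipsBit else x i := by
  funext i
  rw [flipPattern, word₂_apply huv]
  by_cases hiu : i = u
  · subst hiu; simp
  · by_cases hiv : i = v
    · subst hiv; simp [hiu]
    · simp [hiu, hiv, Pauli.flipsBit]

omit [Fintype V] in
/-- `Z_uZ_v` flips nothing. [folklore] -/
private theorem flipPattern_word₂_ZZ {u v : V} (huv : u ≠ v) (x : V → Bool) :
    flipPattern (word₂ u v Pauli.Z Pauli.Z) x = x := by
  rw [flipPattern_word₂ huv]; funext i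
  by_cases hiu : i = u
  · subst hiu; simp [Pauli.flipsBit]
  · by_cases hiv : i = v
    · subst hiv; simp [hiu, Pauli.flipsBit]
    · simp [hiu, hiv]

omit [Fintype V] in
/-- `Y_uZ_v` flips `u`. [folklore] -/
private theorem flipPattern_word₂_YZ {u v : V} (huv : u ≠ v) (x : V → Bool) :
    flipPattern (word₂ u v Pauli.Y Pauli.Z) x = flipAt x u := by
  rw [flipPattern_word₂ huv]; funext i
  rw [flipAt_apply]
  by_cases hiu : i = u
  · subst hiu; simp [Pauli.flipsBit]
  · by_cases hiv : i = v
    · subst hiv; simp [hiu, Pauli.flipsBit]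
    · simp [hiu, hiv]

omit [Fintype V] in
/-- `Z_uY_v` flips `v`. [folklore] -/
private theorem flipPattern_word₂_ZY {u v : V} (huv : u ≠ v) (x : V → Bool) :
    flipPattern (word₂ u v Pauli.Z Pauli.Y) x = flipAt x v := by
  rw [flipPattern_word₂ huv]; funext i
  rw [flipAt_apply]
  by_cases hiu : i = u
  · subst hiu; simp [Pauli.flipsBit, huv]
  · by_cases hiv : i = v
    · subst hiv; simp [Pauli.flipsBit, hiu]
    · simp [hiu, hiv]

omit [Fintype V] in
/-- `Y_uY_v` flips `u` and `v`. [folklore] -/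
private theorem flipPattern_word₂_YY {u v : V} (huv : u ≠ v) (x : V → Bool) :
    flipPattern (word₂ u v Pauli.Y Pauli.Y) x = flipAt (flipAt x u) v := by
  rw [flipPattern_word₂ huv]; funext i
  rw [flipAt_apply, flipAt_apply, flipAt_apply, if_neg (Ne.symm huv)]
  by_cases hiu : i = u
  · subst hiu; simp [Pauli.flipsBit, huv]
  · by_cases hiv : i = v
    · subst hiv; simp [Pauli.flipsBit, hiu]
    · simp [hiu, hiv]

/-! ### Sums over the register: factorisation and the shear substitution -/

/-- A register sum of a product of one-site factors factorises. [folklore] -/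
private theorem sum_prod_eq_prod_add (h : V → Bool → ℂ) :
    ∑ x : V → Bool, ∏ w, h w (x w) = ∏ w, (h w false + h w true) := by
  rw [← Fintype.prod_sum h]
  refine Finset.prod_congr rfl fun w _ => ?_
  rw [Fintype.sum_bool, add_comm]

/-- Normalised factorisation: if every one-site sum is `2 g_w`, the register average is `∏ g_w`.
[folklore] -/
private theorem avg_prod_eq (h : V → Bool → ℂ) (g : V → ℂ) (hg : ∀ w, h w false + h w true = 2 * g w) :
    ((2 : ℂ) ^ Fintype.card V)⁻¹ * ∑ x : V → Bool, ∏ w, h w (x w) = ∏ w, g w := by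
  rw [sum_prod_eq_prod_add]
  simp_rw [hg]
  rw [Finset.prod_mul_distrib, Finset.prod_const, Finset.card_univ, ← mul_assoc,
    inv_mul_cancel₀ (pow_ne_zero _ two_ne_zero), one_mul]

/-- The change of variables `x_w ↦ x_w ⊕ x_u` for `w ≠ u` (so `ζ_w ↦ ζ_u ζ_w`), an involution of the
register used to decouple the factors `(c' − i s' σ^z_u σ^z_w)` of the printed proof. [folklore] -/
def shear (u : V) (x : V → Bool) : V → Bool := fun w => if w = u then x u else Bool.xor (x w) (x u)

omit [Fintype V] in
/-- Plumbing. [folklore] -/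
private theorem shear_apply_self (u : V) (x : V → Bool) : shear u x u = x u := by simp [shear]

omit [Fintype V] in
/-- Plumbing. [folklore] -/
private theorem shear_apply_of_ne {u w : V} (h : w ≠ u) (x : V → Bool) : shear u x w = Bool.xor (x w) (x u) := by
  simp [shear, h]

omit [Fintype V] in
/-- The shear is an involution. [folklore] -/
private theorem shear_shear (u : V) (x : V → Bool) : shear u (shear u x) = x := by
  funext w
  by_cases h : w = u
  · subst h; rw [shear_apply_self, shear_apply_self]
  · rw [shear_apply_of_ne h, shear_apply_of_ne h, shear_apply_self, Bool.xor_assoc, Bool.xor_self,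
      Bool.xor_false]

/-- The shear as a permutation of the register. [folklore] -/
def shearEquiv (u : V) : (V → Bool) ≃ (V → Bool) :=
  ⟨shear u, shear u, shear_shear u, shear_shear u⟩

omit [Fintype V] in
/-- Plumbing: the shear fixes `ζ_u`. [folklore] -/
private theorem zspin_shear_self (u : V) (x : V → Bool) : zspin (shear u x) u = zspin x u := by
  rw [zspin_eq_bsign, zspin_eq_bsign, shear_apply_self]

omit [Fintype V] in
/-- Plumbing: the shear sends `ζ_w` to `ζ_u ζ_w` for `w ≠ u`. [folklore] -/
private theorem zspin_shear_of_ne {u w : V} (h : w ≠ u) (x : V → Bool) :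
    zspin (shear u x) w = zspin x u * zspin x w := by
  rw [zspin_eq_bsign, zspin_eq_bsign, zspin_eq_bsign, shear_apply_of_ne h, bsign_xor, mul_comm]

/-! ### The cutValue function in zspin variables and its change under bit flips -/

/-- The edge clause in spin variables, `(1 − ζ_a ζ_b)/2`. [cite: WangHadfieldJiangRieffel2018, §3 (C
= ½ Σ_{(i,j)∈E} (1 − z_i z_j))] -/
def edgeSpin (x : V → Bool) : Sym2 V → ℂ :=
  Sym2.lift ⟨fun a b => (1 - zspin x a * zspin x b) / 2, fun a b => by simp only [mul_comm]⟩

omit [Fintype V] [DecidableEq V] in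
/-- Unfolding. [folklore] -/
@[simp] private theorem edgeSpin_mk (x : V → Bool) (a b : V) :
    edgeSpin x s(a, b) = (1 - zspin x a * zspin x b) / 2 := rfl

omit [Fintype V] [DecidableEq V] in
/-- The cut indicator is the spin clause `(1 − ζ_a ζ_b)/2`. [cite: WangHadfieldJiangRieffel2018, §3
(C = ½ Σ_{(i,j)∈E} (1 − z_i z_j))] -/
theorem cutInd_eq_edgeSpin (x : V → Bool) (e : Sym2 V) : (cutInd x e : ℂ) = edgeSpin x e := by
  induction e using Sym2.ind with
  | h a b => rw [cutInd_mk_eq_zspin, edgeSpin_mk]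

omit [DecidableEq V] in
/-- **`C(x) = ½ Σ_{(a,b)∈E} (1 − ζ_a ζ_b)`.** [cite: WangHadfieldJiangRieffel2018, §3 (C = ½
Σ_{(i,j)∈E} (1 − z_i z_j))] -/
theorem cutValue_eq_sum_edgeSpin (x : V → Bool) : (cutValue G x : ℂ) = ∑ e ∈ G.edgeFinset, edgeSpin x e := by
  rw [cutValue, Nat.cast_sum]
  exact Finset.sum_congr rfl fun e _ => cutInd_eq_edgeSpin x e

/-- Graph plumbing: the edges at `u` are the `s(u, w)`, `w ∈ N(u)`. [folklore] -/
private theorem incidenceFinset_eq_image (u : V) :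
    G.incidenceFinset u = (G.neighborFinset u).image fun w => s(u, w) := by
  ext e
  rw [SimpleGraph.mem_incidenceFinset, Finset.mem_image]
  constructor
  · intro he
    obtain ⟨he', hu⟩ := he
    induction e using Sym2.ind with
    | h a b =>
      rw [SimpleGraph.mem_edgeSet] at he'
      rcases Sym2.mem_iff.1 hu with rfl | rfl
      · exact ⟨b, (G.mem_neighborFinset u b).2 he', rfl⟩
      · exact ⟨a, (G.mem_neighborFinset u a).2 he'.symm, Sym2.eq_swap⟩
  · rintro ⟨w, hw, rfl⟩
    exact ⟨(G.mem_neighborFinset u w).1 hw, Sym2.mem_mk_left u w⟩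

/-- Graph plumbing: split an edge sum at a vertex. [folklore] -/
private theorem sum_edgeFinset_split (u : V) (f : Sym2 V → ℂ) :
    ∑ e ∈ G.edgeFinset, f e =
      ∑ w ∈ G.neighborFinset u, f s(u, w) + ∑ e ∈ G.edgeFinset with u ∉ e, f e := by
  rw [← Finset.sum_filter_add_sum_filter_not G.edgeFinset (fun e => u ∈ e) f]
  congr 1
  rw [← SimpleGraph.incidenceFinset_eq_filter, incidenceFinset_eq_image, Finset.sum_image]
  intro w _ w' _ h
  exact Sym2.congr_right.1 h

/-- **Flipping one bit changes the cost only through the constraints at that vertex**: `C(x ⊕ e_u) =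
C(x) + Σ_{w ∈ N(u)} ζ_u ζ_w` (the `deg u` constraints involving `u`; the others “commute through and
cancel out”). [cite: WangHadfieldJiangRieffel2018, App. A (only the d constraints C_u involving u
and the e constraints C_v contribute; ∏_{i=1}^{d}(I c' − i s' σ^z_uσ^z_{w_i}))] [cite:
FarhiGoldstoneGutmann2014, §2 (“Any factors in the operator U(C, γ₁) which do not involve qubits j
or k will commute through and cancel out”)] -/
theorem cutValue_flipAt (u : V) (x : V → Bool) :
    (cutValue G (flipAt x u) : ℂ) = cutValue G x + ∑ w ∈ G.neighborFinset u, zspin x u * zspin x w := by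
  rw [cutValue_eq_sum_edgeSpin, cutValue_eq_sum_edgeSpin, sum_edgeFinset_split G u, sum_edgeFinset_split G u]
  have h1 : ∀ w ∈ G.neighborFinset u, edgeSpin (flipAt x u) s(u, w) = edgeSpin x s(u, w) + zspin x u * zspin x w := by
    intro w hw
    have hwu : w ≠ u := (G.ne_of_adj ((G.mem_neighborFinset u w).1 hw)).symm
    rw [edgeSpin_mk, edgeSpin_mk, zspin_flipAt, zspin_flipAt, if_pos rfl, if_neg hwu]
    ring
  have h2 : ∀ e ∈ G.edgeFinset.filter (fun e => u ∉ e), edgeSpin (flipAt x u) e = edgeSpin x e := by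
    intro e he
    have hue : u ∉ e := (Finset.mem_filter.1 he).2
    induction e using Sym2.ind with
    | h a b =>
      have hau : a ≠ u := fun h => hue (h ▸ Sym2.mem_mk_left a b)
      have hbu : b ≠ u := fun h => hue (h ▸ Sym2.mem_mk_right a b)
      rw [edgeSpin_mk, edgeSpin_mk, zspin_flipAt, zspin_flipAt, if_neg hau, if_neg hbu]
  rw [Finset.sum_congr rfl h1, Finset.sum_congr rfl h2, Finset.sum_add_distrib]
  ring

/-- **Flipping both ends of an edge**: `C(x ⊕ e_u ⊕ e_v) = C(x) + Σ_{w ∈ N(u)∖v} ζ_u ζ_w + Σ_{w ∈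
N(v)∖u} ζ_v ζ_w` (the `σ^yσ^y` case: `e^{2iγC_u} e^{2iγC_v}`). [cite: WangHadfieldJiangRieffel2018,
App. A (tr[ρ₀ e^{iγC} σ^y_uσ^y_v e^{−iγC}] = tr[e^{2iγC_u} e^{2iγC_v} σ^y_uσ^y_v])] -/
theorem cutValue_flipAt_flipAt {u v : V} (huv : G.Adj u v) (x : V → Bool) :
    (cutValue G (flipAt (flipAt x u) v) : ℂ) = cutValue G x +
      (∑ w ∈ (G.neighborFinset u).erase v, zspin x u * zspin x w +
      ∑ w ∈ (G.neighborFinset v).erase u, zspin x v * zspin x w) := by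
  have hne : u ≠ v := G.ne_of_adj huv
  have hv : v ∈ G.neighborFinset u := (G.mem_neighborFinset u v).2 huv
  have hu : u ∈ G.neighborFinset v := (G.mem_neighborFinset v u).2 huv.symm
  rw [cutValue_flipAt, cutValue_flipAt, ← Finset.add_sum_erase _ _ hv, ← Finset.add_sum_erase _ _ hu]
  have h3 : ∀ w ∈ (G.neighborFinset v).erase u,
      zspin (flipAt x u) v * zspin (flipAt x u) w = zspin x v * zspin x w := by
    intro w hw
    rw [zspin_flipAt, zspin_flipAt, if_neg (Ne.symm hne), if_neg (Finset.ne_of_mem_erase hw)]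
  rw [Finset.sum_congr rfl h3]
  rw [zspin_flipAt, zspin_flipAt, if_neg (Ne.symm hne), if_pos rfl]
  ring


/-! ### Exponentials of zspin sums -/

/-- Plumbing: `e^{−iγσ} = cos γ − iσ sin γ` for a sign `σ = ±1`. [folklore] -/
private theorem exp_neg_I_mul_bsign (γ : ℝ) (b : Bool) :
    Complex.exp (-(Complex.I * γ * bsign b)) = (Real.cos γ : ℂ) - Complex.I * (Real.sin γ : ℂ) * bsign b := by
  cases b
  · have h : -(Complex.I * (γ : ℂ) * bsign false) = ((-γ : ℝ) : ℂ) * Complex.I := by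
      rw [bsign_false]; push_cast; ring
    rw [h, Complex.exp_mul_I, ← Complex.ofReal_cos, ← Complex.ofReal_sin, Real.cos_neg, Real.sin_neg,
      bsign_false]
    push_cast; ring
  · have h : -(Complex.I * (γ : ℂ) * bsign true) = ((γ : ℝ) : ℂ) * Complex.I := by
      rw [bsign_true]; ring
    rw [h, Complex.exp_mul_I, ← Complex.ofReal_cos, ← Complex.ofReal_sin, bsign_true]
    ring

omit [Fintype V] [DecidableEq V] in
/-- Plumbing: `e^{−iγζ_aζ_b} = cos γ − i sin γ ζ_aζ_b` (the factor `I c' − i s' σ^zσ^z` on a basis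
state). [folklore] -/
private theorem exp_neg_I_mul_zspin_mul_zspin (γ : ℝ) (x : V → Bool) (a b : V) :
    Complex.exp (-(Complex.I * γ * (zspin x a * zspin x b))) =
      (Real.cos γ : ℂ) - Complex.I * (Real.sin γ : ℂ) * (zspin x a * zspin x b) := by
  rw [zspin_eq_bsign, zspin_eq_bsign, ← bsign_xor]
  exact exp_neg_I_mul_bsign γ _

omit [Fintype V] [DecidableEq V] in
/-- Plumbing: `e^{−iγ Σ_{w∈s} ζ_a ζ_w} = ∏_{w∈s} (cos γ − i sin γ ζ_a ζ_w)`. [folklore] -/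
private theorem exp_neg_I_mul_sum_zspin (γ : ℝ) (x : V → Bool) (a : V) (s : Finset V) :
    Complex.exp (-(Complex.I * γ * ∑ w ∈ s, zspin x a * zspin x w)) =
      ∏ w ∈ s, ((Real.cos γ : ℂ) - Complex.I * (Real.sin γ : ℂ) * (zspin x a * zspin x w)) := by
  rw [Finset.mul_sum, ← Finset.sum_neg_distrib, Complex.exp_sum]
  exact Finset.prod_congr rfl fun w _ => exp_neg_I_mul_zspin_mul_zspin γ x a w

/-- Plumbing: `e^{−iγ(C + Δ)} e^{iγC} = e^{−iγΔ}`. [folklore] -/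
private theorem exp_flip_factor (γ : ℝ) (C Δ : ℂ) :
    Complex.exp (-(Complex.I * γ * (C + Δ))) * Complex.exp (Complex.I * γ * C) =
      Complex.exp (-(Complex.I * γ * Δ)) := by
  rw [← Complex.exp_add]
  congr 1
  ring

/-! ### Products supported on one or two sites -/

omit [Fintype V] in
/-- Plumbing: a product supported on one site. [folklore] -/
private theorem prod_ite_eq_one_site {M : Type*} [CommMonoid M] [Fintype V] (v : V) (f : V → M) :
    ∏ w, (if w = v then f w else 1) = f v := by
  rw [Finset.prod_ite_eq']
  simp

/-! ### The three traces of the printed proof -/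

/-- **`tr[ρ₀ e^{iγC} σ^z_u σ^z_v e^{−iγC}] = 0`** for `u ≠ v` (“The first term `σ^z_uσ^z_v` commutes
with `C` and does not contribute”). [cite: WangHadfieldJiangRieffel2018, App. A (first term does not
contribute to ⟨C_uv⟩)] -/
theorem trace_ZZ_phaseState (γ : ℝ) {u v : V} (huv : u ≠ v) :
    (pauliString (word₂ u v Pauli.Z Pauli.Z) * phaseState G γ).trace = 0 := by
  rw [trace_pauliString_mul_phaseState]
  simp_rw [flipPattern_word₂_ZZ huv, strPhase_word₂ huv, rowPhase_Z]
  have h1 : ∀ x : V → Bool, Complex.exp (-(Complex.I * γ * (cutValue G x : ℂ))) *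
      Complex.exp (Complex.I * γ * (cutValue G x : ℂ)) = 1 := by
    intro x
    rw [← Complex.exp_add, neg_add_cancel, Complex.exp_zero]
  simp_rw [h1, mul_one]
  -- `Σ_x ζ_u ζ_v = 0`
  set h : V → Bool → ℂ := fun w b => if w = u then bsign b else if w = v then bsign b else 1 with hh
  have h2 : ∀ x : V → Bool, bsign (x u) * bsign (x v) = ∏ w, h w (x w) := by
    intro x
    rw [hh]
    simp only
    rw [← Finset.prod_erase_mul _ _ (Finset.mem_univ u),
      ← Finset.prod_erase_mul _ _ (Finset.mem_erase.2 ⟨Ne.symm huv, Finset.mem_univ v⟩)]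
    rw [if_pos rfl, if_neg (Ne.symm huv), if_pos rfl]
    rw [Finset.prod_eq_one fun i hi => ?_]
    · ring
    · rw [if_neg (Finset.ne_of_mem_erase (Finset.mem_of_mem_erase hi)), if_neg (Finset.ne_of_mem_erase hi)]
  simp_rw [h2]
  rw [sum_prod_eq_prod_add, Finset.prod_eq_zero (Finset.mem_univ u), mul_zero]
  rw [hh]
  simp

/-- **`tr[ρ₀ e^{iγC} σ^y_u σ^z_v e^{−iγC}] = −s' c'^{d}`** for an edge `⟨uv⟩`, `c' = cos γ`, `s' =
sin γ`, `d + 1 = deg u` (the second display of the printed proof; “these terms are independent of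
the number of mutual neighbours”). [cite: WangHadfieldJiangRieffel2018, App. A (tr[ρ₀ e^{iγC}
σ^y_uσ^z_v e^{−iγC}] = −s' c'^d)] -/
theorem trace_YZ_phaseState (γ : ℝ) {u v : V} (huv : G.Adj u v) :
    (pauliString (word₂ u v Pauli.Y Pauli.Z) * phaseState G γ).trace =
      -((Real.sin γ : ℂ) * (Real.cos γ : ℂ) ^ (G.degree u - 1)) := by
  have hne : u ≠ v := G.ne_of_adj huv
  have hv : v ∈ G.neighborFinset u := (G.mem_neighborFinset u v).2 huv
  rw [trace_pauliString_mul_phaseState]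
  simp_rw [flipPattern_word₂_YZ hne, strPhase_word₂ hne, rowPhase_Y, rowPhase_Z, cutValue_flipAt, exp_flip_factor,
    exp_neg_I_mul_sum_zspin]
  -- the shear substitution `ζ_w ↦ ζ_u ζ_w`
  set c' : ℂ := (Real.cos γ : ℂ) with hc'
  set s' : ℂ := (Real.sin γ : ℂ) with hs'
  set F : (V → Bool) → ℂ := fun x => -Complex.I * bsign (x v) *
    ∏ w ∈ G.neighborFinset u, (c' - Complex.I * s' * zspin x w) with hF
  have hshear : ∀ x : V → Bool, -Complex.I * bsign (shear u x u) * bsign (shear u x v) *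
      ∏ w ∈ G.neighborFinset u, (c' - Complex.I * s' * (zspin (shear u x) u * zspin (shear u x) w)) = F x := by
    intro x
    rw [hF]
    simp only
    rw [shear_apply_self, shear_apply_of_ne (Ne.symm hne), bsign_xor]
    have hp : ∀ w ∈ G.neighborFinset u,
        c' - Complex.I * s' * (zspin (shear u x) u * zspin (shear u x) w) = c' - Complex.I * s' * zspin x w := by
      intro w hw
      have hwu : w ≠ u := (G.ne_of_adj ((G.mem_neighborFinset u w).1 hw)).symm
      rw [zspin_shear_self, zspin_shear_of_ne hwu, ← mul_assoc (zspin x u), zspin_mul_self, one_mul]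
    rw [Finset.prod_congr rfl hp]
    have hsu : bsign (x u) * bsign (x u) = 1 := bsign_mul_self _
    linear_combination (-Complex.I * bsign (x v) * ∏ w ∈ G.neighborFinset u, (c' - Complex.I * s' * zspin x w)) * hsu
  rw [← Equiv.sum_comp (shearEquiv u)]
  have hco : ∀ x, (shearEquiv u) x = shear u x := fun x => rfl
  simp_rw [hco, hshear]
  -- factorise the sheared sum siteWord by siteWord
  set h : V → Bool → ℂ := fun w b => (if w = v then -Complex.I * bsign b else 1) *
    (if w ∈ G.neighborFinset u then (c' - Complex.I * s' * bsign b) else 1) with hh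
  have hF' : ∀ x : V → Bool, F x = ∏ w, h w (x w) := by
    intro x
    rw [hF, hh]
    simp only
    rw [Finset.prod_mul_distrib, prod_ite_eq_one_site v (fun w => -Complex.I * bsign (x w)),
      Finset.prod_ite_mem, Finset.univ_inter]
    rfl
  simp_rw [hF']
  set g : V → ℂ := fun w => if w = v then -s' else if w ∈ G.neighborFinset u then c' else 1 with hg
  have hsum : ∀ w, h w false + h w true = 2 * g w := by
    intro w
    rw [hh, hg]
    simp only [bsign_false, bsign_true]
    by_cases hwv : w = v
    · have hwN : w ∈ G.neighborFinset u := hwv ▸ hv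
      simp only [if_pos hwv, if_pos hwN]
      ring_nf
      rw [Complex.I_sq]
      ring
    · by_cases hwN : w ∈ G.neighborFinset u
      · simp only [if_neg hwv, if_pos hwN]; ring
      · simp only [if_neg hwv, if_neg hwN]; norm_num
  rw [avg_prod_eq h g hsum]
  -- evaluate `∏ g = (−sin γ) cos γ ^ (deg u − 1)`
  rw [← Finset.prod_subset (Finset.subset_univ (G.neighborFinset u)) (fun w _ hw => by
    rw [hg]; simp only; rw [if_neg (fun h : w = v => hw (h ▸ hv)), if_neg hw])]
  rw [← Finset.mul_prod_erase _ _ hv]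
  have hgv : g v = -s' := by rw [hg]; simp
  have hge : ∀ w ∈ (G.neighborFinset u).erase v, g w = c' := by
    intro w hw
    rw [hg]; simp only
    rw [if_neg (Finset.ne_of_mem_erase hw), if_pos (Finset.mem_of_mem_erase hw)]
  rw [hgv, Finset.prod_congr rfl hge, Finset.prod_const, Finset.card_erase_of_mem hv,
    SimpleGraph.card_neighborFinset_eq_degree]
  ring


omit [Fintype V] in
/-- Plumbing: swapping the two sites of a word. [folklore] -/
private theorem word₂_swap {u v : V} (huv : u ≠ v) (Q P : Pauli) : word₂ u v Q P = word₂ v u P Q := by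
  funext i
  rw [word₂_apply huv, word₂_apply (Ne.symm huv)]
  by_cases hiu : i = u
  · subst hiu; simp [huv]
  · simp [hiu]

/-- **`tr[ρ₀ e^{iγC} σ^z_u σ^y_v e^{−iγC}] = −s' c'^{e}`**, `e + 1 = deg v` (“By symmetry”). [cite:
WangHadfieldJiangRieffel2018, App. A (tr[ρ₀ e^{iγC} σ^z_uσ^y_v e^{−iγC}] = −s' c'^e)] -/
theorem trace_ZY_phaseState (γ : ℝ) {u v : V} (huv : G.Adj u v) :
    (pauliString (word₂ u v Pauli.Z Pauli.Y) * phaseState G γ).trace =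
      -((Real.sin γ : ℂ) * (Real.cos γ : ℂ) ^ (G.degree v - 1)) := by
  rw [word₂_swap (G.ne_of_adj huv)]
  exact trace_YZ_phaseState G γ huv.symm

/-- Graph plumbing: removing the ends of an edge from each other's neighbourhoods does not change
the common neighbours. [folklore] -/
private theorem erase_inter_erase {u v : V} :
    (G.neighborFinset u).erase v ∩ (G.neighborFinset v).erase u = G.neighborFinset u ∩ G.neighborFinset v := by
  ext w
  simp only [Finset.mem_inter, Finset.mem_erase, SimpleGraph.mem_neighborFinset]
  constructor
  · rintro ⟨⟨-, h1⟩, -, h2⟩; exact ⟨h1, h2⟩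
  · rintro ⟨h1, h2⟩
    exact ⟨⟨(G.ne_of_adj h2).symm, h1⟩, (G.ne_of_adj h1).symm, h2⟩

/-- **`tr[ρ₀ e^{iγC} σ^y_u σ^y_v e^{−iγC}] = ½ c'^{d+e−2f} (1 − cos^f 2γ)`** for an edge `⟨uv⟩` with
`f = λ_{uv}` common neighbours, `d + 1 = deg u`, `e + 1 = deg v` (the third display of the printed
proof; the odd binomial sum `Σ_{i odd} C(f,i)(c'²)^{f−i}(s'²)^i = ½(1 − cos^f 2γ)`). [cite:
WangHadfieldJiangRieffel2018, App. A (tr[ρ₀ e^{iγC} σ^y_uσ^y_v e^{−iγC}] = ½ c'^{d+e−2f}(1 − cos^f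
2γ))] -/
theorem trace_YY_phaseState (γ : ℝ) {u v : V} (huv : G.Adj u v) :
    (pauliString (word₂ u v Pauli.Y Pauli.Y) * phaseState G γ).trace =
      (1 / 2 : ℂ) * (Real.cos γ : ℂ) ^ (G.degree u - 1 + (G.degree v - 1) -
        2 * (G.neighborFinset u ∩ G.neighborFinset v).card) *
        (1 - (Real.cos (2 * γ) : ℂ) ^ (G.neighborFinset u ∩ G.neighborFinset v).card) := by
  have hne : u ≠ v := G.ne_of_adj huv
  have hv : v ∈ G.neighborFinset u := (G.mem_neighborFinset u v).2 huv
  have hu : u ∈ G.neighborFinset v := (G.mem_neighborFinset v u).2 huv.symm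
  rw [trace_pauliString_mul_phaseState]
  simp_rw [flipPattern_word₂_YY hne, strPhase_word₂ hne, rowPhase_Y, cutValue_flipAt_flipAt G huv, exp_flip_factor]
  set A : Finset V := (G.neighborFinset u).erase v with hA
  set B : Finset V := (G.neighborFinset v).erase u with hB
  have hvA : v ∉ A := Finset.notMem_erase v _
  have hvB : v ∉ B := fun h => (G.ne_of_adj ((G.mem_neighborFinset v v).1 (Finset.mem_of_mem_erase h))) rfl
  have huA : u ∉ A := fun h => (G.ne_of_adj ((G.mem_neighborFinset u u).1 (Finset.mem_of_mem_erase h))) rfl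
  have huB : u ∉ B := Finset.notMem_erase u _
  have hsplit : ∀ x : V → Bool, Complex.exp (-(Complex.I * γ *
      (∑ w ∈ A, zspin x u * zspin x w + ∑ w ∈ B, zspin x v * zspin x w))) =
      (∏ w ∈ A, ((Real.cos γ : ℂ) - Complex.I * (Real.sin γ : ℂ) * (zspin x u * zspin x w))) *
      ∏ w ∈ B, ((Real.cos γ : ℂ) - Complex.I * (Real.sin γ : ℂ) * (zspin x v * zspin x w)) := by
    intro x
    rw [mul_add, neg_add, Complex.exp_add, exp_neg_I_mul_sum_zspin, exp_neg_I_mul_sum_zspin]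
  simp_rw [hsplit]
  set c' : ℂ := (Real.cos γ : ℂ) with hc'
  set s' : ℂ := (Real.sin γ : ℂ) with hs'
  -- the shear substitution at `u`
  set F : (V → Bool) → ℂ := fun x => -bsign (x v) *
    ((∏ w ∈ A, (c' - Complex.I * s' * zspin x w)) *
      ∏ w ∈ B, (c' - Complex.I * s' * (bsign (x v) * zspin x w))) with hF
  have hshear : ∀ x : V → Bool,
      -Complex.I * bsign (shear u x u) * (-Complex.I * bsign (shear u x v)) *
      ((∏ w ∈ A, (c' - Complex.I * s' * (zspin (shear u x) u * zspin (shear u x) w))) *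
        ∏ w ∈ B, (c' - Complex.I * s' * (zspin (shear u x) v * zspin (shear u x) w))) = F x := by
    intro x
    rw [hF]
    simp only
    rw [shear_apply_self, shear_apply_of_ne (Ne.symm hne), bsign_xor]
    have hpA : ∀ w ∈ A,
        c' - Complex.I * s' * (zspin (shear u x) u * zspin (shear u x) w) = c' - Complex.I * s' * zspin x w := by
      intro w hw
      have hwu : w ≠ u := fun h => huA (h ▸ hw)
      rw [zspin_shear_self, zspin_shear_of_ne hwu, ← mul_assoc (zspin x u), zspin_mul_self, one_mul]
    have hpB : ∀ w ∈ B,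
        c' - Complex.I * s' * (zspin (shear u x) v * zspin (shear u x) w) =
          c' - Complex.I * s' * (bsign (x v) * zspin x w) := by
      intro w hw
      have hwu : w ≠ u := fun h => huB (h ▸ hw)
      rw [zspin_shear_of_ne (Ne.symm hne), zspin_shear_of_ne hwu, ← zspin_eq_bsign]
      congr 1
      linear_combination (Complex.I * s' * zspin x v * zspin x w) * zspin_mul_self x u
    rw [Finset.prod_congr rfl hpA, Finset.prod_congr rfl hpB]
    have hsu : bsign (x u) * bsign (x u) = 1 := bsign_mul_self _
    linear_combination (bsign (x v) * ((∏ w ∈ A, (c' - Complex.I * s' * zspin x w)) *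
      ∏ w ∈ B, (c' - Complex.I * s' * (bsign (x v) * zspin x w)))) * (bsign (x u) * bsign (x u) * Complex.I_sq - hsu)
  rw [← Equiv.sum_comp (shearEquiv u)]
  have hco : ∀ x, (shearEquiv u) x = shear u x := fun x => rfl
  simp_rw [hco, hshear]
  -- condition on the bit at `v`, then factorise siteWord by siteWord
  set h : Bool → V → Bool → ℂ := fun b w t =>
    (if w = v then (if t = b then -bsign b else 0) else 1) *
      ((if w ∈ A then (c' - Complex.I * s' * bsign t) else 1) *
        (if w ∈ B then (c' - Complex.I * s' * (bsign b * bsign t)) else 1)) with hh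
  have hFx : ∀ x : V → Bool, F x = ∑ b, ∏ w, h b w (x w) := by
    intro x
    have hprod : ∀ b, ∏ w, h b w (x w) = (if x v = b then -bsign b else 0) *
        ((∏ w ∈ A, (c' - Complex.I * s' * zspin x w)) *
          ∏ w ∈ B, (c' - Complex.I * s' * (bsign b * zspin x w))) := by
      intro b
      rw [hh]
      simp only
      rw [Finset.prod_mul_distrib, Finset.prod_mul_distrib,
        prod_ite_eq_one_site v (fun w => if x w = b then -bsign b else 0),
        Finset.prod_ite_mem, Finset.univ_inter, Finset.prod_ite_mem, Finset.univ_inter]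
      rfl
    simp_rw [hprod]
    rw [Fintype.sum_bool, hF]
    simp only
    cases x v <;> simp
  simp_rw [hFx]
  rw [Finset.sum_comm, Finset.mul_sum]
  set g : Bool → V → ℂ := fun b w => if w = v then -bsign b / 2 else
    if w ∈ A ∩ B then (c' ^ 2 - s' ^ 2 * bsign b) else if w ∈ A ∪ B then c' else 1 with hg
  have hsum : ∀ b w, h b w false + h b w true = 2 * g b w := by
    intro b w
    rw [hh, hg]
    simp only [bsign_false, bsign_true]
    by_cases hwv : w = v
    · have hwA : w ∉ A := hwv ▸ hvA
      have hwB : w ∉ B := hwv ▸ hvB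
      simp only [if_pos hwv, if_neg hwA, if_neg hwB]
      cases b
      · simp; ring
      · simp
    · rw [if_neg hwv, if_neg hwv, if_neg hwv]
      by_cases hwA : w ∈ A
      · by_cases hwB : w ∈ B
        · have hwAB : w ∈ A ∩ B := Finset.mem_inter.2 ⟨hwA, hwB⟩
          simp only [if_pos hwA, if_pos hwB, if_pos hwAB]
          ring_nf
          rw [Complex.I_sq]
          ring
        · have hwAB : w ∉ A ∩ B := fun h' => hwB (Finset.mem_of_mem_inter_right h')
          have hwAuB : w ∈ A ∪ B := Finset.mem_union_left _ hwA
          simp only [if_pos hwA, if_neg hwB, if_neg hwAB, if_pos hwAuB]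
          ring
      · by_cases hwB : w ∈ B
        · have hwAB : w ∉ A ∩ B := fun h' => hwA (Finset.mem_of_mem_inter_left h')
          have hwAuB : w ∈ A ∪ B := Finset.mem_union_right _ hwB
          simp only [if_neg hwA, if_pos hwB, if_neg hwAB, if_pos hwAuB]
          ring
        · have hwAB : w ∉ A ∩ B := fun h' => hwA (Finset.mem_of_mem_inter_left h')
          have hwAuB : w ∉ A ∪ B := fun h' => by
            rcases Finset.mem_union.1 h' with h'' | h''
            · exact hwA h''
            · exact hwB h''
          simp only [if_neg hwA, if_neg hwB, if_neg hwAB, if_neg hwAuB]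
          norm_num
  rw [Finset.sum_congr rfl fun b _ => avg_prod_eq (h b) (g b) (hsum b)]
  -- evaluate the siteWord product
  have hAB : A ∩ B ⊆ A ∪ B := Finset.inter_subset_union
  have hprodg : ∀ b, ∏ w, g b w =
      (-bsign b / 2) * ((c' ^ 2 - s' ^ 2 * bsign b) ^ (A ∩ B).card * c' ^ ((A ∪ B).card - (A ∩ B).card)) := by
    intro b
    rw [← Finset.mul_prod_erase _ _ (Finset.mem_univ v)]
    have hgv : g b v = -bsign b / 2 := by rw [hg]; simp
    rw [hgv]
    congr 1
    have hsub : A ∪ B ⊆ Finset.univ.erase v := by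
      intro w hw
      refine Finset.mem_erase.2 ⟨fun hwv => ?_, Finset.mem_univ w⟩
      rcases Finset.mem_union.1 hw with h' | h'
      · exact hvA (hwv ▸ h')
      · exact hvB (hwv ▸ h')
    rw [← Finset.prod_subset hsub (fun w hw hw' => by
      rw [hg]
      simp only
      rw [if_neg (Finset.ne_of_mem_erase hw), if_neg (fun h' => hw' (hAB h')), if_neg hw'])]
    rw [← Finset.prod_filter_mul_prod_filter_not (A ∪ B) (fun w => w ∈ A ∩ B), Finset.filter_mem_eq_inter,
      Finset.inter_eq_right.2 hAB, ← Finset.sdiff_eq_filter]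
    have h1 : ∀ w ∈ A ∩ B, g b w = c' ^ 2 - s' ^ 2 * bsign b := by
      intro w hw
      have hwv : w ≠ v := fun h' => hvA (h' ▸ Finset.mem_of_mem_inter_left hw)
      rw [hg]; simp only; rw [if_neg hwv, if_pos hw]
    have h2 : ∀ w ∈ (A ∪ B) \ (A ∩ B), g b w = c' := by
      intro w hw
      obtain ⟨hw1, hw2⟩ := Finset.mem_sdiff.1 hw
      have hwv : w ≠ v := fun h' => by
        rcases Finset.mem_union.1 hw1 with h'' | h''
        · exact hvA (h' ▸ h'')
        · exact hvB (h' ▸ h'')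
      rw [hg]; simp only; rw [if_neg hwv, if_neg hw2, if_pos hw1]
    rw [Finset.prod_congr rfl h1, Finset.prod_congr rfl h2, Finset.prod_const, Finset.prod_const,
      Finset.card_sdiff, Finset.inter_eq_left.2 hAB]
  simp_rw [hprodg]
  -- bookkeeping of the exponents
  have hinter : A ∩ B = G.neighborFinset u ∩ G.neighborFinset v := erase_inter_erase G
  have hcardA : A.card = G.degree u - 1 := by
    rw [hA, Finset.card_erase_of_mem hv, SimpleGraph.card_neighborFinset_eq_degree]
  have hcardB : B.card = G.degree v - 1 := by
    rw [hB, Finset.card_erase_of_mem hu, SimpleGraph.card_neighborFinset_eq_degree]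
  have hexp : (A ∪ B).card - (A ∩ B).card =
      G.degree u - 1 + (G.degree v - 1) - 2 * (G.neighborFinset u ∩ G.neighborFinset v).card := by
    have h' := Finset.card_union_add_card_inter A B
    have h'' : (A ∩ B).card ≤ A.card := Finset.card_le_card Finset.inter_subset_left
    rw [← hinter, ← hcardA, ← hcardB]
    omega
  rw [hexp, hinter, Fintype.sum_bool, bsign_true, bsign_false]
  -- trigonometry: c'² + s'² = 1, c'² − s'² = cos 2γ
  have hone : c' ^ 2 + s' ^ 2 = 1 := by
    rw [hc', hs']
    push_cast
    exact Complex.cos_sq_add_sin_sq _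
  have hcos2 : (Real.cos (2 * γ) : ℂ) = c' ^ 2 - s' ^ 2 := by
    rw [hc', hs']
    push_cast
    rw [Complex.cos_two_mul, Complex.sin_sq]
    ring
  rw [hcos2, mul_neg, mul_one, sub_neg_eq_add, hone, one_pow]
  ring


/-! ### Assembly: Theorem 1 -/

/-- `tr W(γ) = 1`. [folklore] -/
private theorem trace_phaseState (γ : ℝ) : (phaseState G γ).trace = 1 := by
  simp only [Matrix.trace, diag_apply, phaseState_apply]
  have h1 : ∀ x : V → Bool, Complex.exp (-(Complex.I * γ * (cutValue G x : ℂ))) *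
      Complex.exp (Complex.I * γ * (cutValue G x : ℂ)) = 1 := by
    intro x
    rw [← Complex.exp_add, neg_add_cancel, Complex.exp_zero]
  simp_rw [h1, mul_one]
  rw [Finset.sum_const, Finset.card_univ, Fintype.card_fun, Fintype.card_bool, nsmul_eq_mul]
  push_cast
  rw [mul_inv_cancel₀ (pow_ne_zero _ two_ne_zero)]

/-- The mixer is unitary: `U(B, β)† U(B, β) = 1`. [cite: FarhiGoldstoneGutmann2014, eq. (4) (U(B, β)
= e^{−iβB} unitary)] -/
theorem mixUnitary_conjTranspose_mul_mixUnitary (β : ℝ) : (mixUnitary β : Matrix (V → Bool) (V → Bool) ℂ)ᴴ * mixUnitary β = 1 := by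
  have h := mixUnitary_conj_pauliString (V := V) β (fun _ => Pauli.I)
  rw [pauliString_const_I, Matrix.mul_one] at h
  rw [h]
  have : (fun _ : V => (mixerGate β)ᴴ * Pauli.I.mat * mixerGate β) = fun _ : V => (1 : Matrix Bool Bool ℂ) := by
    funext i
    exact mixerGate_conj_one β
  rw [this, tensorAll_one]

/-- The final state is the mixer applied to the state after the phase separator. [folklore] -/
private theorem finalState_eq (γ β : ℝ) : finalState G γ β = mixUnitary β * phaseState G γ * (mixUnitary β)ᴴ := by
  rw [finalState, qaoaUnitary, phaseState, conjTranspose_mul]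
  simp only [Matrix.mul_assoc]

/-- Cyclicity (Heisenberg picture for the mixer): `tr[O · U ρ₀ U†] = tr[(U(B)† O U(B)) · W(γ)]`.
[cite: FarhiGoldstoneGutmann2014, §2 (⟨s|U†(C,γ₁) U†(B,β₁) C_⟨jk⟩ U(B,β₁) U(C,γ₁)|s⟩)] [cite:
WangHadfieldJiangRieffel2018, App. A (⟨C_uv⟩ = tr[ρ₀ e^{iγC} e^{iβB} C_uv e^{−iβB} e^{−iγC}])] -/
theorem trace_mul_finalState (γ β : ℝ) (O : Matrix (V → Bool) (V → Bool) ℂ) :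
    (O * finalState G γ β).trace = ((mixUnitary β)ᴴ * O * mixUnitary β * phaseState G γ).trace := by
  rw [finalState_eq, ← Matrix.mul_assoc, ← Matrix.mul_assoc, Matrix.trace_mul_comm,
    ← Matrix.mul_assoc, ← Matrix.mul_assoc]

/-- **`λ_{uv}`, the number of triangles of `G` containing the edge `⟨uv⟩`** = the number of common
neighbours of `u` and `v`. [cite: WangHadfieldJiangRieffel2018, §3 Thm. 1 (λ_uv is the number of
triangles in the graph containing edge ⟨uv⟩)] -/
def edgeTriangles (u v : V) : ℕ := (G.neighborFinset u ∩ G.neighborFinset v).card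

/-- `λ_{uv} = λ_{vu}`. [folklore] -/
private theorem edgeTriangles_comm (u v : V) : edgeTriangles G u v = edgeTriangles G v u := by
  rw [edgeTriangles, edgeTriangles, Finset.inter_comm]

/-- **The printed right-hand side of Theorem 1** as a function of the local data `(d_u, d_v,
λ_{uv})` of an edge and the angles: `½ + ¼ (sin 4β sin γ)(cos^{d_u} γ + cos^{d_v} γ) − ¼ (sin² 2β
cos^{d_u+d_v−2λ_{uv}} γ)(1 − cos^{λ_{uv}} 2γ)` (“the expectation value of any edge ⟨C_uv⟩ depends
only on the parameters (d_u, d_v, λ_uv)”). [cite: WangHadfieldJiangRieffel2018, §3 Thm. 1] -/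
def levelOneEdge (du dv lam : ℕ) (γ β : ℝ) : ℝ :=
  1 / 2 + 1 / 4 * (Real.sin (4 * β) * Real.sin γ) * (Real.cos γ ^ du + Real.cos γ ^ dv) -
    1 / 4 * (Real.sin (2 * β) ^ 2 * Real.cos γ ^ (du + dv - 2 * lam)) * (1 - Real.cos (2 * γ) ^ lam)

/-- The edge formula is symmetric in the two ends. [folklore] -/
private theorem levelOneEdge_comm (du dv lam : ℕ) (γ β : ℝ) :
    levelOneEdge du dv lam γ β = levelOneEdge dv du lam γ β := by
  rw [levelOneEdge, levelOneEdge, add_comm (Real.cos γ ^ du), Nat.add_comm du dv]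

/-- **Theorem 1 (Wang–Hadfield–Jiang–Rieffel 2018): the level-1 QAOA expectation of an edge.** “For
QAOA with `p = 1`, for each edge `⟨uv⟩`, `⟨C_uv⟩ = ½ + ¼ (sin 4β sin γ)(cos^{d_u} γ + cos^{d_v} γ) −
¼ (sin² 2β cos^{d_u+d_v−2λ_uv} γ)(1 − cos^{λ_uv} 2γ)`, where `d_u + 1` and `d_v + 1` are the degrees
of vertices `u` and `v`, respectively, and `λ_uv` is the number of triangles in the graph containing
edge `⟨uv⟩`.” Here `d_u = G.degree u − 1`, `λ_uv = edgeTriangles G u v`, and the real right-hand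
side `levelOneEdge` is cast to `ℂ`. [cite: WangHadfieldJiangRieffel2018, §3 Thm. 1 and App. A
(proof)] -/
theorem edgeExpect_eq (γ β : ℝ) {u v : V} (huv : G.Adj u v) :
    edgeExpect G γ β s(u, v) =
      (levelOneEdge (G.degree u - 1) (G.degree v - 1) (edgeTriangles G u v) γ β : ℂ) := by
  have hne : u ≠ v := G.ne_of_adj huv
  rw [edgeExpect, trace_mul_finalState, edgeTerm_mk, sitePauli_Z_mul_sitePauli_Z_eq_word₂ hne]
  rw [Matrix.mul_smul, Matrix.smul_mul, Matrix.mul_sub, Matrix.sub_mul, Matrix.mul_one,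
    mixUnitary_conjTranspose_mul_mixUnitary, mixUnitary_conj_ZZ β hne]
  rw [Matrix.smul_mul, Matrix.trace_smul, Matrix.sub_mul, Matrix.one_mul, Matrix.trace_sub,
    trace_phaseState]
  simp only [Matrix.add_mul, Matrix.smul_mul, Matrix.trace_add, Matrix.trace_smul, smul_eq_mul]
  rw [trace_ZZ_phaseState G γ hne, trace_ZY_phaseState G γ huv, trace_YZ_phaseState G γ huv,
    trace_YY_phaseState G γ huv]
  rw [levelOneEdge, edgeTriangles]
  have h4 : Complex.sin (4 * (β : ℂ)) = 2 * Complex.sin (2 * (β : ℂ)) * Complex.cos (2 * (β : ℂ)) := by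
    rw [show (4 : ℂ) * β = 2 * (2 * β) by ring, Complex.sin_two_mul]
  push_cast
  rw [h4]
  ring

/-- Theorem 1 as a function on edges `Sym2 V` (the formula is symmetric under `u ↔ v`): the summand
of `F(γ,β) = Σ_{(d₁,d₂,λ)} ⟨C_uv⟩ χ(d₁,d₂,λ)`. [cite: WangHadfieldJiangRieffel2018, §3 (F(γ,β) =
Σ_{(d₁,d₂,λ)} ⟨C_uv⟩ χ(d₁,d₂,λ))] -/
def edgeFormula (γ β : ℝ) : Sym2 V → ℝ :=
  Sym2.lift ⟨fun u v => levelOneEdge (G.degree u - 1) (G.degree v - 1) (edgeTriangles G u v) γ β,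
    fun u v => by
      simp only [edgeTriangles_comm G u v, levelOneEdge_comm (G.degree u - 1)]⟩

/-- Unfolding of the edge formula. [folklore] -/
private theorem edgeFormula_mk (γ β : ℝ) (u v : V) :
    edgeFormula G γ β s(u, v) = levelOneEdge (G.degree u - 1) (G.degree v - 1) (edgeTriangles G u v) γ β :=
  rfl

/-- **`F(γ, β) = Σ_{⟨uv⟩ ∈ E} ⟨C_uv⟩` in closed form** — “Thus, for an arbitrary graph the
expectation value `F(γ, β)` may be efficiently computed classically”. [cite:
WangHadfieldJiangRieffel2018, §3 (display after Thm. 1 and the sentence following it)] -/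
theorem levelOne_eq_sum_edgeFormula (γ β : ℝ) :
    levelOne G γ β = ∑ e ∈ G.edgeFinset, (edgeFormula G γ β e : ℂ) := by
  rw [levelOne_eq_sum_edgeExpect]
  refine Finset.sum_congr rfl fun e he => ?_
  induction e using Sym2.ind with
  | h u v =>
    rw [edgeExpect_eq G γ β (SimpleGraph.mem_edgeFinset.1 he), edgeFormula_mk]


/-! ### Faithfulness: the operators are the printed exponentials, `ρ₀ = |s⟩⟨s|`, `F = ⟨γ,β|C|γ,β⟩` -/

/-- **`U(C, γ) = e^{−iγC}`**: the diagonal matrix `costUnitary` IS the matrix exponential (Mathlib's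
`NormedSpace.exp`) of `−iγ C`. [cite: FarhiGoldstoneGutmann2014, eq. (2) (U(C, γ) = e^{−iγC})]
[cite: WangHadfieldJiangRieffel2018, §2 (U_C(γ) ≡ exp[−iγ H_C])] -/
theorem costUnitary_eq_exp (γ : ℝ) : costUnitary G γ = NormedSpace.exp ((-(Complex.I * γ)) • costOp G) := by
  rw [costOp_eq_diagonal, ← Matrix.diagonal_smul, Matrix.exp_diagonal, costUnitary]
  congr 1
  funext x
  rw [Pi.exp_def]
  simp only [Pi.smul_apply, smul_eq_mul]
  rw [congrFun Complex.exp_eq_exp_ℂ]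
  ring_nf

/-- Plumbing: single-site `σ^x` operators commute. [folklore] -/
private theorem commute_sitePauli_X (a b : V) : Commute (sitePauli Pauli.X a) (sitePauli Pauli.X b) := by
  rw [Commute, SemiconjBy, sitePauli, sitePauli, pauliString_eq, pauliString_eq, tensorAll_mul, tensorAll_mul]
  congr 1
  funext i
  rw [siteWord_apply, siteWord_apply]
  by_cases hia : i = a
  · by_cases hib : i = b
    · rw [if_pos hia, if_pos hib]
    · rw [if_pos hia, if_neg hib]; simp [Pauli.mat]
  · by_cases hib : i = b
    · rw [if_neg hia, if_pos hib]; simp [Pauli.mat]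
    · rw [if_neg hia, if_neg hib]

/-- Plumbing: linearity of `tensorAll` in one slot (differences). [folklore] -/
private theorem tensorAll_update_sub (A : V → Matrix Bool Bool ℂ) (j : V) (B C : Matrix Bool Bool ℂ) :
    tensorAll (Function.update A j (B - C)) =
      tensorAll (Function.update A j B) - tensorAll (Function.update A j C) := by
  ext x y
  simp only [Matrix.sub_apply, tensorAll_update_apply, sub_mul]

/-- **`e^{−iβσ^x_w} = 1 ⊗ ⋯ ⊗ (cos β − i sin β σ^x) ⊗ ⋯ ⊗ 1`** (matrix exponential, via the tree's
`exp_eq_pauliRot`). [cite: FarhiGoldstoneGutmann2014, eq. (4) (the commuting one bit operators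
e^{−iβσ^x_j})] -/
theorem exp_sitePauli_X (β : ℝ) (w : V) :
    NormedSpace.exp ((-(Complex.I * β)) • sitePauli Pauli.X w) =
      tensorAll (Function.update (fun _ : V => (1 : Matrix Bool Bool ℂ)) w (mixerGate β)) := by
  have h := PauliPropagation.exp_eq_pauliRot (2 * β) (siteWord Pauli.X w)
  have h2 : ((2 * β / 2 : ℝ) : ℂ) = (β : ℂ) := by push_cast; ring
  rw [h2] at h
  rw [sitePauli, h, PauliPropagation.pauliRot_eq, mul_div_cancel_left₀ β two_ne_zero, siteWord,
    pauliString_update_const, mixerGate, tensorAll_update_sub, tensorAll_update_smul, tensorAll_update_smul,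
    Function.update_eq_self, tensorAll_one]


/-- `e^{−iβ Σ_{w∈s} σ^x_w} = ⊗_{w∈s} e^{−iβσ^x_w}` for any vertex set `s` (induction on `s`,
`Matrix.exp_add_of_commute`). [folklore] -/
private theorem exp_sum_sitePauli_X (β : ℝ) (s : Finset V) :
    NormedSpace.exp ((-(Complex.I * β)) • ∑ w ∈ s, sitePauli Pauli.X w) =
      tensorAll (fun w => if w ∈ s then mixerGate β else (1 : Matrix Bool Bool ℂ)) := by
  induction s using Finset.induction_on with
  | empty =>
    rw [Finset.sum_empty, smul_zero, NormedSpace.exp_zero]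
    simp only [Finset.notMem_empty, if_false]
    exact tensorAll_one.symm
  | insert a s ha ih =>
    have hcomm : Commute ((-(Complex.I * β)) • sitePauli Pauli.X a) ((-(Complex.I * β)) • ∑ w ∈ s, sitePauli Pauli.X w) :=
      ((Commute.sum_right _ _ _ fun w _ => commute_sitePauli_X a w).smul_right _).smul_left _
    rw [Finset.sum_insert ha, smul_add, Matrix.exp_add_of_commute _ _ hcomm, exp_sitePauli_X, ih, tensorAll_mul]
    congr 1
    funext i
    by_cases hia : i = a
    · subst hia
      rw [Function.update_self, if_neg ha, if_pos (Finset.mem_insert_self _ _), Matrix.mul_one]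
    · rw [Function.update_of_ne hia, Matrix.one_mul]
      by_cases his : i ∈ s
      · rw [if_pos his, if_pos (Finset.mem_insert_of_mem his)]
      · rw [if_neg his, if_neg (fun h => his ((Finset.mem_insert.1 h).resolve_left hia))]

/-- **`U(B, β) = e^{−iβB} = ∏_w e^{−iβσ^x_w}`**: the tensor-product matrix `mixUnitary` IS the
matrix exponential of `−iβ B`. [cite: FarhiGoldstoneGutmann2014, eq. (4) (U(B, β) = e^{−iβB} = ∏_j
e^{−iβσ^x_j})] [cite: WangHadfieldJiangRieffel2018, §2 (U_B(β) ≡ exp[−iβ H_B])] -/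
theorem mixUnitary_eq_exp (β : ℝ) : (mixUnitary β : Matrix (V → Bool) (V → Bool) ℂ) = NormedSpace.exp ((-(Complex.I * β)) • mixOp) := by
  rw [mixOp, exp_sum_sitePauli_X]
  simp only [Finset.mem_univ, if_true]
  rfl

/-- **The uniform superposition `|s⟩ = 2^{−n/2} Σ_z |z⟩ = |+⟩₁|+⟩₂…|+⟩_n`.** [cite:
FarhiGoldstoneGutmann2014, eq. (5) and §2 (|s⟩ = |+⟩₁…|+⟩_n)] -/
def plusState : (V → Bool) → ℂ := fun _ => ((Real.sqrt (2 ^ Fintype.card V))⁻¹ : ℝ)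

omit [DecidableEq V] in
/-- **`ρ₀ = |s⟩⟨s|`**: the product `∏_w ½(1 + σ^x_w)` is the projector onto the uniform
superposition. [cite: WangHadfieldJiangRieffel2018, §2 (“ρ₀ = |ψ₀⟩⟨ψ₀| = ∏_j ½(1+σ^x_j)”, the ground
state of −H_B)] [cite: FarhiGoldstoneGutmann2014, eq. (5)] -/
theorem initialState_eq_vecMulVec :
    (initialState : Matrix (V → Bool) (V → Bool) ℂ) = vecMulVec plusState (star plusState) := by
  ext x y
  rw [initialState_apply, vecMulVec_apply, Pi.star_apply]
  unfold plusState
  rw [Complex.star_def, Complex.conj_ofReal, ← Complex.ofReal_mul, ← mul_inv,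
    Real.mul_self_sqrt (by positivity)]
  push_cast
  ring

/-- **The QAOA state `|γ, β⟩ = U(B, β) U(C, γ) |s⟩`** (`p = 1`). [cite: FarhiGoldstoneGutmann2014,
eq. (6) (p = 1)] [cite: WangHadfieldJiangRieffel2018, §2 (|γ, β⟩ = U|ψ₀⟩)] -/
def qaoaState (γ β : ℝ) : (V → Bool) → ℂ := qaoaUnitary G γ β *ᵥ plusState

/-- **`F(γ, β) = ⟨γ, β| C |γ, β⟩`**: the trace form `tr[H_C U ρ₀ U†]` of WHJR is FGG's expectation
of `C` in the QAOA state. [cite: FarhiGoldstoneGutmann2014, eq. (7) (F_p(γ, β) = ⟨γ, β|C|γ, β⟩)]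
[cite: WangHadfieldJiangRieffel2018, §2 (F(γ, β) = tr[H_C U ρ₀ U†])] -/
theorem levelOne_eq_expectation (γ β : ℝ) :
    levelOne G γ β = star (qaoaState G γ β) ⬝ᵥ (costOp G *ᵥ qaoaState G γ β) := by
  rw [levelOne, finalState, initialState_eq_vecMulVec, qaoaState, mul_vecMulVec, vecMulVec_mul, ← star_mulVec,
    mul_vecMulVec, trace_vecMulVec, dotProduct_comm]


/-! ### Corollary 1: triangle-free regular graphs -/

/-- In a triangle-free graph an edge lies in no triangle: `λ_{uv} = 0`. [cite:
WangHadfieldJiangRieffel2018, §3 Cor. 1 (triangle-free)] -/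
theorem edgeTriangles_eq_zero_of_cliqueFree (hG : G.CliqueFree 3) {u v : V} (huv : G.Adj u v) :
    edgeTriangles G u v = 0 := by
  rw [edgeTriangles, Finset.card_eq_zero, Finset.eq_empty_iff_forall_notMem]
  intro w hw
  rw [Finset.mem_inter, SimpleGraph.mem_neighborFinset, SimpleGraph.mem_neighborFinset] at hw
  exact hG {u, v, w} (SimpleGraph.is3Clique_triple_iff.2 ⟨huv, hw.1, hw.2⟩)

/-- **The level-1 value of an edge of a triangle-free `(d+1)`-regular graph, `½ (1 + sin 4β sin γ
cos^d γ)`** (Theorem 1 with `d_u = d_v = d`, `λ = 0`). [cite: WangHadfieldJiangRieffel2018, §3 Cor.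
1 (F(γ,β) = |E|/2 (1 + sin 4β sin γ cos^d γ))] -/
def regularEdge (d : ℕ) (γ β : ℝ) : ℝ := 1 / 2 * (1 + Real.sin (4 * β) * Real.sin γ * Real.cos γ ^ d)

/-- Theorem 1 at `d_u = d_v = d`, `λ = 0`. [folklore] -/
private theorem levelOneEdge_regular (d : ℕ) (γ β : ℝ) : levelOneEdge d d 0 γ β = regularEdge d γ β := by
  rw [levelOneEdge, regularEdge]
  simp only [pow_zero, sub_self, mul_zero, sub_zero]
  ring

/-- **Corollary 1 (per edge): `⟨C_uv⟩ = ½(1 + sin 4β sin γ cos^d γ)`** on every edge of a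
triangle-free `(d+1)`-regular graph. [cite: WangHadfieldJiangRieffel2018, §3 Cor. 1] -/
theorem edgeExpect_eq_of_regular_cliqueFree {d : ℕ} (hreg : G.IsRegularOfDegree (d + 1))
    (hG : G.CliqueFree 3) (γ β : ℝ) {u v : V} (huv : G.Adj u v) :
    edgeExpect G γ β s(u, v) = (regularEdge d γ β : ℂ) := by
  rw [edgeExpect_eq G γ β huv, hreg.degree_eq u, hreg.degree_eq v, Nat.add_sub_cancel,
    edgeTriangles_eq_zero_of_cliqueFree G hG huv, levelOneEdge_regular]

/-- **Corollary 1 (Wang–Hadfield–Jiang–Rieffel 2018): `F(γ, β) = |E|/2 · (1 + sin 4β sin γ cos^d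
γ)`** for a triangle-free `(d+1)`-regular graph. [cite: WangHadfieldJiangRieffel2018, §3 Cor. 1
(F(γ,β) = |E|/2 (1 + sin 4β sin γ cos^d γ))] -/
theorem levelOne_eq_of_regular_cliqueFree {d : ℕ} (hreg : G.IsRegularOfDegree (d + 1))
    (hG : G.CliqueFree 3) (γ β : ℝ) :
    levelOne G γ β = ((G.edgeFinset.card : ℝ) * regularEdge d γ β : ℝ) := by
  rw [levelOne_eq_sum_edgeExpect]
  have h : ∀ e ∈ G.edgeFinset, edgeExpect G γ β e = (regularEdge d γ β : ℂ) := by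
    intro e he
    induction e using Sym2.ind with
    | h u v => exact edgeExpect_eq_of_regular_cliqueFree G hreg hG γ β (SimpleGraph.mem_edgeFinset.1 he)
  rw [Finset.sum_congr rfl h, Finset.sum_const, nsmul_eq_mul]
  push_cast
  ring

/-- **The printed maximal edge value `(1/√(d+1)) (d/(d+1))^{d/2}`** (so that `F* = |E|/2 (1 +
regularMax d) = C^reg_max(d)`), written with `(√(d/(d+1)))^d = (d/(d+1))^{d/2}`. [cite:
WangHadfieldJiangRieffel2018, §3 Cor. 1 (F* = |E|/2 (1 + (1/√(d+1))(d/(d+1))^{d/2}) =: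
C^reg_max(d))] -/
def regularMax (d : ℕ) : ℝ := 1 / Real.sqrt (d + 1) * Real.sqrt (d / (d + 1)) ^ d

/-- `regularMax d ≥ 0`. [folklore] -/
private theorem regularMax_nonneg (d : ℕ) : 0 ≤ regularMax d := by
  unfold regularMax; positivity

/-- `(regularMax d)² = d^d/(d+1)^{d+1}`. [folklore] -/
private theorem regularMax_sq (d : ℕ) : regularMax d ^ 2 = (d : ℝ) ^ d / (d + 1) ^ (d + 1) := by
  unfold regularMax
  rw [mul_pow, ← pow_mul, mul_comm d 2, pow_mul, Real.sq_sqrt (by positivity), div_pow,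
    Real.sq_sqrt (by positivity), div_pow, one_pow, pow_succ]
  field_simp

/-- **The maximisation behind Corollary 1 (AM–GM): `x (1 − x)^d ≤ d^d/(d+1)^{d+1}` for `0 ≤ x ≤ 1`**
— with `x = sin² γ` this is `(sin γ cos^d γ)² ≤ (regularMax d)²`, i.e. the maximum of `F(γ,β) =
|E|/2 (1 + sin 4β sin γ cos^d γ)` over the angles. [cite: WangHadfieldJiangRieffel2018, §3 Cor. 1
(“with maximum F* = |E|/2 (1 + (1/√(d+1))(d/(d+1))^{d/2})”)] -/
theorem mul_pow_le_max {x : ℝ} (hx0 : 0 ≤ x) (hx1 : x ≤ 1) (d : ℕ) :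
    x * (1 - x) ^ d ≤ (d : ℝ) ^ d / (d + 1) ^ (d + 1) := by
  rcases Nat.eq_zero_or_pos d with rfl | hd
  · simp; exact hx1
  have hd' : (0 : ℝ) < d := Nat.cast_pos.2 hd
  have hd1 : (0 : ℝ) < d + 1 := by linarith
  -- weighted AM–GM with weights `1/(d+1)`, `d/(d+1)` and points `(d+1)x`, `(d+1)(1−x)/d`
  set w₁ : ℝ := 1 / (d + 1) with hw₁
  set w₂ : ℝ := d / (d + 1) with hw₂
  set p₁ : ℝ := (d + 1) * x with hp₁
  set p₂ : ℝ := (d + 1) * (1 - x) / d with hp₂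
  have hw₁0 : 0 ≤ w₁ := by positivity
  have hw₂0 : 0 ≤ w₂ := by positivity
  have hp₁0 : 0 ≤ p₁ := by positivity
  have hp₂0 : 0 ≤ p₂ := by rw [hp₂]; apply div_nonneg <;> nlinarith
  have hw : w₁ + w₂ = 1 := by rw [hw₁, hw₂]; field_simp; ring
  have hamgm := Real.geom_mean_le_arith_mean2_weighted hw₁0 hw₂0 hp₁0 hp₂0 hw
  have hrhs : w₁ * p₁ + w₂ * p₂ = 1 := by
    rw [hw₁, hw₂, hp₁, hp₂]; field_simp; ring
  rw [hrhs] at hamgm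
  -- raise to the power `d + 1`
  have hL0 : 0 ≤ p₁ ^ w₁ * p₂ ^ w₂ := by positivity
  have hpow : (p₁ ^ w₁ * p₂ ^ w₂) ^ (d + 1) ≤ 1 := pow_le_one₀ hL0 hamgm
  have h1 : (p₁ ^ w₁) ^ (d + 1) = p₁ := by
    rw [← Real.rpow_natCast, ← Real.rpow_mul hp₁0, hw₁]
    push_cast
    rw [one_div_mul_cancel (ne_of_gt hd1), Real.rpow_one]
  have h2 : (p₂ ^ w₂) ^ (d + 1) = p₂ ^ d := by
    rw [← Real.rpow_natCast, ← Real.rpow_mul hp₂0, hw₂]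
    push_cast
    rw [div_mul_cancel₀ _ (ne_of_gt hd1), Real.rpow_natCast]
  rw [mul_pow, h1, h2, hp₁, hp₂, div_pow, mul_pow] at hpow
  -- unpack: `(d+1) x ((d+1)^d (1−x)^d / d^d) ≤ 1`
  rw [le_div_iff₀ (by positivity)]
  have hdd : (0 : ℝ) < (d : ℝ) ^ d := by positivity
  have key : (d + 1 : ℝ) * x * ((d + 1) ^ d * (1 - x) ^ d) ≤ (d : ℝ) ^ d := by
    have := mul_le_mul_of_nonneg_right hpow (le_of_lt hdd)
    rwa [one_mul, mul_assoc, div_mul_cancel₀ _ (ne_of_gt hdd)] at this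
  calc x * (1 - x) ^ d * (d + 1 : ℝ) ^ (d + 1) = (d + 1 : ℝ) * x * ((d + 1) ^ d * (1 - x) ^ d) := by ring
    _ ≤ (d : ℝ) ^ d := key

/-- **`sin γ cos^d γ ≤ (1/√(d+1)) (d/(d+1))^{d/2}`** for every `γ`. [cite:
WangHadfieldJiangRieffel2018, §3 Cor. 1 (maximum over γ)] -/
theorem sin_mul_cos_pow_le (γ : ℝ) (d : ℕ) : Real.sin γ * Real.cos γ ^ d ≤ regularMax d := by
  refine le_trans (le_abs_self _) (abs_le_of_sq_le_sq ?_ (regularMax_nonneg d))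
  rw [regularMax_sq, mul_pow, ← pow_mul, mul_comm d 2, pow_mul, Real.cos_sq', ]
  exact mul_pow_le_max (sq_nonneg _) (Real.sin_sq_le_one γ) d

/-- **Corollary 1 (maximum): for all angles `½(1 + sin 4β sin γ cos^d γ) ≤ ½(1 +
(1/√(d+1))(d/(d+1))^{d/2})`**, i.e. `F(γ, β) ≤ C^reg_max(d)` on a triangle-free `(d+1)`-regular
graph. [cite: WangHadfieldJiangRieffel2018, §3 Cor. 1 (“with maximum F*”)] -/
theorem regularEdge_le (d : ℕ) (γ β : ℝ) : regularEdge d γ β ≤ 1 / 2 * (1 + regularMax d) := by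
  unfold regularEdge
  have h1 : Real.sin (4 * β) * Real.sin γ * Real.cos γ ^ d ≤ regularMax d := by
    have hb : |Real.sin (4 * β)| ≤ 1 := Real.abs_sin_le_one _
    have ht : |Real.sin γ * Real.cos γ ^ d| ≤ regularMax d :=
      abs_le_of_sq_le_sq (by
        rw [regularMax_sq, mul_pow, ← pow_mul, mul_comm d 2, pow_mul, Real.cos_sq']
        exact mul_pow_le_max (sq_nonneg _) (Real.sin_sq_le_one γ) d) (regularMax_nonneg d)
    calc Real.sin (4 * β) * Real.sin γ * Real.cos γ ^ d
        ≤ |Real.sin (4 * β) * (Real.sin γ * Real.cos γ ^ d)| := by rw [mul_assoc]; exact le_abs_self _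
      _ = |Real.sin (4 * β)| * |Real.sin γ * Real.cos γ ^ d| := abs_mul _ _
      _ ≤ 1 * regularMax d := mul_le_mul hb ht (abs_nonneg _) zero_le_one
      _ = regularMax d := one_mul _
  linarith

/-- **Corollary 1 (optimal angles): “For any such graph, one optimal pair of angles is `(γ, β) =
(arctan(1/√d), π/8)`”** — at these angles the edge value equals `½(1 + (1/√(d+1))(d/(d+1))^{d/2})`
(`d ≥ 1`). [cite: WangHadfieldJiangRieffel2018, §3 Cor. 1] -/
theorem regularEdge_optimal {d : ℕ} (hd : 0 < d) :
    regularEdge d (Real.arctan (1 / Real.sqrt d)) (Real.pi / 8) = 1 / 2 * (1 + regularMax d) := by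
  have hd' : (0 : ℝ) < d := Nat.cast_pos.2 hd
  unfold regularEdge regularMax
  rw [show 4 * (Real.pi / 8) = Real.pi / 2 by ring, Real.sin_pi_div_two, one_mul, Real.sin_arctan,
    Real.cos_arctan]
  have hsq : 1 + (1 / Real.sqrt d) ^ 2 = (d + 1) / d := by
    rw [div_pow, one_pow, Real.sq_sqrt (le_of_lt hd')]; field_simp
  rw [hsq]
  congr 2
  have hs1 : Real.sqrt ((d + 1) / d) = Real.sqrt (d + 1) / Real.sqrt d := by
    rw [Real.sqrt_div (le_of_lt (by linarith : (0:ℝ) < d + 1))]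
  rw [hs1]
  have hsd : Real.sqrt (d : ℝ) ≠ 0 := (Real.sqrt_pos.2 hd').ne'
  have hsd1 : Real.sqrt (d + 1 : ℝ) ≠ 0 := (Real.sqrt_pos.2 (by linarith)).ne'
  rw [Real.sqrt_div (le_of_lt hd') (d + 1), one_div_div]
  field_simp


/-! ### The ring of disagrees and triangle-free 3-regular graphs; the `1/√e` bound -/

/-- `d = 1` (the ring of disagrees): `(1/√2)(1/2)^{1/2} = 1/2`, so `F* = ¾|E|`. [cite:
WangHadfieldJiangRieffel2018, §3 (“Equation … yields the approximation ratio 0.75 at (β,γ) =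
(π/8,π/4), reproducing the results in [Farhi2014]”)] [cite: FarhiGoldstoneGutmann2014, §4 (ring of
disagrees: “for p = 1 … the maxima are 3/4, …”)] -/
theorem regularMax_one : regularMax 1 = 1 / 2 := by
  unfold regularMax
  have h2 : Real.sqrt 2 ≠ 0 := (Real.sqrt_pos.2 (by norm_num)).ne'
  rw [pow_one, Nat.cast_one, show (1 : ℝ) + 1 = 2 by norm_num, Real.sqrt_div zero_le_one, Real.sqrt_one]
  field_simp
  rw [Real.sq_sqrt (by norm_num)]

/-- **Ring of disagrees, `p = 1`: every edge value is `≤ 3/4`, hence `F₁ ≤ ¾|E|`** — the `3/4` of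
Farhi–Goldstone–Gutmann. [cite: FarhiGoldstoneGutmann2014, §4 (p = 1 maximum 3/4)] [cite:
WangHadfieldJiangRieffel2018, §3 (ratio 0.75 for the ring)] -/
theorem regularEdge_one_le (γ β : ℝ) : regularEdge 1 γ β ≤ 3 / 4 := by
  have h := regularEdge_le 1 γ β
  rw [regularMax_one] at h
  linarith

/-- **Ring of disagrees: the value `3/4` is attained at `(β, γ) = (π/8, π/4)`.** [cite:
WangHadfieldJiangRieffel2018, §3 (“the approximation ratio 0.75 at (β,γ) = (π/8,π/4)”)] [cite:
FarhiGoldstoneGutmann2014, §4] -/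
theorem regularEdge_one_optimal : regularEdge 1 (Real.pi / 4) (Real.pi / 8) = 3 / 4 := by
  have h := regularEdge_optimal Nat.one_pos
  rw [Nat.cast_one, Real.sqrt_one, div_one, Real.arctan_one, regularMax_one] at h
  rw [h]
  norm_num

/-- `d = 2` (triangle-free 3-regular graphs): `(1/√3)(2/3)^{2/2} = 2/(3√3)`. [cite:
WangHadfieldJiangRieffel2018, §3 (“For triangle-free 3-regular graph (d=2), the ratio is 0.692”)] -/
theorem regularMax_two : regularMax 2 = 2 / (3 * Real.sqrt 3) := by
  unfold regularMax
  rw [Nat.cast_ofNat, show (2 : ℝ) + 1 = 3 by norm_num, Real.sq_sqrt (by norm_num)]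
  field_simp

/-- **Triangle-free 3-regular graphs, `p = 1`: the optimal value per edge `½(1 + 2/(3√3))` lies in
`(0.6924, 0.6925)`** (“the ratio is 0.692, also in agreement with the results of Ref. [Farhi2014]
for a general 3-regular graph”; FGG: “at least 0.6924 times the size of the optimal cut”). [cite:
WangHadfieldJiangRieffel2018, §3 (ratio 0.692 for d = 2)] [cite: FarhiGoldstoneGutmann2014, abstract
and §5 (0.6924 for 3-regular graphs at p = 1)] -/
theorem regularMax_two_bounds :
    (0.6924 : ℝ) < 1 / 2 * (1 + regularMax 2) ∧ 1 / 2 * (1 + regularMax 2) < 0.6925 := by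
  rw [regularMax_two]
  have h3 : Real.sqrt 3 ^ 2 = 3 := Real.sq_sqrt (by norm_num)
  have hpos : 0 < Real.sqrt 3 := Real.sqrt_pos.2 (by norm_num)
  have hlo : (1.7320 : ℝ) < Real.sqrt 3 := by nlinarith
  have hhi : Real.sqrt 3 < (1.7321 : ℝ) := by nlinarith
  constructor
  · have : (0.3848 : ℝ) < 2 / (3 * Real.sqrt 3) := by
      rw [lt_div_iff₀ (by positivity)]; nlinarith
    linarith
  · have : 2 / (3 * Real.sqrt 3) < 0.3850 := by
      rw [div_lt_iff₀ (by positivity)]; nlinarith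
    linarith

/-- **`regularMax d ≥ 1/(√e √(d+1))`**, from `(d/(d+1))^d ≥ 1/e` (which follows from `1 + 1/d ≤
e^{1/d}`): the printed lower bound “the optimal approximation ratio is lower-bounded as `r > ½(1 +
(1/√e)(1/√(d+1)))`” in non-strict form. [cite: WangHadfieldJiangRieffel2018, §3 (“Notice that
(d/(d+1))^d > 1/e …”)] -/
theorem regularMax_ge (d : ℕ) : 1 / (Real.sqrt (Real.exp 1) * Real.sqrt (d + 1)) ≤ regularMax d := by
  unfold regularMax
  have hd1 : (0 : ℝ) < d + 1 := by positivity
  -- `(d/(d+1))^d ≥ exp(−1)`, from `1 + 1/d ≤ exp(1/d)`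
  have hkey : Real.exp (-1) ≤ ((d : ℝ) / (d + 1)) ^ d := by
    rcases Nat.eq_zero_or_pos d with rfl | hd
    · simp
    have hd' : (0 : ℝ) < d := Nat.cast_pos.2 hd
    have h1 : (d + 1 : ℝ) / d ≤ Real.exp (1 / d) := by
      have := Real.add_one_le_exp (1 / (d : ℝ))
      rw [show (d + 1 : ℝ) / d = 1 / d + 1 by field_simp; ring]
      exact this
    have h2 : Real.exp (-(1 / d : ℝ)) ≤ (d : ℝ) / (d + 1) := by
      rw [Real.exp_neg, show (d : ℝ) / (d + 1) = (((d : ℝ) + 1) / d)⁻¹ by rw [inv_div]]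
      exact inv_anti₀ (by positivity) h1
    calc Real.exp (-1) = Real.exp (-(1 / d : ℝ)) ^ d := by
          rw [← Real.exp_nat_mul]; congr 1; field_simp
      _ ≤ ((d : ℝ) / (d + 1)) ^ d := pow_le_pow_left₀ (Real.exp_nonneg _) h2 d
  have hA : 1 / Real.sqrt (Real.exp 1) ≤ Real.sqrt ((d : ℝ) / (d + 1)) ^ d := by
    refine le_trans (le_abs_self _) (abs_le_of_sq_le_sq ?_ (by positivity))
    rw [← pow_mul, mul_comm d 2, pow_mul, Real.sq_sqrt (by positivity), div_pow, one_pow,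
      Real.sq_sqrt (Real.exp_nonneg _), one_div, ← Real.exp_neg]
    exact hkey
  calc 1 / (Real.sqrt (Real.exp 1) * Real.sqrt (d + 1))
      = 1 / Real.sqrt (d + 1) * (1 / Real.sqrt (Real.exp 1)) := by ring
    _ ≤ 1 / Real.sqrt (d + 1) * Real.sqrt ((d : ℝ) / (d + 1)) ^ d :=
      mul_le_mul_of_nonneg_left hA (by positivity)


/-! ## Level `p` and the light cone (FGG §2) -/

section LightCone

/-- **`M` involves only the qubits in `S`**: `M` commutes with every single-site Pauli outside `S`
(equivalently, with the whole site algebra there, since `I, σ^x, σ^y, σ^z` span it — the commutant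
condition `Chain.Free` of `DualUnitaryLightCone.lean` at every site outside `S`). FGG's “operator
[that] only involves qubits j and k and those …”. [cite: FarhiGoldstoneGutmann2014, §2 (“The factors
in the operator U(B, β₁) which do not involve qubits j or k commute through C_⟨jk⟩ … Any factors in
the operator U(C, γ₁) which do not involve qubits j or k will commute through and cancel out”)] -/
def ActsWithin (S : Finset V) (M : Matrix (V → Bool) (V → Bool) ℂ) : Prop :=
  ∀ w, w ∉ S → ∀ Q : Pauli, Commute (sitePauli Q w) M

/-- Involving only `S` is monotone in `S`. [cite: FarhiGoldstoneGutmann2014, §2 (“The factors in the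
operator U(B, β₁) which do not involve qubits j or k commute through C_⟨jk⟩ … Any factors in the
operator U(C, γ₁) which do not involve qubits j or k will commute through and cancel out”)] -/
theorem ActsWithin.mono {S T : Finset V} (hST : S ⊆ T) {M : Matrix (V → Bool) (V → Bool) ℂ}
    (h : ActsWithin S M) : ActsWithin T M :=
  fun w hw Q => h w (fun h' => hw (hST h')) Q

/-- Products of operators involving only `S` involve only `S`. [cite: FarhiGoldstoneGutmann2014, §2
(“The factors in the operator U(B, β₁) which do not involve qubits j or k commute through C_⟨jk⟩ …
Any factors in the operator U(C, γ₁) which do not involve qubits j or k will commute through and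
cancel out”)] -/
theorem ActsWithin.mul {S : Finset V} {A B : Matrix (V → Bool) (V → Bool) ℂ} (hA : ActsWithin S A)
    (hB : ActsWithin S B) : ActsWithin S (A * B) :=
  fun w hw Q => (hA w hw Q).mul_right (hB w hw Q)

/-- Sums of operators involving only `S` involve only `S`. [folklore] -/
private theorem ActsWithin.add {S : Finset V} {A B : Matrix (V → Bool) (V → Bool) ℂ} (hA : ActsWithin S A)
    (hB : ActsWithin S B) : ActsWithin S (A + B) :=
  fun w hw Q => (hA w hw Q).add_right (hB w hw Q)

/-- Differences of operators involving only `S` involve only `S`. [folklore] -/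
private theorem ActsWithin.sub {S : Finset V} {A B : Matrix (V → Bool) (V → Bool) ℂ} (hA : ActsWithin S A)
    (hB : ActsWithin S B) : ActsWithin S (A - B) :=
  fun w hw Q => (hA w hw Q).sub_right (hB w hw Q)

/-- Scalar multiples of operators involving only `S` involve only `S`. [folklore] -/
private theorem ActsWithin.smul {S : Finset V} {A : Matrix (V → Bool) (V → Bool) ℂ} (hA : ActsWithin S A)
    (c : ℂ) : ActsWithin S (c • A) :=
  fun w hw Q => (hA w hw Q).smul_right c

/-- Finite sums of operators involving only `S` involve only `S`. [folklore] -/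
private theorem ActsWithin.sum {S : Finset V} {ι : Type*} (s : Finset ι) {A : ι → Matrix (V → Bool) (V → Bool) ℂ}
    (hA : ∀ i ∈ s, ActsWithin S (A i)) : ActsWithin S (∑ i ∈ s, A i) :=
  fun w hw Q => Commute.sum_right _ _ _ fun i hi => hA i hi w hw Q

/-- The identity involves no qubit. [folklore] -/
private theorem ActsWithin.one (S : Finset V) : ActsWithin S (1 : Matrix (V → Bool) (V → Bool) ℂ) :=
  fun _ _ _ => Commute.one_right _

/-- Adjoints of operators involving only `S` involve only `S`. [cite: FarhiGoldstoneGutmann2014, §2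
(“The factors in the operator U(B, β₁) which do not involve qubits j or k commute through C_⟨jk⟩ …
Any factors in the operator U(C, γ₁) which do not involve qubits j or k will commute through and
cancel out”)] -/
theorem ActsWithin.conjTranspose {S : Finset V} {A : Matrix (V → Bool) (V → Bool) ℂ}
    (hA : ActsWithin S A) : ActsWithin S Aᴴ := by
  intro w hw Q
  have h := congr_arg Matrix.conjTranspose (hA w hw Q).eq
  rw [Matrix.conjTranspose_mul, Matrix.conjTranspose_mul, sitePauli, conjTranspose_pauliString] at h
  exact h.symm

/-- Exponentials of operators involving only `S` involve only `S`. [cite: FarhiGoldstoneGutmann2014,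
§2 and eq. (2) (e^{−iγC_α} has “the locality of the clause α”)] -/
theorem ActsWithin.exp {S : Finset V} {A : Matrix (V → Bool) (V → Bool) ℂ} (hA : ActsWithin S A) :
    ActsWithin S (NormedSpace.exp A) :=
  fun w hw Q => (hA w hw Q).exp_right

/-- Plumbing: single-site Paulis at different sites commute. [folklore] -/
private theorem commute_sitePauli {a b : V} (hab : a ≠ b) (Q P : Pauli) :
    Commute (sitePauli Q a) (sitePauli P b) := by
  rw [Commute, SemiconjBy, sitePauli, sitePauli, pauliString_eq, pauliString_eq, tensorAll_mul,
    tensorAll_mul]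
  congr 1
  funext i
  rw [siteWord_apply, siteWord_apply]
  by_cases hia : i = a
  · rw [if_pos hia, if_neg (fun h => hab (hia.symm.trans h))]; simp [Pauli.mat]
  · by_cases hib : i = b
    · rw [if_neg hia, if_pos hib]; simp [Pauli.mat]
    · rw [if_neg hia, if_neg hib]

/-- A single-site Pauli involves only its site. [cite: FarhiGoldstoneGutmann2014, eqs. (3)–(4) (the
one bit operators σ^x_j)] -/
theorem actsWithin_sitePauli {S : Finset V} {a : V} (ha : a ∈ S) (Q : Pauli) :
    ActsWithin S (sitePauli Q a) :=
  fun w hw P => commute_sitePauli (fun h : w = a => hw (h ▸ ha)) P Q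

/-- The edge term `C_{⟨ab⟩}` involves only `a` and `b` (“each term's locality is the locality of the
clause”). [cite: FarhiGoldstoneGutmann2014, eq. (2) and §2 (C_⟨jk⟩)] -/
theorem actsWithin_edgeTerm {S : Finset V} {a b : V} (ha : a ∈ S) (hb : b ∈ S) :
    ActsWithin S (edgeTerm s(a, b)) := by
  rw [edgeTerm_mk]
  exact ((ActsWithin.one S).sub ((actsWithin_sitePauli ha _).mul (actsWithin_sitePauli hb _))).smul _

/-! ### The phase separator of a set of edges -/

/-- The cost operator of an edge set `E'`, `Σ_{e ∈ E'} C_e`. [cite: FarhiGoldstoneGutmann2014, eq.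
(1) and §2 (C = Σ_⟨jk⟩ C_⟨jk⟩)] -/
def edgesOp (E' : Finset (Sym2 V)) : Matrix (V → Bool) (V → Bool) ℂ := ∑ e ∈ E', edgeTerm e

/-- **The phase separator of an edge set `E'`, `∏_{e ∈ E'} e^{−iγC_e} = diag(e^{−iγ Σ_{e∈E'}
C_e(x)})`** (the partial products of FGG's `U(C, γ) = ∏_α e^{−iγC_α}`). [cite:
FarhiGoldstoneGutmann2014, eq. (2) (U(C, γ) = e^{−iγC} = ∏_α e^{−iγC_α})] -/
def edgesUnitary (E' : Finset (Sym2 V)) (γ : ℝ) : Matrix (V → Bool) (V → Bool) ℂ :=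
  diagonal fun x => Complex.exp (-(Complex.I * γ * ((∑ e ∈ E', cutInd x e : ℕ) : ℂ)))

/-- `C` is the cost operator of the whole edge set. [folklore] -/
private theorem costOp_eq_edgesOp : costOp G = edgesOp G.edgeFinset := rfl

omit [DecidableEq V] in
/-- `U(C, γ)` is the phase separator of the whole edge set. [folklore] -/
private theorem costUnitary_eq_edgesUnitary (γ : ℝ) : costUnitary G γ = edgesUnitary G.edgeFinset γ := rfl

/-- The cost operator of an edge set is diagonal. [folklore] -/
private theorem edgesOp_eq_diagonal (E' : Finset (Sym2 V)) :
    edgesOp E' = diagonal fun x => ((∑ e ∈ E', cutInd x e : ℕ) : ℂ) := by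
  rw [edgesOp]
  simp_rw [edgeTerm_eq_diagonal]
  have h := map_sum (Matrix.diagonalAddMonoidHom (V → Bool) ℂ)
    (fun e => fun x : V → Bool => (cutInd x e : ℂ)) E'
  simp only [Matrix.diagonalAddMonoidHom_apply] at h
  rw [← h]
  congr 1
  funext x
  rw [Nat.cast_sum, Finset.sum_apply]

/-- `∏_{e∈E'} e^{−iγC_e} = e^{−iγ Σ_{e∈E'} C_e}` as a matrix exponential. [cite:
FarhiGoldstoneGutmann2014, eq. (2)] -/
theorem edgesUnitary_eq_exp (E' : Finset (Sym2 V)) (γ : ℝ) :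
    edgesUnitary E' γ = NormedSpace.exp ((-(Complex.I * γ)) • edgesOp E') := by
  rw [edgesOp_eq_diagonal, ← Matrix.diagonal_smul, Matrix.exp_diagonal, edgesUnitary]
  congr 1
  funext x
  rw [Pi.exp_def]
  simp only [Pi.smul_apply, smul_eq_mul]
  rw [congrFun Complex.exp_eq_exp_ℂ]
  ring_nf

/-- **`U(C, γ)` factors over disjoint edge sets** (“All of the terms in this product commute because
they are diagonal in the computational basis”). [cite: FarhiGoldstoneGutmann2014, eq. (2)] -/
theorem edgesUnitary_union {E₁ E₂ : Finset (Sym2 V)} (h : Disjoint E₁ E₂) (γ : ℝ) :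
    edgesUnitary (E₁ ∪ E₂) γ = edgesUnitary E₁ γ * edgesUnitary E₂ γ := by
  rw [edgesUnitary, edgesUnitary, edgesUnitary, diagonal_mul_diagonal]
  congr 1
  funext x
  rw [Finset.sum_union h, Nat.cast_add, ← Complex.exp_add]
  congr 1
  ring

/-- Phase separators are unitary. [folklore] -/
private theorem edgesUnitary_conjTranspose_mul_self (E' : Finset (Sym2 V)) (γ : ℝ) :
    (edgesUnitary E' γ)ᴴ * edgesUnitary E' γ = 1 := by
  rw [edgesUnitary, diagonal_conjTranspose, diagonal_mul_diagonal, ← diagonal_one]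
  congr 1
  funext x
  rw [Pi.star_apply, Complex.star_def, ← Complex.exp_conj, ← Complex.exp_add]
  simp only [map_neg, map_mul, Complex.conj_I, Complex.conj_ofReal, Complex.conj_natCast]
  convert Complex.exp_zero using 2
  ring

/-- Every edge of `E'` has both endpoints in `T` (“qubits on those edges”). [cite:
FarhiGoldstoneGutmann2014, §2 (“only involves … edges adjacent to ⟨jk⟩, and qubits on those edges”)] -/
def EdgesWithin (E' : Finset (Sym2 V)) (T : Finset V) : Prop := ∀ e ∈ E', ∀ a ∈ e, a ∈ T

/-- The cost operator of edges inside `T` involves only `T`. [cite: FarhiGoldstoneGutmann2014, eq.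
(2) and §2 (locality of the clauses)] -/
theorem actsWithin_edgesOp {E' : Finset (Sym2 V)} {T : Finset V} (h : EdgesWithin E' T) :
    ActsWithin T (edgesOp E') := by
  refine ActsWithin.sum E' fun e he => ?_
  induction e using Sym2.ind with
  | h a b => exact actsWithin_edgeTerm (h _ he a (Sym2.mem_mk_left a b)) (h _ he b (Sym2.mem_mk_right a b))

/-- The phase separator of edges inside `T` involves only `T`. [cite: FarhiGoldstoneGutmann2014, eq.
(2) (“each term's locality is the locality of the clause α”)] -/
theorem actsWithin_edgesUnitary {E' : Finset (Sym2 V)} {T : Finset V} (h : EdgesWithin E' T) (γ : ℝ) :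
    ActsWithin T (edgesUnitary E' γ) := by
  rw [edgesUnitary_eq_exp]
  exact ((actsWithin_edgesOp h).smul _).exp

/-- **The factors of `U(C, γ)` on edges avoiding the support commute through**: an operator
involving only `S` commutes with the phase separator of any set of edges with no endpoint in `S`.
[cite: FarhiGoldstoneGutmann2014, §2 (“The factors in the operator U(B, β₁) which do not involve
qubits j or k commute through C_⟨jk⟩ … Any factors in the operator U(C, γ₁) which do not involve
qubits j or k will commute through and cancel out”)] -/
theorem commute_edgesUnitary_of_avoid {S : Finset V} {M : Matrix (V → Bool) (V → Bool) ℂ}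
    (hM : ActsWithin S M) {E' : Finset (Sym2 V)} (hE : ∀ e ∈ E', ∀ a ∈ e, a ∉ S) (γ : ℝ) :
    Commute M (edgesUnitary E' γ) := by
  rw [edgesUnitary_eq_exp]
  refine (Commute.smul_right ?_ _).exp_right
  refine Commute.sum_right _ _ _ fun e he => ?_
  induction e using Sym2.ind with
  | h a b =>
    rw [edgeTerm_mk]
    refine Commute.smul_right (Commute.sub_right (Commute.one_right _) ?_) _
    exact ((hM a (hE _ he a (Sym2.mem_mk_left a b)) Pauli.Z).symm).mul_right
      ((hM b (hE _ he b (Sym2.mem_mk_right a b)) Pauli.Z).symm)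

/-! ### Edges meeting a vertex set; the restricted graph -/

/-- The edge `e` has an endpoint in the vertex set `T` (the edges “adjacent to” the qubits of `T`). [cite:
FarhiGoldstoneGutmann2014, §2 (“the edge ⟨jk⟩ and edges adjacent to ⟨jk⟩ … edges at most p steps away
from ⟨jk⟩”)] -/
def Meets (T : Finset V) (e : Sym2 V) : Prop := ∃ a ∈ e, a ∈ T

/-- Meeting a finite vertex set is decidable. [folklore] -/
instance meetsDecidable (T : Finset V) (e : Sym2 V) : Decidable (Meets T e) := by
  unfold Meets; infer_instance

/-- **`G` restricted to the edges with an endpoint in `T`** — FGG's subgraph of “the edge ⟨jk⟩ and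
edges adjacent to ⟨jk⟩ … edges at most p steps away from ⟨jk⟩”, for `T` the set of qubits within
distance `p − 1`. [cite: FarhiGoldstoneGutmann2014, §2 (“only involves edges at most p steps away
from ⟨jk⟩ and qubits on those edges”)] -/
def touching (T : Finset V) : SimpleGraph V where
  Adj a b := G.Adj a b ∧ (a ∈ T ∨ b ∈ T)
  symm := ⟨fun _ _ h => ⟨h.1.symm, h.2.symm⟩⟩
  loopless := ⟨fun a h => G.loopless.irrefl a h.1⟩

/-- Adjacency in the restricted graph is decidable. [folklore] -/
instance touchingDecidableRel (T : Finset V) : DecidableRel (touching G T).Adj := by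
  intro a b; unfold touching; infer_instance

omit [Fintype V] [DecidableEq V] [DecidableRel G.Adj] in
/-- Unfolding of `Meets` on `s(a, b)`. [folklore] -/
private theorem meets_mk (T : Finset V) (a b : V) : Meets T s(a, b) ↔ a ∈ T ∨ b ∈ T := by
  constructor
  · rintro ⟨c, hc, hcT⟩
    rcases Sym2.mem_iff.1 hc with rfl | rfl
    · exact Or.inl hcT
    · exact Or.inr hcT
  · rintro (h | h)
    · exact ⟨a, Sym2.mem_mk_left a b, h⟩
    · exact ⟨b, Sym2.mem_mk_right a b, h⟩

/-- The edges of the restricted graph are the edges meeting `T`. [folklore] -/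
private theorem edgeFinset_touching (T : Finset V) :
    (touching G T).edgeFinset = G.edgeFinset.filter (Meets T) := by
  ext e
  rw [Finset.mem_filter, SimpleGraph.mem_edgeFinset, SimpleGraph.mem_edgeFinset]
  induction e using Sym2.ind with
  | h a b => rw [SimpleGraph.mem_edgeSet, SimpleGraph.mem_edgeSet, meets_mk]; rfl

/-- **`U(C, γ) = (∏_{edges meeting T} e^{−iγC_e}) (∏_{edges avoiding T} e^{−iγC_e})`.** [cite:
FarhiGoldstoneGutmann2014, eq. (2) (U(C, γ) = ∏_α e^{−iγC_α}, commuting factors)] -/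
theorem costUnitary_split (T : Finset V) (γ : ℝ) :
    costUnitary G γ = edgesUnitary (G.edgeFinset.filter (Meets T)) γ *
      edgesUnitary (G.edgeFinset.filter fun e => ¬Meets T e) γ := by
  rw [costUnitary_eq_edgesUnitary, ← edgesUnitary_union (Finset.disjoint_filter_filter_not _ _ _),
    Finset.filter_union_filter_not_eq]

/-! ### The mixer on a vertex set -/

/-- The mixer restricted to a vertex set `T`: `⊗_{w∈T} e^{−iβσ^x_w}` (identity elsewhere) — FGG's
`e^{−iβ₁(σ^x_j + σ^x_k)}`. [cite: FarhiGoldstoneGutmann2014, eq. (4) and §2 (e^{−iβ₁(σ^x_j +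
σ^x_k)})] -/
def mixOn (T : Finset V) (β : ℝ) : Matrix (V → Bool) (V → Bool) ℂ :=
  tensorAll fun w => if w ∈ T then mixerGate β else 1

/-- `⊗_{w∈T} e^{−iβσ^x_w} = e^{−iβ Σ_{w∈T} σ^x_w}`. [cite: FarhiGoldstoneGutmann2014, eq. (4)] -/
theorem mixOn_eq_exp (T : Finset V) (β : ℝ) :
    mixOn T β = NormedSpace.exp ((-(Complex.I * β)) • ∑ w ∈ T, sitePauli Pauli.X w) :=
  (exp_sum_sitePauli_X β T).symm

/-- **`U(B, β) = (∏_{w∉S} e^{−iβσ^x_w}) (∏_{w∈S} e^{−iβσ^x_w})`** (“the β dependent product of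
commuting one bit operators”). [cite: FarhiGoldstoneGutmann2014, eq. (4)] -/
theorem mixUnitary_eq_mixOn_mul (S : Finset V) (β : ℝ) :
    (mixUnitary β : Matrix (V → Bool) (V → Bool) ℂ) = mixOn Sᶜ β * mixOn S β := by
  rw [mixUnitary, mixOn, mixOn, tensorAll_mul]
  congr 1
  funext w
  by_cases hw : w ∈ S
  · rw [if_pos hw, if_neg (fun h => Finset.mem_compl.1 h hw), Matrix.one_mul]
  · rw [if_neg hw, if_pos (Finset.mem_compl.2 hw), Matrix.mul_one]

/-- Restricted mixers are unitary. [folklore] -/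
private theorem mixOn_conjTranspose_mul_self (T : Finset V) (β : ℝ) : (mixOn T β)ᴴ * mixOn T β = 1 := by
  rw [mixOn, conjTranspose_tensorAll, tensorAll_mul, ← tensorAll_one]
  congr 1
  funext w
  by_cases hw : w ∈ T
  · rw [if_pos hw]
    have h := mixerGate_conj_one β
    rwa [Matrix.mul_one] at h
  · rw [if_neg hw, conjTranspose_one, Matrix.mul_one]

/-- The restricted mixer involves only its vertex set. [cite: FarhiGoldstoneGutmann2014, eq. (4)] -/
theorem actsWithin_mixOn (T : Finset V) (β : ℝ) : ActsWithin T (mixOn T β) := by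
  rw [mixOn_eq_exp]
  exact ((ActsWithin.sum T fun w hw => actsWithin_sitePauli hw Pauli.X).smul _).exp

/-- **“The factors in the operator `U(B, β₁)` which do not involve qubits j or k commute through”**:
an operator involving only `S` commutes with the mixer factors on sites outside `S`. [cite:
FarhiGoldstoneGutmann2014, §2 (“The factors in the operator U(B, β₁) which do not involve qubits j
or k commute through C_⟨jk⟩ … Any factors in the operator U(C, γ₁) which do not involve qubits j or
k will commute through and cancel out”)] -/
theorem commute_mixOn_of_disjoint {S T : Finset V} {M : Matrix (V → Bool) (V → Bool) ℂ}
    (hM : ActsWithin S M) (hST : ∀ w ∈ T, w ∉ S) (β : ℝ) : Commute M (mixOn T β) := by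
  rw [mixOn_eq_exp]
  refine (Commute.smul_right ?_ _).exp_right
  exact Commute.sum_right _ _ _ fun w hw => (hM w (hST w hw) Pauli.X).symm

/-- **Conjugation by `U(B, β)` of an operator involving only `S` is conjugation by `⊗_{w∈S}
e^{−iβσ^x_w}`** (FGG's passage from (15) to (16): `U†(B,β₁) C_⟨jk⟩ U(B,β₁) = e^{iβ₁(σ^x_j+σ^x_k)}
C_⟨jk⟩ e^{−iβ₁(σ^x_j+σ^x_k)}`). [cite: FarhiGoldstoneGutmann2014, §2 (“The factors in the operator
U(B, β₁) which do not involve qubits j or k commute through C_⟨jk⟩ … Any factors in the operator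
U(C, γ₁) which do not involve qubits j or k will commute through and cancel out”)] -/
theorem mixUnitary_conj_eq {S : Finset V} {M : Matrix (V → Bool) (V → Bool) ℂ} (hM : ActsWithin S M)
    (β : ℝ) : (mixUnitary β)ᴴ * M * mixUnitary β = (mixOn S β)ᴴ * M * mixOn S β := by
  have hc : Commute M (mixOn Sᶜ β) :=
    commute_mixOn_of_disjoint hM (fun w hw => Finset.mem_compl.1 hw) β
  rw [mixUnitary_eq_mixOn_mul S β, conjTranspose_mul]
  calc (mixOn S β)ᴴ * (mixOn Sᶜ β)ᴴ * M * (mixOn Sᶜ β * mixOn S β)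
      = (mixOn S β)ᴴ * ((mixOn Sᶜ β)ᴴ * (M * mixOn Sᶜ β)) * mixOn S β := by
        simp only [Matrix.mul_assoc]
    _ = (mixOn S β)ᴴ * ((mixOn Sᶜ β)ᴴ * (mixOn Sᶜ β * M)) * mixOn S β := by rw [hc.eq]
    _ = (mixOn S β)ᴴ * M * mixOn S β := by
        rw [← Matrix.mul_assoc (mixOn Sᶜ β)ᴴ, mixOn_conjTranspose_mul_self, Matrix.one_mul]

/-- Conjugation by the mixer does not enlarge the set of qubits involved. [cite:
FarhiGoldstoneGutmann2014, §2 (“The factors in the operator U(B, β₁) which do not involve qubits j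
or k commute through C_⟨jk⟩ … Any factors in the operator U(C, γ₁) which do not involve qubits j or
k will commute through and cancel out”)] -/
theorem actsWithin_mixUnitary_conj {S : Finset V} {M : Matrix (V → Bool) (V → Bool) ℂ}
    (hM : ActsWithin S M) (β : ℝ) : ActsWithin S ((mixUnitary β)ᴴ * M * mixUnitary β) := by
  rw [mixUnitary_conj_eq hM]
  exact ((actsWithin_mixOn S β).conjTranspose.mul hM).mul (actsWithin_mixOn S β)

/-! ### The phase-separator factors not on the support cancel -/

/-- **“Any factors in the operator `U(C, γ₁)` which do not involve qubits j or k will commute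
through and cancel out”**: conjugation by `U(C, γ)` of an operator involving only `S ⊆ T` equals
conjugation by the phase separator of `G` restricted to the edges meeting `T`. [cite:
FarhiGoldstoneGutmann2014, §2 (“The factors in the operator U(B, β₁) which do not involve qubits j
or k commute through C_⟨jk⟩ … Any factors in the operator U(C, γ₁) which do not involve qubits j or
k will commute through and cancel out”)] -/
theorem costUnitary_conj_eq {S T : Finset V} {M : Matrix (V → Bool) (V → Bool) ℂ} (hM : ActsWithin S M)
    (hST : S ⊆ T) (γ : ℝ) :
    (costUnitary G γ)ᴴ * M * costUnitary G γ =
      (costUnitary (touching G T) γ)ᴴ * M * costUnitary (touching G T) γ := by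
  set N := edgesUnitary (G.edgeFinset.filter (Meets T)) γ with hN
  set F := edgesUnitary (G.edgeFinset.filter fun e => ¬Meets T e) γ with hF
  have hfar : ∀ e ∈ G.edgeFinset.filter (fun e => ¬Meets T e), ∀ a ∈ e, a ∉ S := by
    intro e he a ha haS
    exact (Finset.mem_filter.1 he).2 ⟨a, ha, hST haS⟩
  have hcM : Commute M F := commute_edgesUnitary_of_avoid hM hfar γ
  have hcN : Commute N F := by
    rw [hN, hF, Commute, SemiconjBy, edgesUnitary, edgesUnitary, diagonal_mul_diagonal,
      diagonal_mul_diagonal]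
    simp_rw [mul_comm]
  have hcN' : Commute Nᴴ F := by
    rw [hN, hF, Commute, SemiconjBy, edgesUnitary, edgesUnitary, diagonal_conjTranspose,
      diagonal_mul_diagonal, diagonal_mul_diagonal]
    simp_rw [mul_comm]
  have htouch : costUnitary (touching G T) γ = N := by
    rw [costUnitary_eq_edgesUnitary, edgeFinset_touching]
  rw [costUnitary_split G T γ, htouch, conjTranspose_mul]
  calc Fᴴ * Nᴴ * M * (N * F) = Fᴴ * (Nᴴ * M * N * F) := by simp only [Matrix.mul_assoc]
    _ = Fᴴ * (F * (Nᴴ * M * N)) := by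
        rw [((hcN'.mul_left hcM).mul_left hcN).eq]
    _ = Nᴴ * M * N := by
        rw [← Matrix.mul_assoc, hF, edgesUnitary_conjTranspose_mul_self, Matrix.one_mul]

/-- The closed neighbourhood `S ∪ N(S)` of a vertex set (qubits at distance `≤ 1` from `S`). [cite:
FarhiGoldstoneGutmann2014, §2 (“qubits whose distance on the graph from j or k is less than or equal
to p”)] -/
def nbhd (S : Finset V) : Finset V := S ∪ S.biUnion fun v => G.neighborFinset v

/-- `S ⊆ S ∪ N(S)`. [folklore] -/
private theorem subset_nbhd (S : Finset V) : S ⊆ nbhd G S := Finset.subset_union_left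

/-- Neighbours of `S` lie in its closed neighbourhood. [folklore] -/
private theorem mem_nbhd_of_adj {S : Finset V} {a b : V} (ha : a ∈ S) (hab : G.Adj a b) : b ∈ nbhd G S :=
  Finset.mem_union_right _ (Finset.mem_biUnion.2 ⟨a, ha, (G.mem_neighborFinset a b).2 hab⟩)

/-- The edges meeting `S` lie inside the closed neighbourhood of `S`. [folklore] -/
private theorem edgesWithin_filter_meets (S : Finset V) : EdgesWithin (G.edgeFinset.filter (Meets S)) (nbhd G S) := by
  intro e he a ha
  obtain ⟨he', hm⟩ := Finset.mem_filter.1 he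
  induction e using Sym2.ind with
  | h b c =>
    have hadj : G.Adj b c := SimpleGraph.mem_edgeFinset.1 he'
    rcases (meets_mk S b c).1 hm with hb | hc
    · rcases Sym2.mem_iff.1 ha with rfl | rfl
      · exact subset_nbhd G S hb
      · exact mem_nbhd_of_adj G hb hadj
    · rcases Sym2.mem_iff.1 ha with rfl | rfl
      · exact mem_nbhd_of_adj G hc hadj.symm
      · exact subset_nbhd G S hc

/-- **One phase-separator conjugation grows the set of involved qubits by one step**: `U(C,γ)† M
U(C,γ)` involves only `S ∪ N(S)` when `M` involves only `S` (“the operator … only involves the edge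
⟨jk⟩ and edges adjacent to ⟨jk⟩, and qubits on those edges”). [cite: FarhiGoldstoneGutmann2014, §2
(sentence after eq. (16))] -/
theorem actsWithin_costUnitary_conj {S : Finset V} {M : Matrix (V → Bool) (V → Bool) ℂ} (hM : ActsWithin S M)
    (γ : ℝ) : ActsWithin (nbhd G S) ((costUnitary G γ)ᴴ * M * costUnitary G γ) := by
  rw [costUnitary_conj_eq G hM (subset_refl S) γ, costUnitary_eq_edgesUnitary, edgeFinset_touching]
  have hN := actsWithin_edgesUnitary (edgesWithin_filter_meets G S) γ
  exact (hN.conjTranspose.mul (hM.mono (subset_nbhd G S))).mul hN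

/-! ### Level `p`: the circuit and the light cone -/

/-- **The level-`p` QAOA circuit `U = U(B, β_p) U(C, γ_p) ⋯ U(B, β₁) U(C, γ₁)`** (`Fin p`-indexed
angles; the last index is the outermost layer). [cite: FarhiGoldstoneGutmann2014, eq. (6) (|γ, β⟩ =
U(B, β_p) U(C, γ_p) ⋯ U(B, β₁) U(C, γ₁)|s⟩)] [cite: WangHadfieldJiangRieffel2018, §2 (U =
U_B(β_p)U_C(γ_p)⋯U_B(β₁)U_C(γ₁))] -/
def qaoaUnitaryP : (p : ℕ) → (Fin p → ℝ) → (Fin p → ℝ) → Matrix (V → Bool) (V → Bool) ℂ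
  | 0, _, _ => 1
  | p + 1, γ, β => mixUnitary (β (Fin.last p)) * costUnitary G (γ (Fin.last p)) *
      qaoaUnitaryP p (fun i => γ i.castSucc) (fun i => β i.castSucc)

/-- The level-1 circuit of the general definition is `U(B, β) U(C, γ)`. [cite:
FarhiGoldstoneGutmann2014, eq. (6) (p = 1)] -/
theorem qaoaUnitaryP_one (γ β : Fin 1 → ℝ) : qaoaUnitaryP G 1 γ β = qaoaUnitary G (γ 0) (β 0) := by
  rw [qaoaUnitaryP, qaoaUnitaryP, Matrix.mul_one, qaoaUnitary]
  rfl

/-- One level of Heisenberg evolution, `M ↦ U(C,γ)† U(B,β)† M U(B,β) U(C,γ)` (FGG's (15)). [cite: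
FarhiGoldstoneGutmann2014, §2 (display (15): U†(C, γ₁) U†(B, β₁) C_⟨jk⟩ U(B, β₁) U(C, γ₁))] -/
def layer (γ β : ℝ) (M : Matrix (V → Bool) (V → Bool) ℂ) : Matrix (V → Bool) (V → Bool) ℂ :=
  (costUnitary G γ)ᴴ * ((mixUnitary β)ᴴ * M * mixUnitary β) * costUnitary G γ

/-- Peeling the outermost level: `U_{p+1}† M U_{p+1} = U_p† (U(C,γ_{p+1})† U(B,β_{p+1})† M
U(B,β_{p+1}) U(C,γ_{p+1})) U_p`. [cite: FarhiGoldstoneGutmann2014, §2 (display (14): U†(C, γ₁) ⋯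
U†(B, β_p) C_⟨jk⟩ U(B, β_p) ⋯ U(C, γ₁))] -/
theorem conj_qaoaUnitaryP_succ (p : ℕ) (γ β : Fin (p + 1) → ℝ) (M : Matrix (V → Bool) (V → Bool) ℂ) :
    (qaoaUnitaryP G (p + 1) γ β)ᴴ * M * qaoaUnitaryP G (p + 1) γ β =
      (qaoaUnitaryP G p (fun i => γ i.castSucc) (fun i => β i.castSucc))ᴴ *
        layer G (γ (Fin.last p)) (β (Fin.last p)) M *
        qaoaUnitaryP G p (fun i => γ i.castSucc) (fun i => β i.castSucc) := by
  rw [qaoaUnitaryP, layer, conjTranspose_mul, conjTranspose_mul]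
  simp only [Matrix.mul_assoc]

/-- The `k`-step closed neighbourhood of a vertex set (qubits at graph distance `≤ k`). [cite:
FarhiGoldstoneGutmann2014, §2 (“those qubits whose distance on the graph from j or k is less than or
equal to p”)] -/
def ball (k : ℕ) (S : Finset V) : Finset V := (nbhd G)^[k] S

/-- `ball 0 S = S`. [folklore] -/
private theorem ball_zero (S : Finset V) : ball G 0 S = S := rfl

/-- `ball (k+1) S = ball k (S ∪ N(S))`. [folklore] -/
private theorem ball_succ (k : ℕ) (S : Finset V) : ball G (k + 1) S = ball G k (nbhd G S) := by
  rw [ball, ball, Function.iterate_succ_apply]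

/-- One level grows the set of involved qubits from `S` to `S ∪ N(S)`. [cite:
FarhiGoldstoneGutmann2014, §2 (sentence after eq. (16))] -/
theorem actsWithin_layer {S : Finset V} {M : Matrix (V → Bool) (V → Bool) ℂ} (hM : ActsWithin S M)
    (γ β : ℝ) : ActsWithin (nbhd G S) (layer G γ β M) := by
  rw [layer, ← Matrix.mul_assoc]
  have h := actsWithin_costUnitary_conj G (actsWithin_mixUnitary_conj hM β) γ
  rwa [← Matrix.mul_assoc] at h

/-- One level applied to an operator involving only `S ⊆ T` only sees the edges meeting `T`. [cite:
FarhiGoldstoneGutmann2014, §2 (“The factors in the operator U(B, β₁) which do not involve qubits j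
or k commute through C_⟨jk⟩ … Any factors in the operator U(C, γ₁) which do not involve qubits j or
k will commute through and cancel out”)] -/
theorem layer_eq_touching {S T : Finset V} {M : Matrix (V → Bool) (V → Bool) ℂ} (hM : ActsWithin S M)
    (hST : S ⊆ T) (γ β : ℝ) : layer G γ β M = layer (touching G T) γ β M := by
  rw [layer, layer, costUnitary_conj_eq G (actsWithin_mixUnitary_conj hM β) hST γ]

/-- **The light cone of the level-`p` QAOA circuit (Farhi–Goldstone–Gutmann §2).** If `O` involves
only the qubits in `S`, then `U† O U` for the level-`p` circuit involves only the qubits within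
distance `p` of `S`, and it is unchanged when `G` is replaced by its restriction to the edges
meeting any `T` that contains all qubits within distance `p − 1` of `S`: “This operator only
involves qubits j and k and those qubits whose distance on the graph from j or k is less than or
equal to p … For any p we see that the operator in (14) only involves edges at most p steps away
from ⟨jk⟩ and qubits on those edges.” [cite: FarhiGoldstoneGutmann2014, §2 (paragraph around eqs.
(14)–(16))] -/
theorem lightCone (p : ℕ) : ∀ (S T : Finset V) (O : Matrix (V → Bool) (V → Bool) ℂ),
    ActsWithin S O → (∀ k, k < p → ball G k S ⊆ T) → ∀ (γ β : Fin p → ℝ),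
    ActsWithin (ball G p S) ((qaoaUnitaryP G p γ β)ᴴ * O * qaoaUnitaryP G p γ β) ∧
    (qaoaUnitaryP G p γ β)ᴴ * O * qaoaUnitaryP G p γ β =
      (qaoaUnitaryP (touching G T) p γ β)ᴴ * O * qaoaUnitaryP (touching G T) p γ β := by
  induction p with
  | zero =>
    intro S T O hO _ γ β
    rw [qaoaUnitaryP, qaoaUnitaryP, conjTranspose_one, Matrix.one_mul, Matrix.mul_one]
    exact ⟨hO, rfl⟩
  | succ p ih =>
    intro S T O hO hT γ β
    have hS : S ⊆ T := by simpa [ball_zero] using hT 0 (Nat.zero_lt_succ p)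
    have hO' : ActsWithin (nbhd G S) (layer G (γ (Fin.last p)) (β (Fin.last p)) O) := actsWithin_layer G hO _ _
    have hT' : ∀ k, k < p → ball G k (nbhd G S) ⊆ T := fun k hk => by
      rw [← ball_succ]; exact hT (k + 1) (Nat.succ_lt_succ hk)
    obtain ⟨h1, h2⟩ := ih (nbhd G S) T _ hO' hT' (fun i => γ i.castSucc) (fun i => β i.castSucc)
    refine ⟨?_, ?_⟩
    · rw [conj_qaoaUnitaryP_succ, ball_succ]
      exact h1
    · rw [conj_qaoaUnitaryP_succ, conj_qaoaUnitaryP_succ, h2,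
        layer_eq_touching G hO hS (γ (Fin.last p)) (β (Fin.last p))]

/-! ### Level-`p` expectation values see only the light cone -/

/-- The level-`p` final state `U ρ₀ U† = |γ, β⟩⟨γ, β|`. [cite: FarhiGoldstoneGutmann2014, eqs.
(6)–(7)] [cite: WangHadfieldJiangRieffel2018, §2 (F = tr[H_C U ρ₀ U†])] -/
def finalStateP (p : ℕ) (γ β : Fin p → ℝ) : Matrix (V → Bool) (V → Bool) ℂ :=
  qaoaUnitaryP G p γ β * initialState * (qaoaUnitaryP G p γ β)ᴴ

/-- `⟨γ, β| C_{⟨jk⟩} |γ, β⟩ = tr[C_{⟨jk⟩} U ρ₀ U†]` at level `p` (the summand of FGG's (13)). [cite: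
FarhiGoldstoneGutmann2014, §2 (display (13))] -/
def edgeExpectP (p : ℕ) (γ β : Fin p → ℝ) (e : Sym2 V) : ℂ := (edgeTerm e * finalStateP G p γ β).trace

/-- **`F_p(γ, β) = ⟨γ, β| C |γ, β⟩ = tr[C U ρ₀ U†]`.** [cite: FarhiGoldstoneGutmann2014, eq. (7)]
[cite: WangHadfieldJiangRieffel2018, §2 (F(γ, β) = tr[H_C U ρ₀ U†])] -/
def levelP (p : ℕ) (γ β : Fin p → ℝ) : ℂ := (costOp G * finalStateP G p γ β).trace

/-- **`F_p(γ, β) = Σ_{⟨jk⟩} ⟨s| U† C_{⟨jk⟩} U |s⟩`** (FGG's (13)). [cite: FarhiGoldstoneGutmann2014,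
§2 (display (13))] -/
theorem levelP_eq_sum_edgeExpectP (p : ℕ) (γ β : Fin p → ℝ) :
    levelP G p γ β = ∑ e ∈ G.edgeFinset, edgeExpectP G p γ β e := by
  rw [levelP, costOp, Finset.sum_mul, trace_sum]
  rfl

/-- Level `1` of the general definition is the `F(γ, β)` of Theorem 1. [cite:
FarhiGoldstoneGutmann2014, eq. (7) (p = 1)] [cite: WangHadfieldJiangRieffel2018, §3 (F(γ,β) for
QAOA₁)] -/
theorem levelP_one (γ β : Fin 1 → ℝ) : levelP G 1 γ β = levelOne G (γ 0) (β 0) := by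
  rw [levelP, finalStateP, qaoaUnitaryP_one, levelOne, finalState]

/-- Heisenberg form `tr[O · U ρ₀ U†] = tr[(U† O U) ρ₀]`. [folklore] -/
private theorem trace_mul_finalStateP (p : ℕ) (γ β : Fin p → ℝ) (O : Matrix (V → Bool) (V → Bool) ℂ) :
    (O * finalStateP G p γ β).trace = ((qaoaUnitaryP G p γ β)ᴴ * O * qaoaUnitaryP G p γ β * initialState).trace := by
  rw [finalStateP, ← Matrix.mul_assoc, ← Matrix.mul_assoc, Matrix.trace_mul_comm, ← Matrix.mul_assoc,
    ← Matrix.mul_assoc]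

/-- **Each term of `F_p` depends only on the edges within `p` steps of its edge (FGG §2):**
`⟨s|U(G)† C_{⟨ab⟩} U(G)|s⟩ = ⟨s|U(G_T)† C_{⟨ab⟩} U(G_T)|s⟩` for the restriction `G_T` of `G` to the
edges meeting any `T` containing the qubits within distance `p − 1` of `{a, b}` — “each term in
equation (13) depends only on the subgraph involving qubits j and k and those at a distance no more
than p away”, whence `F_p` can be evaluated “in terms of quantum subsystems whose sizes are
independent of n” for bounded degree. [cite: FarhiGoldstoneGutmann2014, §2 (paragraph after eq.
(16))] -/
theorem edgeExpectP_eq_touching (p : ℕ) (γ β : Fin p → ℝ) {a b : V} {T : Finset V}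
    (hT : ∀ k, k < p → ball G k {a, b} ⊆ T) :
    edgeExpectP G p γ β s(a, b) = edgeExpectP (touching G T) p γ β s(a, b) := by
  have hO : ActsWithin ({a, b} : Finset V) (edgeTerm s(a, b)) :=
    actsWithin_edgeTerm (Finset.mem_insert_self a {b}) (Finset.mem_insert_of_mem (Finset.mem_singleton_self b))
  rw [edgeExpectP, edgeExpectP, trace_mul_finalStateP, trace_mul_finalStateP,
    (lightCone G p {a, b} T (edgeTerm s(a, b)) hO hT γ β).2]

/-- `ball (k+1) S = (ball k S) ∪ N(ball k S)`. [folklore] -/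
private theorem ball_succ' (k : ℕ) (S : Finset V) : ball G (k + 1) S = nbhd G (ball G k S) := by
  rw [ball, ball, Function.iterate_succ_apply']

/-- Balls grow with the radius. [folklore] -/
private theorem ball_mono {k p : ℕ} (hkp : k ≤ p) (S : Finset V) : ball G k S ⊆ ball G p S := by
  induction p, hkp using Nat.le_induction with
  | base => exact subset_refl _
  | succ p _ ih => rw [ball_succ']; exact ih.trans (subset_nbhd G _)

/-- The evolved edge term `U† C_{⟨ab⟩} U` involves only the qubits within distance `p` of `{a, b}`.
[cite: FarhiGoldstoneGutmann2014, §2 (“This operator only involves qubits j and k and those qubits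
whose distance on the graph from j or k is less than or equal to p”)] -/
theorem actsWithin_conj_edgeTerm (p : ℕ) (γ β : Fin p → ℝ) (a b : V) :
    ActsWithin (ball G p {a, b}) ((qaoaUnitaryP G p γ β)ᴴ * edgeTerm s(a, b) * qaoaUnitaryP G p γ β) :=
  (lightCone G p {a, b} (ball G p {a, b}) (edgeTerm s(a, b))
    (actsWithin_edgeTerm (Finset.mem_insert_self a {b}) (Finset.mem_insert_of_mem (Finset.mem_singleton_self b)))
    (fun _ hk => ball_mono G (le_of_lt hk) _) γ β).1

end LightCone

section Concentration

/-! ## Concentration (Farhi–Goldstone–Gutmann §3)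

FGG §3: “it is useful to get information about the spread of C measured in the state |γ, β⟩. If v
is fixed and p is fixed … the distribution of C(z) is actually concentrated near its mean.”  The
printed argument: expand `⟨C²⟩ − ⟨C⟩²` over pairs of edges (display (29)); “If the subgraphs g(j,k)
and g(j′,k′) do not involve any common qubits, the summand in (29) will be 0” (the state `|s⟩` is a
product and the two evolved edge terms live on disjoint qubit sets); the subgraphs share no qubit
unless `⟨j′k′⟩` is within `2p + 1` steps, so by the tree count (26) with `p ↦ 2p + 1` at most
`2[((v−1)^{2p+2} − 1)/((v−1) − 1)]` edges contribute for each `⟨jk⟩`; “each summand is at most 1 in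
norm”; hence (27). We write the geometric sum `2 Σ_{i=0}^{2p+1} (v−1)^i`, which is the printed
bracket for `v ≥ 3` and the printed `4p + 4` for `v = 2`. -/

/-! ### Graph balls: symmetry, concatenation, and the counts (26) -/

/-- Membership in `S ∪ N(S)`. [folklore] -/
private theorem mem_nbhd_iff {S : Finset V} {b : V} : b ∈ nbhd G S ↔ b ∈ S ∨ ∃ a ∈ S, G.Adj a b := by
  simp only [nbhd, Finset.mem_union, Finset.mem_biUnion, SimpleGraph.mem_neighborFinset]

/-- `N` is monotone. [folklore] -/
private theorem nbhd_mono {S T : Finset V} (h : S ⊆ T) : nbhd G S ⊆ nbhd G T := by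
  intro b hb
  rw [mem_nbhd_iff] at hb ⊢
  rcases hb with hb | ⟨a, ha, hab⟩
  · exact Or.inl (h hb)
  · exact Or.inr ⟨a, h ha, hab⟩

/-- Balls are monotone in the centre set. [folklore] -/
private theorem ball_mono_set {S T : Finset V} (h : S ⊆ T) (k : ℕ) : ball G k S ⊆ ball G k T := by
  induction k with
  | zero => exact h
  | succ k ih => rw [ball_succ', ball_succ']; exact nbhd_mono G ih

/-- `N(S ∪ T) = N(S) ∪ N(T)`. [folklore] -/
private theorem nbhd_union (S T : Finset V) : nbhd G (S ∪ T) = nbhd G S ∪ nbhd G T := by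
  ext b
  simp only [mem_nbhd_iff, Finset.mem_union, or_and_right, exists_or]
  exact or_or_or_comm

/-- Balls of a union. [folklore] -/
private theorem ball_union (k : ℕ) (S T : Finset V) : ball G k (S ∪ T) = ball G k S ∪ ball G k T := by
  induction k with
  | zero => rfl
  | succ k ih => rw [ball_succ', ball_succ', ball_succ', ih, nbhd_union]

/-- Concatenation of radii. [folklore] -/
private theorem ball_add (j k : ℕ) (S : Finset V) : ball G j (ball G k S) = ball G (j + k) S := by
  rw [ball, ball, ball, ← Function.iterate_add_apply]

/-- Last-step decomposition of a ball. [folklore] -/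
private theorem mem_ball_succ {k : ℕ} {S : Finset V} {w : V} :
    w ∈ ball G (k + 1) S ↔ w ∈ ball G k S ∨ ∃ u ∈ ball G k S, G.Adj u w := by
  rw [ball_succ', mem_nbhd_iff]

/-- Graph distance is symmetric: `w ∈ B_k(u) → u ∈ B_k(w)`. [folklore] -/
private theorem mem_ball_singleton_symm (k : ℕ) : ∀ {u w : V}, w ∈ ball G k {u} → u ∈ ball G k {w} := by
  induction k with
  | zero =>
    intro u w h
    rw [ball_zero, Finset.mem_singleton] at h ⊢
    exact h.symm
  | succ k ih =>
    intro u w h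
    rw [mem_ball_succ] at h
    rcases h with h | ⟨x, hx, hxw⟩
    · exact ball_mono G (Nat.le_succ k) _ (ih h)
    · have hsub : ball G k {x} ⊆ ball G (k + 1) {w} := by
        rw [ball_succ]
        exact ball_mono_set G (Finset.singleton_subset_iff.2
          (mem_nbhd_of_adj G (Finset.mem_singleton_self w) hxw.symm)) k
      exact hsub (ih hx)

/-- `N(∅) = ∅`. [folklore] -/
private theorem nbhd_empty : nbhd G (∅ : Finset V) = ∅ := by
  simp [nbhd]

/-- `B_k(∅) = ∅`. [folklore] -/
private theorem ball_empty (k : ℕ) : ball G k (∅ : Finset V) = ∅ := by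
  induction k with
  | zero => rfl
  | succ k ih => rw [ball_succ', ih, nbhd_empty]

/-- A ball is the union of the balls of its centres. [folklore] -/
private theorem ball_eq_biUnion (k : ℕ) (S : Finset V) : ball G k S = S.biUnion fun u => ball G k {u} := by
  induction S using Finset.induction_on with
  | empty => rw [Finset.biUnion_empty, ball_empty]
  | insert a S _ ih => rw [Finset.biUnion_insert, Finset.insert_eq, ball_union, ih]

/-- Membership in a ball, centre by centre. [folklore] -/
private theorem mem_ball_iff {k : ℕ} {S : Finset V} {w : V} : w ∈ ball G k S ↔ ∃ u ∈ S, w ∈ ball G k {u} := by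
  rw [ball_eq_biUnion, Finset.mem_biUnion]

/-- If the radius-`p` balls of `S` and `S'` share a qubit then `S'` meets the radius-`2p` ball of
`S` — “The subgraphs g(j,k) and g(j′,k′) will have no common qubits as long as there is no path in
the instance graph from ⟨jk⟩ to ⟨j′k′⟩ of length 2p + 1 or shorter.” [cite: FarhiGoldstoneGutmann2014,
§3 (sentence after display (29))] -/
theorem exists_mem_ball_of_not_disjoint {p : ℕ} {S S' : Finset V}
    (h : ¬ Disjoint (ball G p S) (ball G p S')) : ∃ u' ∈ S', u' ∈ ball G (p + p) S := by
  rw [Finset.not_disjoint_iff] at h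
  obtain ⟨w, hw, hw'⟩ := h
  obtain ⟨u', hu', hwu'⟩ := (mem_ball_iff G).1 hw'
  refine ⟨u', hu', ?_⟩
  rw [← ball_add]
  exact ball_mono_set G (Finset.singleton_subset_iff.2 hw) p (mem_ball_singleton_symm G p hwu')

variable {v : ℕ}

/-- A vertex with a neighbour in `B` has at most `v − 1` neighbours outside `B` (maximum degree
`v`). [folklore] -/
private theorem card_neighborFinset_sdiff_le (hdeg : ∀ w, G.degree w ≤ v) {x y : V} {B : Finset V}
    (hy : y ∈ B) (hxy : G.Adj x y) : #(G.neighborFinset x \ B) ≤ v - 1 := by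
  have h1 : 1 ≤ #(G.neighborFinset x ∩ B) :=
    Finset.card_pos.2 ⟨y, Finset.mem_inter.2 ⟨(G.mem_neighborFinset x y).2 hxy, hy⟩⟩
  have h2 := Finset.card_sdiff_add_card_inter (G.neighborFinset x) B
  rw [G.card_neighborFinset_eq_degree] at h2
  have h3 := hdeg x
  omega

/-- A vertex at distance exactly `k + 1` has a neighbour at distance `≤ k`. [folklore] -/
private theorem exists_adj_of_mem_sdiff {k : ℕ} {S : Finset V} {x : V} (hx : x ∈ ball G (k + 1) S \ ball G k S) :
    ∃ y ∈ ball G k S, G.Adj x y := by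
  rw [Finset.mem_sdiff, mem_ball_succ] at hx
  obtain ⟨h | ⟨y, hy, hyx⟩, hx'⟩ := hx
  · exact absurd h hx'
  · exact ⟨y, hy, hyx.symm⟩

/-- The shell at distance `k + 2` consists of new neighbours of the shell at distance `k + 1`.
[folklore] -/
private theorem sdiff_succ_subset (k : ℕ) (S : Finset V) :
    ball G (k + 2) S \ ball G (k + 1) S ⊆
      (ball G (k + 1) S \ ball G k S).biUnion fun x => G.neighborFinset x \ ball G (k + 1) S := by
  intro w hw
  rw [Finset.mem_sdiff, mem_ball_succ] at hw
  obtain ⟨h | ⟨x, hx, hxw⟩, hw'⟩ := hw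
  · exact absurd h hw'
  · refine Finset.mem_biUnion.2 ⟨x, Finset.mem_sdiff.2 ⟨hx, fun hxk => hw' ?_⟩,
      Finset.mem_sdiff.2 ⟨(G.mem_neighborFinset x w).2 hxw, hw'⟩⟩
    rw [ball_succ']
    exact mem_nbhd_of_adj G hxk hxw

/-- Shell growth: each vertex of a shell spawns at most `v − 1` vertices of the next shell (“the
subgraph is a tree” is the worst case). [cite: FarhiGoldstoneGutmann2014, §2 (derivation of eq.
(26))] -/
private theorem card_sdiff_succ_le (hdeg : ∀ w, G.degree w ≤ v) (k : ℕ) (S : Finset V) :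
    #(ball G (k + 2) S \ ball G (k + 1) S) ≤ (v - 1) * #(ball G (k + 1) S \ ball G k S) := by
  refine (Finset.card_le_card (sdiff_succ_subset G k S)).trans (Finset.card_biUnion_le.trans ?_)
  rw [mul_comm, ← smul_eq_mul, ← Finset.sum_const]
  refine Finset.sum_le_sum fun x hx => ?_
  obtain ⟨y, hy, hxy⟩ := exists_adj_of_mem_sdiff G hx
  exact card_neighborFinset_sdiff_le G hdeg (ball_mono G (Nat.le_succ k) S hy) hxy

omit [DecidableEq V] in
/-- An edge forces `v ≥ 1`. [folklore] -/
private theorem one_le_of_adj (hdeg : ∀ w, G.degree w ≤ v) {a b : V} (hab : G.Adj a b) : 1 ≤ v := by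
  have h : 0 < G.degree a := by
    rw [← G.card_neighborFinset_eq_degree]
    exact Finset.card_pos.2 ⟨b, (G.mem_neighborFinset a b).2 hab⟩
  exact (Nat.succ_le_of_lt h).trans (hdeg a)

/-- The first shell around an edge has at most `2(v − 1)` vertices. [cite: FarhiGoldstoneGutmann2014,
§2 (derivation of eq. (26))] -/
private theorem card_sdiff_one_le (hdeg : ∀ w, G.degree w ≤ v) {a b : V} (hab : G.Adj a b) :
    #(ball G 1 {a, b} \ ball G 0 {a, b}) ≤ 2 * (v - 1) := by
  have hsub : ball G 1 {a, b} \ ball G 0 {a, b} ⊆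
      (G.neighborFinset a \ {b}) ∪ (G.neighborFinset b \ {a}) := by
    intro w hw
    rw [ball_succ', ball_zero, Finset.mem_sdiff, mem_nbhd_iff] at hw
    obtain ⟨h | ⟨x, hx, hxw⟩, hw'⟩ := hw
    · exact absurd h hw'
    · rw [Finset.mem_insert, Finset.mem_singleton] at hx hw'
      push Not at hw'
      rw [Finset.mem_union, Finset.mem_sdiff, Finset.mem_sdiff, SimpleGraph.mem_neighborFinset,
        SimpleGraph.mem_neighborFinset, Finset.mem_singleton, Finset.mem_singleton]
      rcases hx with rfl | rfl
      · exact Or.inl ⟨hxw, hw'.2⟩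
      · exact Or.inr ⟨hxw, hw'.1⟩
  refine (Finset.card_le_card hsub).trans ((Finset.card_union_le _ _).trans ?_)
  have ha := card_neighborFinset_sdiff_le G hdeg (Finset.mem_singleton_self b) hab
  have hb := card_neighborFinset_sdiff_le G hdeg (Finset.mem_singleton_self a) hab.symm
  omega

/-- The shell at distance `k + 1` around an edge has at most `2(v − 1)^{k+1}` vertices (tree
count). [cite: FarhiGoldstoneGutmann2014, §2 (derivation of eq. (26))] -/
private theorem card_sdiff_le (hdeg : ∀ w, G.degree w ≤ v) {a b : V} (hab : G.Adj a b) (k : ℕ) :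
    #(ball G (k + 1) {a, b} \ ball G k {a, b}) ≤ 2 * (v - 1) ^ (k + 1) := by
  induction k with
  | zero => rw [zero_add, pow_one]; exact card_sdiff_one_le G hdeg hab
  | succ k ih =>
    refine (card_sdiff_succ_le G hdeg k _).trans ?_
    calc (v - 1) * #(ball G (k + 1) {a, b} \ ball G k {a, b}) ≤ (v - 1) * (2 * (v - 1) ^ (k + 1)) :=
          Nat.mul_le_mul_left _ ih
      _ = 2 * (v - 1) ^ (k + 1 + 1) := by ring

/-- **FGG eq. (26), `q_tree = 2[((v−1)^{p+1} − 1)/((v−1) − 1)]`:** for maximum degree `v` the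
number of qubits within distance `p` of an edge is at most `2 Σ_{i=0}^{p} (v−1)^i` (“The maximum
number of qubits … comes when the subgraph is a tree”; the sum is the printed bracket, and `2p + 2`
for `v = 2`). [cite: FarhiGoldstoneGutmann2014, eq. (26)] -/
theorem card_ball_le (hdeg : ∀ w, G.degree w ≤ v) {a b : V} (hab : G.Adj a b) (p : ℕ) :
    #(ball G p {a, b}) ≤ 2 * ∑ i ∈ Finset.range (p + 1), (v - 1) ^ i := by
  induction p with
  | zero =>
    rw [ball_zero, zero_add, Finset.sum_range_one, pow_zero, mul_one]
    exact Finset.card_insert_le a {b} |>.trans (by rw [Finset.card_singleton])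
  | succ p ih =>
    have hsplit : ball G (p + 1) {a, b} = ball G p {a, b} ∪ (ball G (p + 1) {a, b} \ ball G p {a, b}) := by
      rw [Finset.union_sdiff_of_subset (ball_mono G (Nat.le_succ p) _)]
    rw [hsplit, Finset.sum_range_succ, mul_add]
    exact (Finset.card_union_le _ _).trans (Nat.add_le_add ih (card_sdiff_le G hdeg hab p))

/-- Edges meeting the next ball: old ones, or new neighbours of the new shell. [folklore] -/
private theorem filter_meets_succ_subset (r : ℕ) (S : Finset V) :
    G.edgeFinset.filter (Meets (ball G (r + 1) S)) ⊆
      G.edgeFinset.filter (Meets (ball G r S)) ∪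
        (ball G (r + 1) S \ ball G r S).biUnion fun x =>
          (G.neighborFinset x \ ball G r S).image fun y => s(x, y) := by
  intro e he
  rw [Finset.mem_filter] at he
  obtain ⟨he, hm⟩ := he
  rw [Finset.mem_union, Finset.mem_filter, Finset.mem_biUnion]
  induction e using Sym2.ind with
  | h x y =>
    rw [SimpleGraph.mem_edgeFinset, SimpleGraph.mem_edgeSet] at he
    rw [meets_mk] at hm
    by_cases hx : x ∈ ball G r S
    · exact Or.inl ⟨G.mem_edgeFinset.2 he, (meets_mk _ _ _).2 (Or.inl hx)⟩
    by_cases hy : y ∈ ball G r S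
    · exact Or.inl ⟨G.mem_edgeFinset.2 he, (meets_mk _ _ _).2 (Or.inr hy)⟩
    right
    rcases hm with hm | hm
    · exact ⟨x, Finset.mem_sdiff.2 ⟨hm, hx⟩, Finset.mem_image.2
        ⟨y, Finset.mem_sdiff.2 ⟨(G.mem_neighborFinset x y).2 he, hy⟩, rfl⟩⟩
    · exact ⟨y, Finset.mem_sdiff.2 ⟨hm, hy⟩, Finset.mem_image.2
        ⟨x, Finset.mem_sdiff.2 ⟨(G.mem_neighborFinset y x).2 he.symm, hx⟩, Sym2.eq_swap⟩⟩

/-- Edge-count recursion along the shells. [cite: FarhiGoldstoneGutmann2014, §3 (eq. (26) “with p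
replaced by 2p + 1”)] -/
private theorem card_filter_meets_succ_le (hdeg : ∀ w, G.degree w ≤ v) (r : ℕ) (S : Finset V) :
    #(G.edgeFinset.filter (Meets (ball G (r + 1) S))) ≤
      #(G.edgeFinset.filter (Meets (ball G r S))) + (v - 1) * #(ball G (r + 1) S \ ball G r S) := by
  refine (Finset.card_le_card (filter_meets_succ_subset G r S)).trans
    ((Finset.card_union_le _ _).trans (Nat.add_le_add_left (Finset.card_biUnion_le.trans ?_) _))
  rw [mul_comm, ← smul_eq_mul, ← Finset.sum_const]
  refine Finset.sum_le_sum fun x hx => Finset.card_image_le.trans ?_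
  obtain ⟨y, hy, hxy⟩ := exists_adj_of_mem_sdiff G hx
  exact card_neighborFinset_sdiff_le G hdeg hy hxy

/-- At most `2v` edges meet a pair of vertices. [folklore] -/
private theorem card_filter_meets_pair_le (hdeg : ∀ w, G.degree w ≤ v) (a b : V) :
    #(G.edgeFinset.filter (Meets ({a, b} : Finset V))) ≤ 2 * v := by
  have hsub : G.edgeFinset.filter (Meets ({a, b} : Finset V)) ⊆
      (G.neighborFinset a).image (fun y => s(a, y)) ∪ (G.neighborFinset b).image (fun y => s(b, y)) := by
    intro e he
    rw [Finset.mem_filter] at he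
    obtain ⟨he, hm⟩ := he
    rw [Finset.mem_union, Finset.mem_image, Finset.mem_image]
    induction e using Sym2.ind with
    | h x y =>
      rw [SimpleGraph.mem_edgeFinset, SimpleGraph.mem_edgeSet] at he
      rw [meets_mk, Finset.mem_insert, Finset.mem_singleton, Finset.mem_insert, Finset.mem_singleton] at hm
      rcases hm with (rfl | rfl) | (rfl | rfl)
      · exact Or.inl ⟨y, (G.mem_neighborFinset x y).2 he, rfl⟩
      · exact Or.inr ⟨y, (G.mem_neighborFinset x y).2 he, rfl⟩
      · exact Or.inl ⟨x, (G.mem_neighborFinset y x).2 he.symm, Sym2.eq_swap⟩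
      · exact Or.inr ⟨x, (G.mem_neighborFinset y x).2 he.symm, Sym2.eq_swap⟩
  refine (Finset.card_le_card hsub).trans ((Finset.card_union_le _ _).trans ?_)
  have ha := (Finset.card_image_le (s := G.neighborFinset a) (f := fun y => s(a, y))).trans
    ((G.card_neighborFinset_eq_degree a).le.trans (hdeg a))
  have hb := (Finset.card_image_le (s := G.neighborFinset b) (f := fun y => s(b, y))).trans
    ((G.card_neighborFinset_eq_degree b).le.trans (hdeg b))
  omega

/-- **The number of edges meeting the radius-`r` ball of an edge is at most `2 Σ_{i=0}^{r+1}
(v−1)^i`** (the tree count (26) “with p replaced by” `r + 1`). [cite: FarhiGoldstoneGutmann2014, §3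
(“From (26) with p replaced by 2p+1 we see that for each ⟨jk⟩ there are at most 2[((v−1)^{2p+2} −
1)/((v−1) − 1)] edges ⟨j′k′⟩ which could contribute”)] -/
theorem card_filter_meets_ball_le (hdeg : ∀ w, G.degree w ≤ v) {a b : V} (hab : G.Adj a b) (r : ℕ) :
    #(G.edgeFinset.filter (Meets (ball G r {a, b}))) ≤ 2 * ∑ i ∈ Finset.range (r + 2), (v - 1) ^ i := by
  induction r with
  | zero =>
    have hv : 1 ≤ v := one_le_of_adj G hdeg hab
    rw [ball_zero, zero_add, Finset.sum_range_succ, Finset.sum_range_one, pow_zero, pow_one]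
    refine (card_filter_meets_pair_le G hdeg a b).trans ?_
    omega
  | succ r ih =>
    refine (card_filter_meets_succ_le G hdeg r _).trans ?_
    rw [Finset.sum_range_succ, mul_add]
    refine Nat.add_le_add ih ?_
    calc (v - 1) * #(ball G (r + 1) {a, b} \ ball G r {a, b}) ≤ (v - 1) * (2 * (v - 1) ^ (r + 1)) :=
          Nat.mul_le_mul_left _ (card_sdiff_le G hdeg hab r)
      _ = 2 * (v - 1) ^ (r + 1 + 1) := by ring

/-- The two endpoints of an edge `⟨jk⟩`, as a vertex set (the centre of its subgraph `g(j,k)`).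
[cite: FarhiGoldstoneGutmann2014, §2 (“the subgraph involving qubits j and k and those at a distance
no more than p away”)] -/
def verts (e : Sym2 V) : Finset V := Finset.univ.filter (· ∈ e)

/-- `verts ⟨ab⟩ = {a, b}`. [folklore] -/
private theorem verts_mk (a b : V) : verts s(a, b) = {a, b} := by
  ext w
  simp [verts, Sym2.mem_iff]

/-- **For each edge `⟨jk⟩` at most `2 Σ_{i=0}^{2p+1} (v−1)^i = 2[((v−1)^{2p+2} − 1)/((v−1) − 1)]`
edges `⟨j′k′⟩` have a `p`-subgraph sharing a qubit with that of `⟨jk⟩`** (“or 4p + 4 if v = 2”).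
[cite: FarhiGoldstoneGutmann2014, §3 (the count before eq. (27))] -/
theorem card_filter_not_disjoint_le (hdeg : ∀ w, G.degree w ≤ v) {a b : V} (hab : G.Adj a b) (p : ℕ) :
    #(G.edgeFinset.filter fun e' => ¬ Disjoint (ball G p {a, b}) (ball G p (verts e'))) ≤
      2 * ∑ i ∈ Finset.range (2 * p + 2), (v - 1) ^ i := by
  have hsub : (G.edgeFinset.filter fun e' => ¬ Disjoint (ball G p {a, b}) (ball G p (verts e'))) ⊆
      G.edgeFinset.filter (Meets (ball G (p + p) {a, b})) := by
    intro e' he'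
    rw [Finset.mem_filter] at he' ⊢
    refine ⟨he'.1, ?_⟩
    obtain ⟨u', hu', hball⟩ := exists_mem_ball_of_not_disjoint G he'.2
    rw [verts, Finset.mem_filter] at hu'
    exact ⟨u', hu'.2, hball⟩
  refine (Finset.card_le_card hsub).trans ?_
  rw [two_mul p]
  exact card_filter_meets_ball_le G hdeg hab (p + p)

/-! ### Product state and disjoint supports: the summand vanishes -/

omit [Fintype V] [DecidableEq V] in
/-- Every non-identity Pauli letter anticommutes with some letter. [folklore] -/
private theorem exists_sign_eq_neg_one {P : Pauli} (hP : P ≠ Pauli.I) : ∃ Q : Pauli, Pauli.sign Q P = -1 := by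
  cases P with
  | I => exact absurd rfl hP
  | X => exact ⟨Pauli.Z, by simp [Pauli.sign]⟩
  | Y => exact ⟨Pauli.Z, by simp [Pauli.sign]⟩
  | Z => exact ⟨Pauli.X, by simp [Pauli.sign]⟩

/-- **An operator involving only the qubits in `S` has Pauli coefficients supported in `S`**
(`Tr(T M) = 0` for every string `T` with a non-identity letter outside `S`: conjugating by an
anticommuting letter there flips the sign of the coefficient and fixes `M`). [cite:
FarhiGoldstoneGutmann2014, §2 (“This operator only involves qubits j and k and those qubits whose
distance on the graph from j or k is less than or equal to p”)] -/
theorem ActsWithin.pauliCoeff_eq_zero {S : Finset V} {M : Matrix (V → Bool) (V → Bool) ℂ}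
    (hM : ActsWithin S M) {T : V → Pauli} (hT : T ∉ stringsOn S) : pauliCoeff M T = 0 := by
  rw [mem_stringsOn] at hT
  push Not at hT
  obtain ⟨w, hwS, hTw⟩ := hT
  obtain ⟨Q, hQ⟩ := exists_sign_eq_neg_one hTw
  have hc : sitePauli Q w * M * sitePauli Q w = M := by
    rw [(hM w hwS Q).eq, Matrix.mul_assoc, sitePauli, pauliString_mul_self, Matrix.mul_one]
  have h := pauliCoeff_single_conj w Q M T
  change pauliCoeff (sitePauli Q w * M * sitePauli Q w) T = _ at h
  rw [hc, hQ, neg_one_mul, eq_neg_iff_add_eq_zero, ← two_mul, mul_eq_zero] at h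
  exact h.resolve_left two_ne_zero

/-- **Pauli expansion of an operator involving only `S`: `M = 2^{−n} Σ_{supp T ⊆ S} Tr(T M) T`.**
[cite: FarhiGoldstoneGutmann2014, §2 (“This operator only involves qubits j and k and those qubits
whose distance on the graph from j or k is less than or equal to p”)] -/
theorem ActsWithin.eq_sum {S : Finset V} {M : Matrix (V → Bool) (V → Bool) ℂ} (hM : ActsWithin S M) :
    M = ((2 : ℂ) ^ Fintype.card V)⁻¹ • ∑ T ∈ stringsOn S, pauliCoeff M T • pauliString T := by
  conv_lhs => rw [PauliPath.eq_inv_smul_sum_pauliCoeff_smul M]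
  congr 1
  symm
  refine Finset.sum_subset (Finset.subset_univ _) fun T _ hT => ?_
  rw [hM.pauliCoeff_eq_zero hT, zero_smul]

/-- `tr[M X]` through the supported expansion of `M`. [folklore] -/
private theorem ActsWithin.trace_mul {S : Finset V} {A : Matrix (V → Bool) (V → Bool) ℂ} (hA : ActsWithin S A)
    (X : Matrix (V → Bool) (V → Bool) ℂ) :
    (A * X).trace = ((2 : ℂ) ^ Fintype.card V)⁻¹ *
      ∑ T ∈ stringsOn S, pauliCoeff A T * (pauliString T * X).trace := by
  conv_lhs => rw [hA.eq_sum]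
  rw [smul_mul_assoc, Finset.sum_mul, trace_smul, trace_sum, smul_eq_mul]
  congr 1
  refine Finset.sum_congr rfl fun T _ => ?_
  rw [smul_mul_assoc, trace_smul, smul_eq_mul]

omit [Fintype V] [DecidableEq V] in
/-- `σ_I = 1`. [folklore] -/
private theorem mat_I_eq_one : Pauli.I.mat = 1 := rfl

omit [Fintype V] [DecidableEq V] in
/-- `tr ½(1 + σ^x) = 1` (one `|+⟩⟨+|` factor of `ρ₀`). [folklore] -/
private theorem trace_plusFactor : ((1 / 2 : ℂ) • ((1 : Matrix Bool Bool ℂ) + Pauli.X.mat)).trace = 1 := by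
  simp [Matrix.trace]

/-- **`ρ₀ = |s⟩⟨s|` is a product state: `tr[T T′ ρ₀] = tr[T ρ₀] tr[T′ ρ₀]` for Pauli strings `T`,
`T′` supported on disjoint qubit sets** (“the state |s⟩ is the product of σ^x eigenstates |s⟩ =
|+⟩₁|+⟩₂…|+⟩_n”). [cite: FarhiGoldstoneGutmann2014, §2 (display after eq. (16))] -/
theorem trace_pauliString_mul_pauliString_mul_initialState {S S' : Finset V} (hSS' : Disjoint S S')
    {T T' : V → Pauli} (hT : T ∈ stringsOn S) (hT' : T' ∈ stringsOn S') :
    (pauliString T * pauliString T' * initialState).trace =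
      (pauliString T * initialState).trace * (pauliString T' * (initialState : Matrix (V → Bool) (V → Bool) ℂ)).trace := by
  rw [initialState, pauliString_eq, pauliString_eq, tensorAll_mul, tensorAll_mul, tensorAll_mul,
    tensorAll_mul, trace_tensorAll, trace_tensorAll, trace_tensorAll, ← Finset.prod_mul_distrib]
  refine Finset.prod_congr rfl fun i _ => ?_
  rw [mem_stringsOn] at hT hT'
  by_cases hi : i ∈ S
  · rw [hT' i (Finset.disjoint_left.1 hSS' hi), mat_I_eq_one, Matrix.mul_one, Matrix.one_mul,
      trace_plusFactor, mul_one]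
  · rw [hT i hi, mat_I_eq_one, Matrix.one_mul, Matrix.one_mul, trace_plusFactor, one_mul]

/-- **Operators on disjoint qubit sets are uncorrelated in the product state `|s⟩`:
`tr[A B ρ₀] = tr[A ρ₀] · tr[B ρ₀]`** whenever `A` involves only `S`, `B` only `S′`, `S ∩ S′ = ∅` —
the reason “the summand in (29) will be 0” when “the subgraphs g(j,k) and g(j′,k′) do not involve any
common qubits”. [cite: FarhiGoldstoneGutmann2014, §3 (sentence after display (29)) and §2 (|s⟩ =
|+⟩₁…|+⟩_n)] -/
theorem trace_mul_mul_initialState {S S' : Finset V} (hSS' : Disjoint S S')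
    {A B : Matrix (V → Bool) (V → Bool) ℂ} (hA : ActsWithin S A) (hB : ActsWithin S' B) :
    (A * B * initialState).trace = (A * initialState).trace * (B * initialState).trace := by
  have tB := hB.trace_mul initialState
  have key : ∀ T ∈ stringsOn S, (pauliString T * (B * initialState)).trace =
      (pauliString T * initialState).trace * (B * initialState).trace := by
    intro T hT
    rw [Matrix.trace_mul_comm, Matrix.mul_assoc, hB.trace_mul, tB, Finset.mul_sum, Finset.mul_sum,
      Finset.mul_sum]
    refine Finset.sum_congr rfl fun T' hT' => ?_
    rw [← Matrix.mul_assoc (pauliString T'), Matrix.trace_mul_comm (pauliString T' * initialState),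
      ← Matrix.mul_assoc, trace_pauliString_mul_pauliString_mul_initialState hSS' hT hT']
    ring
  rw [Matrix.mul_assoc, hA.trace_mul, hA.trace_mul initialState, mul_assoc, Finset.sum_mul]
  congr 1
  refine Finset.sum_congr rfl fun T hT => ?_
  rw [key T hT]
  ring

/-! ### The level-`p` circuit is unitary; the variance as a sum over pairs of edges -/

/-- `U(C, γ)† U(C, γ) = 1`. [cite: FarhiGoldstoneGutmann2014, eq. (2) (U(C,γ) unitary)] -/
private theorem costUnitary_conjTranspose_mul_self (γ : ℝ) : (costUnitary G γ)ᴴ * costUnitary G γ = 1 := by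
  rw [costUnitary_eq_edgesUnitary]
  exact edgesUnitary_conjTranspose_mul_self G.edgeFinset γ

/-- **The level-`p` circuit is unitary: `U† U = 1`.** [cite: FarhiGoldstoneGutmann2014, eqs. (2),
(4), (6)] -/
theorem qaoaUnitaryP_conjTranspose_mul_self (p : ℕ) (γ β : Fin p → ℝ) :
    (qaoaUnitaryP G p γ β)ᴴ * qaoaUnitaryP G p γ β = 1 := by
  induction p with
  | zero => rw [qaoaUnitaryP, conjTranspose_one, Matrix.mul_one]
  | succ p ih =>
    rw [qaoaUnitaryP, conjTranspose_mul, conjTranspose_mul]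
    simp only [Matrix.mul_assoc]
    rw [← Matrix.mul_assoc (mixUnitary _)ᴴ, mixUnitary_conjTranspose_mul_mixUnitary, Matrix.one_mul,
      ← Matrix.mul_assoc (costUnitary G _)ᴴ, costUnitary_conjTranspose_mul_self, Matrix.one_mul, ih]

/-- `U U† = 1`. [cite: FarhiGoldstoneGutmann2014, eqs. (2), (4), (6)] -/
theorem qaoaUnitaryP_mul_conjTranspose (p : ℕ) (γ β : Fin p → ℝ) :
    qaoaUnitaryP G p γ β * (qaoaUnitaryP G p γ β)ᴴ = 1 :=
  mul_eq_one_comm.1 (qaoaUnitaryP_conjTranspose_mul_self G p γ β)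

/-- **The summand of (29) vanishes for edges whose `p`-subgraphs share no qubit:**
`⟨C_{⟨ab⟩} C_{⟨a′b′⟩}⟩ = ⟨C_{⟨ab⟩}⟩ ⟨C_{⟨a′b′⟩}⟩` when the radius-`p` balls of `{a, b}` and `{a′, b′}`
are disjoint (“If the subgraphs g(j,k) and g(j′,k′) do not involve any common qubits, the summand in
(29) will be 0”). [cite: FarhiGoldstoneGutmann2014, §3 (display (29) and the sentence after it)] -/
theorem trace_edgeTerm_mul_edgeTerm_mul_finalStateP {p : ℕ} (γ β : Fin p → ℝ) {a b a' b' : V}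
    (h : Disjoint (ball G p {a, b}) (ball G p {a', b'})) :
    (edgeTerm s(a, b) * edgeTerm s(a', b') * finalStateP G p γ β).trace =
      edgeExpectP G p γ β s(a, b) * edgeExpectP G p γ β s(a', b') := by
  rw [edgeExpectP, edgeExpectP, trace_mul_finalStateP, trace_mul_finalStateP, trace_mul_finalStateP]
  have hU := qaoaUnitaryP_mul_conjTranspose G p γ β
  have key : (qaoaUnitaryP G p γ β)ᴴ * edgeTerm s(a, b) * qaoaUnitaryP G p γ β *
      ((qaoaUnitaryP G p γ β)ᴴ * edgeTerm s(a', b') * qaoaUnitaryP G p γ β) =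
      (qaoaUnitaryP G p γ β)ᴴ * (edgeTerm s(a, b) * edgeTerm s(a', b')) * qaoaUnitaryP G p γ β := by
    simp only [Matrix.mul_assoc]
    rw [← Matrix.mul_assoc (qaoaUnitaryP G p γ β) (qaoaUnitaryP G p γ β)ᴴ, hU, Matrix.one_mul]
  rw [← key]
  exact trace_mul_mul_initialState h (actsWithin_conj_edgeTerm G p γ β a b)
    (actsWithin_conj_edgeTerm G p γ β a' b')

/-- **`⟨γ, β| C² |γ, β⟩`** at level `p`. [cite: FarhiGoldstoneGutmann2014, §3 (display (27)–(29))] -/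
def levelPSq (p : ℕ) (γ β : Fin p → ℝ) : ℂ := (costOp G * costOp G * finalStateP G p γ β).trace

/-- **FGG display (29):** `⟨C²⟩ − ⟨C⟩² = Σ_{⟨jk⟩, ⟨j′k′⟩} [⟨C_{jk} C_{j′k′}⟩ − ⟨C_{jk}⟩⟨C_{j′k′}⟩]`.
[cite: FarhiGoldstoneGutmann2014, §3 (display (29))] -/
theorem levelPSq_sub_sq (p : ℕ) (γ β : Fin p → ℝ) :
    levelPSq G p γ β - levelP G p γ β ^ 2 =
      ∑ e ∈ G.edgeFinset, ∑ e' ∈ G.edgeFinset,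
        ((edgeTerm e * edgeTerm e' * finalStateP G p γ β).trace -
          edgeExpectP G p γ β e * edgeExpectP G p γ β e') := by
  rw [levelPSq, levelP_eq_sum_edgeExpectP, sq, Finset.sum_mul_sum, costOp, Finset.sum_mul_sum,
    Finset.sum_mul, trace_sum]
  simp_rw [Finset.sum_mul, trace_sum, ← Finset.sum_sub_distrib]

/-! ### Each summand is at most `1` in norm -/

/-- **The level-`p` QAOA state `|γ, β⟩ = U(B,β_p) U(C,γ_p) ⋯ U(B,β₁) U(C,γ₁) |s⟩`.** [cite:
FarhiGoldstoneGutmann2014, eq. (6)] -/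
def qaoaStateP (p : ℕ) (γ β : Fin p → ℝ) : (V → Bool) → ℂ := qaoaUnitaryP G p γ β *ᵥ plusState

/-- `U ρ₀ U† = |γ, β⟩⟨γ, β|`. [cite: FarhiGoldstoneGutmann2014, eqs. (6)–(7)] -/
theorem finalStateP_eq_vecMulVec (p : ℕ) (γ β : Fin p → ℝ) :
    finalStateP G p γ β = vecMulVec (qaoaStateP G p γ β) (star (qaoaStateP G p γ β)) := by
  rw [finalStateP, initialState_eq_vecMulVec, qaoaStateP, mul_vecMulVec, vecMulVec_mul, ← star_mulVec]

/-- **`F_p(γ, β) = ⟨γ, β| C |γ, β⟩`** at level `p`. [cite: FarhiGoldstoneGutmann2014, eq. (7)] -/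
theorem levelP_eq_expectation (p : ℕ) (γ β : Fin p → ℝ) :
    levelP G p γ β = star (qaoaStateP G p γ β) ⬝ᵥ (costOp G *ᵥ qaoaStateP G p γ β) := by
  rw [levelP, finalStateP_eq_vecMulVec, mul_vecMulVec, trace_vecMulVec, dotProduct_comm]

/-- `⟨s|s⟩ = 1`. [cite: FarhiGoldstoneGutmann2014, eq. (5)] -/
private theorem star_plusState_dotProduct : star plusState ⬝ᵥ (plusState : (V → Bool) → ℂ) = 1 := by
  rw [dotProduct_comm, ← trace_vecMulVec, ← initialState_eq_vecMulVec, trace_initialState]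

/-- `⟨γ, β|γ, β⟩ = 1`. [cite: FarhiGoldstoneGutmann2014, eqs. (5)–(6)] -/
theorem star_qaoaStateP_dotProduct (p : ℕ) (γ β : Fin p → ℝ) :
    star (qaoaStateP G p γ β) ⬝ᵥ qaoaStateP G p γ β = 1 := by
  rw [qaoaStateP, star_mulVec, ← dotProduct_mulVec, mulVec_mulVec, qaoaUnitaryP_conjTranspose_mul_self,
    one_mulVec, star_plusState_dotProduct]

/-- `Σ_z |⟨z|γ, β⟩|² = 1`. [cite: FarhiGoldstoneGutmann2014, eqs. (5)–(6)] -/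
private theorem sum_norm_sq_qaoaStateP (p : ℕ) (γ β : Fin p → ℝ) :
    ∑ x, ‖qaoaStateP G p γ β x‖ ^ 2 = 1 := by
  have h := star_qaoaStateP_dotProduct G p γ β
  rw [dotProduct] at h
  simp_rw [Pi.star_apply, Complex.star_def, Complex.conj_mul'] at h
  exact_mod_cast h

/-- `⟨γ, β| D |γ, β⟩ = Σ_z d(z) |⟨z|γ, β⟩|²` for a real diagonal `D` (measurement in the computational
basis). [cite: FarhiGoldstoneGutmann2014, §1 (“Repeating gives a sample of values of C(z) … whose
mean is F_p(γ, β)”)] -/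
private theorem trace_diagonal_mul_finalStateP (d : (V → Bool) → ℝ) (p : ℕ) (γ β : Fin p → ℝ) :
    (diagonal (fun x => (d x : ℂ)) * finalStateP G p γ β).trace =
      ((∑ x, d x * ‖qaoaStateP G p γ β x‖ ^ 2 : ℝ) : ℂ) := by
  rw [finalStateP_eq_vecMulVec, mul_vecMulVec, trace_vecMulVec, dotProduct]
  push_cast
  refine Finset.sum_congr rfl fun x _ => ?_
  rw [mulVec_diagonal, Pi.star_apply, mul_assoc, Complex.star_def, Complex.mul_conj']

/-- A `[0, 1]`-valued diagonal observable has expectation in `[0, 1]`. [folklore] -/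
private theorem exists_trace_diagonal_mul_finalStateP {d : (V → Bool) → ℝ} (h0 : ∀ x, 0 ≤ d x)
    (h1 : ∀ x, d x ≤ 1) (p : ℕ) (γ β : Fin p → ℝ) :
    ∃ r : ℝ, 0 ≤ r ∧ r ≤ 1 ∧ (diagonal (fun x => (d x : ℂ)) * finalStateP G p γ β).trace = r := by
  refine ⟨∑ x, d x * ‖qaoaStateP G p γ β x‖ ^ 2,
    Finset.sum_nonneg fun x _ => mul_nonneg (h0 x) (sq_nonneg _), ?_,
    trace_diagonal_mul_finalStateP G d p γ β⟩
  calc ∑ x, d x * ‖qaoaStateP G p γ β x‖ ^ 2 ≤ ∑ x, ‖qaoaStateP G p γ β x‖ ^ 2 :=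
        Finset.sum_le_sum fun x _ => mul_le_of_le_one_left (sq_nonneg _) (h1 x)
    _ = 1 := sum_norm_sq_qaoaStateP G p γ β

omit [Fintype V] [DecidableEq V] in
/-- The cut indicator is `0` or `1`. [cite: FarhiGoldstoneGutmann2014, eq. (1) (C_α(z) ∈ {0, 1})] -/
private theorem cutInd_le_one (x : V → Bool) (e : Sym2 V) : cutInd x e ≤ 1 := by
  induction e using Sym2.ind with
  | h a b => rw [cutInd_mk]; split_ifs <;> simp

/-- **“each summand is at most 1 in norm”:** `|⟨C_e C_{e′}⟩ − ⟨C_e⟩⟨C_{e′}⟩| ≤ 1`. [cite: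
FarhiGoldstoneGutmann2014, §3 (sentence after eq. (27))] -/
theorem norm_cov_le_one (p : ℕ) (γ β : Fin p → ℝ) (e e' : Sym2 V) :
    ‖(edgeTerm e * edgeTerm e' * finalStateP G p γ β).trace -
        edgeExpectP G p γ β e * edgeExpectP G p γ β e'‖ ≤ 1 := by
  have hd : ∀ e : Sym2 V, edgeTerm e = diagonal fun x => ((cutInd x e : ℝ) : ℂ) := by
    intro e
    rw [edgeTerm_eq_diagonal]
    simp only [Complex.ofReal_natCast]
  have hdd : edgeTerm e * edgeTerm e' = diagonal fun x => ((cutInd x e * cutInd x e' : ℝ) : ℂ) := by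
    rw [hd, hd, diagonal_mul_diagonal]
    congr
    funext x
    push_cast
    ring
  obtain ⟨r₁, h₁0, h₁1, hr₁⟩ := exists_trace_diagonal_mul_finalStateP G
    (d := fun x => (cutInd x e * cutInd x e' : ℝ))
    (fun x => by positivity)
    (fun x => by
      have := cutInd_le_one x e
      have := cutInd_le_one x e'
      exact_mod_cast mul_le_one' ‹cutInd x e ≤ 1› ‹cutInd x e' ≤ 1›) p γ β
  obtain ⟨r₂, h₂0, h₂1, hr₂⟩ := exists_trace_diagonal_mul_finalStateP G (d := fun x => (cutInd x e : ℝ))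
    (fun x => by positivity) (fun x => by exact_mod_cast cutInd_le_one x e) p γ β
  obtain ⟨r₃, h₃0, h₃1, hr₃⟩ := exists_trace_diagonal_mul_finalStateP G (d := fun x => (cutInd x e' : ℝ))
    (fun x => by positivity) (fun x => by exact_mod_cast cutInd_le_one x e') p γ β
  rw [edgeExpectP, edgeExpectP, hdd, hr₁, hd e, hr₂, hd e', hr₃, ← Complex.ofReal_mul,
    ← Complex.ofReal_sub, Complex.norm_real, Real.norm_eq_abs, abs_le]
  constructor <;> nlinarith [mul_nonneg h₂0 h₃0, mul_le_one₀ h₂1 h₃0 h₃1]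

/-! ### Theorem (27): the variance bound -/

/-- **Concentration (Farhi–Goldstone–Gutmann eq. (27)):** for a graph of maximum degree `v` with
`m` edges, at every level `p` and all angles,
`⟨γ,β| C² |γ,β⟩ − ⟨γ,β| C |γ,β⟩² ≤ 2[((v−1)^{2p+2} − 1)/((v−1) − 1)] · m`
(written with the geometric sum `2 Σ_{i=0}^{2p+1} (v−1)^i`, which is the printed bracket for `v ≥ 3`
and the printed `4p + 4` for `v = 2`), “since each summand is at most 1 in norm. For v and p fixed
we see that the standard deviation of C(z) is at most of order √m.” [cite: FarhiGoldstoneGutmann2014,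
§3 eq. (27)] -/
theorem levelPSq_sub_sq_le (hdeg : ∀ w, G.degree w ≤ v) (p : ℕ) (γ β : Fin p → ℝ) :
    ‖levelPSq G p γ β - levelP G p γ β ^ 2‖ ≤
      ((2 * (∑ i ∈ Finset.range (2 * p + 2), (v - 1) ^ i) * G.edgeFinset.card : ℕ) : ℝ) := by
  rw [levelPSq_sub_sq]
  refine (norm_sum_le _ _).trans ?_
  have per_edge : ∀ e ∈ G.edgeFinset,
      ‖∑ e' ∈ G.edgeFinset, ((edgeTerm e * edgeTerm e' * finalStateP G p γ β).trace -
          edgeExpectP G p γ β e * edgeExpectP G p γ β e')‖ ≤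
        ((2 * ∑ i ∈ Finset.range (2 * p + 2), (v - 1) ^ i : ℕ) : ℝ) := by
    intro e he
    induction e using Sym2.ind with
    | h a b =>
      have hab : G.Adj a b := by rwa [SimpleGraph.mem_edgeFinset, SimpleGraph.mem_edgeSet] at he
      rw [← Finset.sum_filter_add_sum_filter_not G.edgeFinset
        (fun e' => ¬ Disjoint (ball G p {a, b}) (ball G p (verts e')))]
      have hzero : ∑ e' ∈ G.edgeFinset with ¬¬ Disjoint (ball G p {a, b}) (ball G p (verts e')),
          ((edgeTerm s(a, b) * edgeTerm e' * finalStateP G p γ β).trace -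
            edgeExpectP G p γ β s(a, b) * edgeExpectP G p γ β e') = 0 := by
        refine Finset.sum_eq_zero fun e' he' => ?_
        rw [Finset.mem_filter, not_not] at he'
        obtain ⟨-, he'⟩ := he'
        induction e' using Sym2.ind with
        | h a' b' =>
          rw [verts_mk] at he'
          rw [trace_edgeTerm_mul_edgeTerm_mul_finalStateP G γ β he', sub_self]
      rw [hzero, add_zero]
      refine (norm_sum_le _ _).trans ?_
      refine (Finset.sum_le_sum fun e' _ => norm_cov_le_one G p γ β s(a, b) e').trans ?_
      rw [Finset.sum_const, nsmul_eq_mul, mul_one]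
      exact_mod_cast card_filter_not_disjoint_le G hdeg hab p
  refine (Finset.sum_le_sum per_edge).trans ?_
  rw [Finset.sum_const, nsmul_eq_mul]
  push_cast
  ring_nf
  rfl

end Concentration

section Levels

/-! ## The levels and the measurement statistics (Farhi–Goldstone–Gutmann §1)

FGG §1: `M_p = max_{γ,β} F_p(γ,β)` (8); “the maximization at p − 1 can be viewed as a constrained
maximization at p so `M_p ≥ M_{p−1}`” (9); “Measure in the computational basis to get a string z and
evaluate C(z) … The mean of C(z) for strings obtained in this way is” `F_p`; §2: “Repeating gives a
sample of values of C(z) between 0 and +m whose mean is F_p(γ, β). An outcome of at least F_p(γ, β) −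
1 will be obtained with probability 1 − 1/m with order m log m repetitions”; §3: the variance bound
(27) read through Chebyshev (“the distribution of C(z) is actually concentrated near its mean”). We
take `M_p` as the supremum over all real angles (the printed maximum over the compact set
`[0,2π]^p × [0,π]^p` exists by continuity and periodicity, which we do not formalise; the supremum is
the same number whenever the maximum exists). -/

omit [DecidableEq V] in
/-- `U(C, 0) = 1`. [cite: FarhiGoldstoneGutmann2014, eq. (2)] -/
theorem costUnitary_zero : costUnitary G 0 = 1 := by
  rw [costUnitary, ← diagonal_one]
  congr
  funext x
  simp

omit [Fintype V] [DecidableEq V] in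
/-- `e^{−i·0·σ^x} = 1`. [cite: FarhiGoldstoneGutmann2014, eq. (4)] -/
private theorem mixerGate_zero : mixerGate 0 = 1 := by
  rw [mixerGate, Real.cos_zero, Real.sin_zero]
  simp

omit [DecidableEq V] in
/-- `U(B, 0) = 1`. [cite: FarhiGoldstoneGutmann2014, eq. (4)] -/
theorem mixUnitary_zero : (mixUnitary 0 : Matrix (V → Bool) (V → Bool) ℂ) = 1 := by
  rw [mixUnitary]
  simp_rw [mixerGate_zero]
  exact tensorAll_one

/-- **Level `p` inside level `p + 1`:** with `γ_{p+1} = β_{p+1} = 0` the level-`(p+1)` circuit is the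
level-`p` circuit (“the maximization at p − 1 can be viewed as a constrained maximization at p”).
[cite: FarhiGoldstoneGutmann2014, §1 (sentence before eq. (9))] -/
theorem qaoaUnitaryP_snoc_zero (p : ℕ) (γ β : Fin p → ℝ) :
    qaoaUnitaryP G (p + 1) (Fin.snoc γ 0) (Fin.snoc β 0) = qaoaUnitaryP G p γ β := by
  rw [qaoaUnitaryP]
  simp only [Fin.snoc_last, Fin.snoc_castSucc]
  rw [mixUnitary_zero, costUnitary_zero, Matrix.one_mul, Matrix.one_mul]

/-- `F_{p+1}(γ,0; β,0) = F_p(γ; β)`. [cite: FarhiGoldstoneGutmann2014, §1 (sentence before eq. (9))] -/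
theorem levelP_snoc_zero (p : ℕ) (γ β : Fin p → ℝ) :
    levelP G (p + 1) (Fin.snoc γ 0) (Fin.snoc β 0) = levelP G p γ β := by
  rw [levelP, levelP, finalStateP, finalStateP, qaoaUnitaryP_snoc_zero]

omit [DecidableEq V] in
/-- **`γ`-periodicity: `U(C, γ + 2π) = U(C, γ)`** (“Because C has integer eigenvalues we can restrict
γ to lie between 0 and 2π”). [cite: FarhiGoldstoneGutmann2014, §1 (sentence after eq. (2))] -/
theorem costUnitary_add_two_pi (γ : ℝ) : costUnitary G (γ + 2 * Real.pi) = costUnitary G γ := by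
  rw [costUnitary, costUnitary]
  congr
  funext x
  have : -(Complex.I * ((γ + 2 * Real.pi : ℝ) : ℂ) * (cutValue G x : ℂ)) =
      -(Complex.I * γ * (cutValue G x : ℂ)) + -((cutValue G x : ℂ) * (2 * Real.pi * Complex.I)) := by
    push_cast
    ring
  have h1 : Complex.exp (-((cutValue G x : ℂ) * (2 * Real.pi * Complex.I))) = 1 := by
    rw [Complex.exp_neg, Complex.exp_nat_mul, Complex.exp_two_pi_mul_I, one_pow, inv_one]
  rw [this, Complex.exp_add, h1, mul_one]

/-! ### Measuring `|γ, β⟩` in the computational basis -/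

/-- **The outcome distribution `P(z) = |⟨z|γ, β⟩|²`** of the computational-basis measurement
(“Measure in the computational basis to get a string z and evaluate C(z)”). [cite:
FarhiGoldstoneGutmann2014, §1 (paragraph after eq. (10))] -/
def outcomeProb (p : ℕ) (γ β : Fin p → ℝ) (z : V → Bool) : ℝ := ‖qaoaStateP G p γ β z‖ ^ 2

/-- `P(z) ≥ 0`. [folklore] -/
private theorem outcomeProb_nonneg (p : ℕ) (γ β : Fin p → ℝ) (z : V → Bool) : 0 ≤ outcomeProb G p γ β z :=
  sq_nonneg _

/-- `Σ_z P(z) = 1`. [cite: FarhiGoldstoneGutmann2014, eqs. (5)–(6) (|γ, β⟩ is a unit vector)] -/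
theorem sum_outcomeProb (p : ℕ) (γ β : Fin p → ℝ) : ∑ z, outcomeProb G p γ β z = 1 :=
  sum_norm_sq_qaoaStateP G p γ β

/-- **The mean of the measured cut, `Σ_z C(z) P(z)`** — `F_p` as a real number (“The mean of C(z)
for strings obtained in this way is” `F_p`). [cite: FarhiGoldstoneGutmann2014, §1 (last sentence) and
eq. (7)] -/
def meanCut (p : ℕ) (γ β : Fin p → ℝ) : ℝ := ∑ z, (cutValue G z : ℝ) * outcomeProb G p γ β z

/-- **`F_p(γ, β) = Σ_z C(z) |⟨z|γ, β⟩|²`.** [cite: FarhiGoldstoneGutmann2014, eq. (7) and §1 (“The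
mean of C(z) for strings obtained in this way is M_p”)] -/
theorem levelP_eq_meanCut (p : ℕ) (γ β : Fin p → ℝ) : levelP G p γ β = (meanCut G p γ β : ℂ) := by
  rw [levelP, costOp_eq_diagonal]
  have : (diagonal fun x => (cutValue G x : ℂ)) = diagonal fun x => ((cutValue G x : ℝ) : ℂ) := by
    simp only [Complex.ofReal_natCast]
  rw [this, trace_diagonal_mul_finalStateP]
  rfl

/-- **`⟨γ,β| C² |γ,β⟩ = Σ_z C(z)² |⟨z|γ, β⟩|²`.** [cite: FarhiGoldstoneGutmann2014, §3 (display (27))] -/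
theorem levelPSq_eq_sum (p : ℕ) (γ β : Fin p → ℝ) :
    levelPSq G p γ β = ((∑ z, (cutValue G z : ℝ) ^ 2 * outcomeProb G p γ β z : ℝ) : ℂ) := by
  rw [levelPSq, costOp_eq_diagonal, diagonal_mul_diagonal]
  have : (diagonal fun x => (cutValue G x : ℂ) * (cutValue G x : ℂ)) =
      diagonal fun x => (((cutValue G x : ℝ) ^ 2 : ℝ) : ℂ) := by
    congr
    funext x
    push_cast
    ring
  rw [this, trace_diagonal_mul_finalStateP]
  rfl

omit [DecidableEq V] in
/-- `C(z) ≤ m`. [cite: FarhiGoldstoneGutmann2014, §2 (“a sample of values of C(z) between 0 and +m”)] -/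
theorem cutValue_le_card (x : V → Bool) : cutValue G x ≤ #G.edgeFinset := by
  rw [cutValue]
  calc ∑ e ∈ G.edgeFinset, cutInd x e ≤ ∑ e ∈ G.edgeFinset, 1 := Finset.sum_le_sum fun e _ => cutInd_le_one x e
    _ = #G.edgeFinset := by simp

/-- `0 ≤ F_p`. [cite: FarhiGoldstoneGutmann2014, §2 (“a sample of values of C(z) between 0 and +m whose
mean is F_p”)] -/
theorem meanCut_nonneg (p : ℕ) (γ β : Fin p → ℝ) : 0 ≤ meanCut G p γ β :=
  Finset.sum_nonneg fun z _ => mul_nonneg (Nat.cast_nonneg _) (outcomeProb_nonneg G p γ β z)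

/-- `F_p ≤ m`. [cite: FarhiGoldstoneGutmann2014, §2 (“a sample of values of C(z) between 0 and +m whose
mean is F_p”)] -/
theorem meanCut_le_card (p : ℕ) (γ β : Fin p → ℝ) : meanCut G p γ β ≤ #G.edgeFinset := by
  calc meanCut G p γ β ≤ ∑ z, (#G.edgeFinset : ℝ) * outcomeProb G p γ β z :=
        Finset.sum_le_sum fun z _ => mul_le_mul_of_nonneg_right
          (by exact_mod_cast cutValue_le_card G z) (outcomeProb_nonneg G p γ β z)
    _ = #G.edgeFinset := by rw [← Finset.mul_sum, sum_outcomeProb, mul_one]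

/-- **`max_z C(z)`, the MaxCut value.** [cite: FarhiGoldstoneGutmann2014, eq. (10) (max_z C(z))] -/
def maxCut : ℕ := Finset.univ.sup (cutValue G)

/-- `F_p ≤ max_z C(z)`. [cite: FarhiGoldstoneGutmann2014, eqs. (7), (10)] -/
theorem meanCut_le_maxCut (p : ℕ) (γ β : Fin p → ℝ) : meanCut G p γ β ≤ maxCut G := by
  calc meanCut G p γ β ≤ ∑ z, (maxCut G : ℝ) * outcomeProb G p γ β z :=
        Finset.sum_le_sum fun z _ => mul_le_mul_of_nonneg_right
          (by exact_mod_cast Finset.le_sup (f := cutValue G) (Finset.mem_univ z))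
          (outcomeProb_nonneg G p γ β z)
    _ = maxCut G := by rw [← Finset.mul_sum, sum_outcomeProb, mul_one]

/-- Level `p` sits inside level `p + 1` at the level of the measured mean. [cite:
FarhiGoldstoneGutmann2014, §1 (sentence before eq. (9))] -/
theorem meanCut_snoc_zero (p : ℕ) (γ β : Fin p → ℝ) :
    meanCut G (p + 1) (Fin.snoc γ 0) (Fin.snoc β 0) = meanCut G p γ β := by
  unfold meanCut outcomeProb qaoaStateP
  rw [qaoaUnitaryP_snoc_zero]

/-! ### `M_p` and its monotonicity (8)–(9) -/

/-- **`M_p = max_{γ,β} F_p(γ, β)`** (8), taken as the supremum over all real angles. [cite: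
FarhiGoldstoneGutmann2014, eq. (8)] -/
def maxLevel (p : ℕ) : ℝ := ⨆ a : (Fin p → ℝ) × (Fin p → ℝ), meanCut G p a.1 a.2

/-- The level-`p` values are bounded by `m`. [cite: FarhiGoldstoneGutmann2014, §2 (values of C(z)
between 0 and +m)] -/
private theorem bddAbove_meanCut (p : ℕ) :
    BddAbove (Set.range fun a : (Fin p → ℝ) × (Fin p → ℝ) => meanCut G p a.1 a.2) :=
  ⟨#G.edgeFinset, by rintro _ ⟨a, rfl⟩; exact meanCut_le_card G p a.1 a.2⟩

/-- `F_p(γ, β) ≤ M_p`. [cite: FarhiGoldstoneGutmann2014, eq. (8)] -/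
theorem meanCut_le_maxLevel (p : ℕ) (γ β : Fin p → ℝ) : meanCut G p γ β ≤ maxLevel G p :=
  le_ciSup (bddAbove_meanCut G p) (γ, β)

/-- `M_p ≤ m`. [cite: FarhiGoldstoneGutmann2014, eq. (8) and §2 (C(z) ≤ m)] -/
theorem maxLevel_le_card (p : ℕ) : maxLevel G p ≤ #G.edgeFinset :=
  ciSup_le fun a => meanCut_le_card G p a.1 a.2

/-- `M_p ≤ max_z C(z)` (the trivial half of (10); the limit statement (10) itself is not formalised).
[cite: FarhiGoldstoneGutmann2014, eqs. (8), (10)] -/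
theorem maxLevel_le_maxCut (p : ℕ) : maxLevel G p ≤ maxCut G :=
  ciSup_le fun a => meanCut_le_maxCut G p a.1 a.2

/-- **`M_{p+1} ≥ M_p`** (9): “the maximization at p − 1 can be viewed as a constrained maximization
at p”. [cite: FarhiGoldstoneGutmann2014, eq. (9)] -/
theorem maxLevel_mono (p : ℕ) : maxLevel G p ≤ maxLevel G (p + 1) :=
  ciSup_le fun a => by
    rw [← meanCut_snoc_zero]
    exact meanCut_le_maxLevel G (p + 1) _ _

/-! ### Spread of the measured cut: variance, Chebyshev, and the §1 sampling bound -/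

/-- **The variance of the measured cut, `Σ_z (C(z) − F_p)² P(z)`.** [cite: FarhiGoldstoneGutmann2014,
§3 (“the spread of C measured in the state |γ, β⟩”, display (27))] -/
def varCut (p : ℕ) (γ β : Fin p → ℝ) : ℝ :=
  ∑ z, ((cutValue G z : ℝ) - meanCut G p γ β) ^ 2 * outcomeProb G p γ β z

/-- `Var = Σ C² P − F_p²`. [folklore] -/
private theorem varCut_eq (p : ℕ) (γ β : Fin p → ℝ) :
    varCut G p γ β = (∑ z, (cutValue G z : ℝ) ^ 2 * outcomeProb G p γ β z) - meanCut G p γ β ^ 2 := by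
  unfold varCut
  have h1 := sum_outcomeProb G p γ β
  have hF : ∑ z, (cutValue G z : ℝ) * outcomeProb G p γ β z = meanCut G p γ β := rfl
  set F := meanCut G p γ β
  calc ∑ z, ((cutValue G z : ℝ) - F) ^ 2 * outcomeProb G p γ β z
      = ∑ z, ((cutValue G z : ℝ) ^ 2 * outcomeProb G p γ β z -
          2 * F * ((cutValue G z : ℝ) * outcomeProb G p γ β z) + F ^ 2 * outcomeProb G p γ β z) :=
        Finset.sum_congr rfl fun z _ => by ring
    _ = (∑ z, (cutValue G z : ℝ) ^ 2 * outcomeProb G p γ β z) -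
          2 * F * ∑ z, (cutValue G z : ℝ) * outcomeProb G p γ β z + F ^ 2 * ∑ z, outcomeProb G p γ β z := by
        rw [Finset.sum_add_distrib, Finset.sum_sub_distrib, ← Finset.mul_sum, ← Finset.mul_sum]
    _ = _ := by rw [hF, h1]; ring

/-- **`⟨C²⟩ − ⟨C⟩² = Σ_z (C(z) − F_p)² P(z)`**: the left side of (27) is the variance of the measured
cut. [cite: FarhiGoldstoneGutmann2014, §3 (display (27), “the spread of C measured in the state”)] -/
theorem levelPSq_sub_sq_eq_varCut (p : ℕ) (γ β : Fin p → ℝ) :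
    levelPSq G p γ β - levelP G p γ β ^ 2 = (varCut G p γ β : ℂ) := by
  rw [levelPSq_eq_sum, levelP_eq_meanCut, varCut_eq]
  push_cast
  ring

variable {v : ℕ}

/-- **The variance bound (27) for the measured cut:** `Σ_z (C(z) − F_p)² P(z) ≤ 2 (Σ_{i=0}^{2p+1}
(v−1)^i) · m` (“For v and p fixed we see that the standard deviation of C(z) is at most of order
√m”). [cite: FarhiGoldstoneGutmann2014, §3 eq. (27)] -/
theorem varCut_le (hdeg : ∀ w, G.degree w ≤ v) (p : ℕ) (γ β : Fin p → ℝ) :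
    varCut G p γ β ≤ ((2 * (∑ i ∈ Finset.range (2 * p + 2), (v - 1) ^ i) * G.edgeFinset.card : ℕ) : ℝ) := by
  have h := levelPSq_sub_sq_le G hdeg p γ β
  rw [levelPSq_sub_sq_eq_varCut, Complex.norm_real, Real.norm_eq_abs] at h
  exact (le_abs_self _).trans h

/-- **Chebyshev for the measured cut:** `P(|C(z) − F_p| ≥ t) ≤ Var / t²`. [cite:
FarhiGoldstoneGutmann2014, §3 (“the distribution of C(z) is actually concentrated near its mean”,
“the sample mean of order m² values of C(z) will be within 1 of F_p(γ, β) with probability 1 −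
1/m”)] -/
theorem sum_outcomeProb_filter_le (p : ℕ) (γ β : Fin p → ℝ) {t : ℝ} (ht : 0 < t) :
    ∑ z ∈ Finset.univ.filter (fun z => t ≤ |(cutValue G z : ℝ) - meanCut G p γ β|), outcomeProb G p γ β z ≤
      varCut G p γ β / t ^ 2 := by
  rw [le_div_iff₀ (pow_pos ht 2), Finset.sum_mul]
  calc ∑ z ∈ Finset.univ.filter (fun z => t ≤ |(cutValue G z : ℝ) - meanCut G p γ β|),
        outcomeProb G p γ β z * t ^ 2
      ≤ ∑ z ∈ Finset.univ.filter (fun z => t ≤ |(cutValue G z : ℝ) - meanCut G p γ β|),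
          ((cutValue G z : ℝ) - meanCut G p γ β) ^ 2 * outcomeProb G p γ β z :=
        Finset.sum_le_sum fun z hz => by
          rw [Finset.mem_filter] at hz
          have h : t ^ 2 ≤ ((cutValue G z : ℝ) - meanCut G p γ β) ^ 2 := by
            rw [← sq_abs ((cutValue G z : ℝ) - _)]
            exact pow_le_pow_left₀ ht.le hz.2 2
          rw [mul_comm]
          exact mul_le_mul_of_nonneg_right h (outcomeProb_nonneg G p γ β z)
    _ ≤ varCut G p γ β :=
        Finset.sum_le_sum_of_subset_of_nonneg (Finset.filter_subset _ _)
          fun z _ _ => mul_nonneg (sq_nonneg _) (outcomeProb_nonneg G p γ β z)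

/-- **Concentration of the measured cut (FGG §3):** for maximum degree `v`,
`P(|C(z) − F_p| ≥ t) ≤ 2 (Σ_{i=0}^{2p+1} (v−1)^i) · m / t²`. [cite: FarhiGoldstoneGutmann2014, §3
(eq. (27) and “The concentration of the distribution of C(z) also means that there is only a small
probability that the algorithm will produce strings with C(z) much bigger than F_p(γ, β)”)] -/
theorem sum_outcomeProb_filter_le_of_degree (hdeg : ∀ w, G.degree w ≤ v) (p : ℕ) (γ β : Fin p → ℝ)
    {t : ℝ} (ht : 0 < t) :
    ∑ z ∈ Finset.univ.filter (fun z => t ≤ |(cutValue G z : ℝ) - meanCut G p γ β|), outcomeProb G p γ β z ≤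
      ((2 * (∑ i ∈ Finset.range (2 * p + 2), (v - 1) ^ i) * G.edgeFinset.card : ℕ) : ℝ) / t ^ 2 :=
  (sum_outcomeProb_filter_le G p γ β ht).trans
    (div_le_div_of_nonneg_right (varCut_le G hdeg p γ β) (pow_pos ht 2).le)

/-- **One measurement gives `C(z) ≥ F_p − 1` with probability at least `1/(m + 1)`** (Markov's
inequality on `m − C(z) ≥ 0`; this is the single-shot step behind “An outcome of at least F_p(γ, β)
− 1 will be obtained with probability 1 − 1/m with order m log m repetitions” — the repetition count
itself, a statement about independent runs, is not modelled). [cite: FarhiGoldstoneGutmann2014, §2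
(paragraph after eq. (25))] -/
theorem inv_le_sum_outcomeProb_filter (p : ℕ) (γ β : Fin p → ℝ) :
    1 / ((#G.edgeFinset : ℝ) + 1) ≤
      ∑ z ∈ Finset.univ.filter (fun z => meanCut G p γ β - 1 ≤ (cutValue G z : ℝ)), outcomeProb G p γ β z := by
  set F := meanCut G p γ β with hFdef
  set m : ℝ := (#G.edgeFinset : ℝ) with hm
  set A := Finset.univ.filter (fun z => F - 1 ≤ (cutValue G z : ℝ))
  set PA := ∑ z ∈ A, outcomeProb G p γ β z
  have hPA0 : 0 ≤ PA := Finset.sum_nonneg fun z _ => outcomeProb_nonneg G p γ β z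
  have hF0 : 0 ≤ F := meanCut_nonneg G p γ β
  have hsplitP := Finset.sum_filter_add_sum_filter_not Finset.univ
    (fun z => F - 1 ≤ (cutValue G z : ℝ)) (outcomeProb G p γ β)
  rw [sum_outcomeProb] at hsplitP
  have hsplitF := Finset.sum_filter_add_sum_filter_not Finset.univ
    (fun z => F - 1 ≤ (cutValue G z : ℝ)) (fun z => (cutValue G z : ℝ) * outcomeProb G p γ β z)
  have hF : ∑ z, (cutValue G z : ℝ) * outcomeProb G p γ β z = F := rfl
  rw [hF] at hsplitF
  have hCm : ∀ z, (cutValue G z : ℝ) ≤ m := fun z => by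
    rw [hm]
    exact_mod_cast cutValue_le_card G z
  have h1 : ∑ z ∈ A, (cutValue G z : ℝ) * outcomeProb G p γ β z ≤ m * PA := by
    rw [Finset.mul_sum]
    exact Finset.sum_le_sum fun z _ => mul_le_mul_of_nonneg_right (hCm z) (outcomeProb_nonneg G p γ β z)
  have h2 : ∑ z ∈ Finset.univ.filter (fun z => ¬ (F - 1 ≤ (cutValue G z : ℝ))),
      (cutValue G z : ℝ) * outcomeProb G p γ β z ≤ (F - 1) * (1 - PA) := by
    have hc : ∑ z ∈ Finset.univ.filter (fun z => ¬ (F - 1 ≤ (cutValue G z : ℝ))), outcomeProb G p γ β z = 1 - PA := by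
      linarith
    rw [← hc, Finset.mul_sum]
    exact Finset.sum_le_sum fun z hz => by
      rw [Finset.mem_filter, not_le] at hz
      exact mul_le_mul_of_nonneg_right hz.2.le (outcomeProb_nonneg G p γ β z)
  have key : 1 ≤ PA * (m + 1) := by nlinarith [mul_nonneg hF0 hPA0]
  rw [div_le_iff₀ (by positivity)]
  linarith

end Levels



end QAOA

end Literature.Computability.QuantumComplexity
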